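import Literature.Barriers.CriticalPhenomena.PlaquetteWalkHoleRootDiagonalCellTurning
import Literature.Barriers.CriticalPhenomena.PlaquetteWalkHoleRootLateralCellLaw
import HarnessLib

/-!
# Barrier catalogue (SAWScalingLimit): the TURNING RIGIDITY at the remaining cells of the ring of a hole root — the three
other diagonal cells and the south lateral cell

Companion of `PlaquetteWalkHoleRootDiagonalCellTurning` (the `SW` diagonal cell `farSW w` of the hole root
`a = w.side W`, hole `h = holeFaceW w = (w.1 − 1, w.2) ∉ D`: a table-driven two-Umlaufsätze engine
`YBWalk.diagCyc_hopf` / `YBWalk.sum_extAng_diagCyc`, parametrised over the cell; turning rigidity for all four first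
sides, entry–exit exclusion, the diagonal-cell law). This file runs the SAME engine at the four remaining cells of the
RING of the hole (the eight cells king-adjacent to `h`), in the frame of `farSW w` (mesh 4, origin `(farSW w).base`;
root midpoint `(8, 6)`):

* `rootS w = (w.1, w.2 − 1)` — SOUTH of the root plaquette, the `SE` neighbour of the hole (base offset `(8, 0)`,
  corner `(8, 4)` with the hole, closing straight up the root edge to `(8, 6)`);
* `rootN w` (this catalogue's `PlaquetteWalkHoleRootLateralCellLaw`) — NORTH of the root plaquette, the `NE`
  neighbour (base offset `(8, 8)`, corner `(8, 8)`, closing straight down to `(8, 6)`);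
* `farNW w` (this catalogue's `PlaquetteWalkHoleRootFarCellLaw`) — the `NW` neighbour (base offset `(0, 8)`, corner
  `(4, 8)`, closing `(4, 8) → (5, 7) → ctr h → (8, 6)`);
* `latS w = (w.1 − 1, w.2 − 1)` — the lateral cell SOUTH of the hole (base offset `(4, 0)`; dead side `N`; closing
  through the midpoint `(6, 4)` of the dead side into the hole: `(6, 4) → ctr h → (8, 6)`).

## Results (all unconditional; axioms `propext`, `Classical.choice`, `Quot.sound`)

Cell-parametric plumbing (any cell `c` with `RootedFace D (w.side W) c`, root not a side of `c`): `ΩG.preC`,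
`ΩG.WP_hopf_of_tables_cell`, `ΩG.winding_hopf_of_tables_cell`, `ΩG.winding_eq_WP_add_cell`, `ΩG.WP_cell_of_pinned`,
`ΩG.WE_sub_excursionWinding_const_cell`; safe closing lists `safeOffsetsSE/NE/NW` with their `≥ 5` lemmas.
Per diagonal cell (`XX ∈ {SE, NE, NW}`): ★★ `ΩG.WP_XX_pi_div_two_mem` (prefix polygon: two candidates `4π` apart
per first side), sixteen `ΩG.winding_XX_z₀z₁z₂` (whole-walk polygon), eight `ΩG.WP_XX_z₀z₁z₂` (pinned) and eight
`ΩG.no_XX_z₀z₁z₂` (impossible, both orientations), ★★★ `ΩG.WP_XX_pi_div_two_eq_of_wound` / `ΩG.WP_XX_eq_of_wound` and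
★★ `ΩG.XX_entry_exit_exclusion`; for the lateral cell (`LS`): `ΩG.LS_sides_ne_N` (dead side), three prefix
candidates, four whole-walk instances, ★★★ `ΩG.WP_LS_eq_of_wound` and ★★ `ΩG.LS_firstSide_eq_E_or_W`:

* **SE** (`rootS`): wound ⇒ `WP(θ) = θ − π` (`N`, straight from the root plaquette), `−π` (`E`), `2π + θ` (`S`), `2π`
  (`W`); `(a, b) = (0, −1), (−1, −1), (3, 2), (2, 2)`. Exclusion: an `E`-entry never uses `N`, an `S`-entry never uses `W`.
* **NE** (`rootN`): wound ⇒ `WP(θ) = θ − 3π` (`N`), `π` (`E`), `θ` (`S`, straight from the root plaquette), `−2π` (`W`);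
  `(a, b) = (−2, −3), (1, 1), (1, 0), (−2, −2)`. Exclusion: an `N`-entry never uses `W`, an `E`-entry never uses `S`.
* **NW** (`farNW`): wound ⇒ `WP(θ) = π + θ` (`N`), `π` (`E`), `θ − 2π` (`S`), `−2π` (`W`);
  `(a, b) = (2, 1), (1, 1), (−1, −2), (−2, −2)`. Exclusion: an `N`-entry never uses `E`, a `W`-entry never uses `S`.
* **LS** (`latS`): wound ⇒ `WP(θ) = −π` (`E`), `2π` (`W`) — the row-mirror images of the lateral file's `π`, `−2π` at
  `latN`; and EVERY class-`B2a` walk at `latS`, wound or not, enters from `E` or from `W` (the companion files' (R1)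
  `firstSide_lateral_of_wound` needed woundness): an `S`-entry would need an excursion joining the `E` and `W` sides.

Together with the root's own plaquette (`PlaquetteWalkRootPlaquetteDefectLaw`; empty prefix), the far cell
(`…FarCellLaw`), the lateral cell `latN` (`…LateralCellLaw`) and the `SW` diagonal cell (`…DiagonalCellTurning`), the
prefix turning of a wound excursion is now PROVED RIGID per (cell, first side) at EVERY cell of the ring of a hole root —
the venture lane's census fact «ring rigidity, 0 / 621 980 violations on 148 ring cells of 31 domains» (seat b-step0
gen 18) as theorems, with the values
the census found (`SE`: `N (0, −1)`, `W (2, 2)`; `NE`: `W (−2, −2)`, `S (1, 0)`; `NW`: `S (−1, −2)`, `E (1, 1)`, `W (−2, −2)`)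
and the entries it could not see (`SE`: `E`, `S`; `NE`: `N`, `E`; `NW`: `N`). The `NW` values are the row-mirror images
(`N ↔ S`, turning negated) of the `SW` file's, the `NE` values those of `SE` — as they must be
(`PlaquetteWalkMirrorDuality`); here each cell is proved directly.

The finite tables (closings, octant sums, pinned values, impossible classes) were designed by
`code/step0/g19/turning/ring_design.py` of the venture lane and are all re-derived inside Lean by `decide`.

References, as printed: A. Glazman, I. Manolescu, arXiv:1708.00395v3, Lemma 2.1 (p. 6, «in the form given in
[Gl]») [GlazmanManolescu2019]; A. Glazman, Electron. Commun. Probab. 20 (2015) no. 86, Lemma 3.1 and its proof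
pp. 6–7 [Glazman2015WeightedSAW]; H. Duminil-Copin, S. Smirnov, Ann. of Math. 175 (2012), Lemma 1, proof («… we
used the fact that a is on the boundary and Ω is simply connected») [DuminilCopinSmirnov2012]; H. Hopf, Compositio
Math. 2 (1935) 50–62, Nr. 2 (Umlaufsatz, p. 53) and Nr. 4 eq. (22) (curves with corners, pp. 60–61) [Hopf1935].
Status: lane theorems, not located in print. NOT claimed: the class directions / cell laws at these four cells (the
`backBracket` algebra is not run here), cells outside the ring. Written for the venture lane
«pcv-sawmu» (Tier B, b-step0 gen 19).
-/

noncomputable section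

/-! ## The cells of the ring in the diagonal-cell frame -/

namespace Literature.Probability.RandomPlanarGeometry.SAW.YangBaxter

open Real Complex

section RingCells

variable (w : Face)

/-- The cell SOUTH of the root plaquette (the `SE` diagonal neighbour of the hole). [cite: GlazmanManolescu2019, §1 (the lattice of rhombi and its mid-edges)] -/
def rootS : Face := (w.1, w.2 - 1)

/-- `rootS` in the diagonal-cell frame: base offset `(8, 0)`. [cite: GlazmanManolescu2019, §1 (the lattice of rhombi and its mid-edges)] -/
theorem rootS_base : (rootS w).base = (farSW w).base + (8, 0) := by
  obtain ⟨k, j⟩ := w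
  refine Prod.ext ?_ ?_
  · show 4 * k = 4 * (k - 2) + 8
    omega
  · show 4 * (j - 1) = 4 * (j - 1) + 0
    omega

/-- `rootN` (the cell NORTH of the root plaquette, the `NE` diagonal neighbour of the hole) in the diagonal-cell frame:
base offset `(8, 8)`. [cite: GlazmanManolescu2019, §1 (the lattice of rhombi and its mid-edges)] -/
theorem rootN_base : (rootN w).base = (farSW w).base + (8, 8) := by
  obtain ⟨k, j⟩ := w
  refine Prod.ext ?_ ?_
  · show 4 * k = 4 * (k - 2) + 8
    omega
  · show 4 * (j + 1) = 4 * (j - 1) + 8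
    omega

/-- `farNW` (the `NW` diagonal neighbour of the hole) in the diagonal-cell frame: base offset `(0, 8)`.
[cite: GlazmanManolescu2019, §1 (the lattice of rhombi and its mid-edges)] -/
theorem farNW_base : (farNW w).base = (farSW w).base + (0, 8) := by
  obtain ⟨k, j⟩ := w
  refine Prod.ext ?_ ?_
  · show 4 * (k - 2) = 4 * (k - 2) + 0
    omega
  · show 4 * (j + 1) = 4 * (j - 1) + 8
    omega

/-- The lateral cell SOUTH of the hole (the row-mirror image of `latN`). [cite: GlazmanManolescu2019, §1 (the lattice of rhombi and its mid-edges)] -/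
def latS : Face := (w.1 - 1, w.2 - 1)

/-- `latS` in the diagonal-cell frame: base offset `(4, 0)`. [cite: GlazmanManolescu2019, §1 (the lattice of rhombi and its mid-edges)] -/
theorem latS_base : (latS w).base = (farSW w).base + (4, 0) := by
  obtain ⟨k, j⟩ := w
  refine Prod.ext ?_ ?_
  · show 4 * (k - 1) = 4 * (k - 2) + 4
    omega
  · show 4 * (j - 1) = 4 * (j - 1) + 0
    omega

/-- The root is not a side of `latS`. [cite: GlazmanManolescu2019, §1 (the lattice of rhombi and its mid-edges); lane plumbing] -/
theorem latS_side_ne_root (t : Side) : (latS w).side t ≠ w.side .W := by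
  obtain ⟨k, j⟩ := w
  cases t <;> simp only [latS, Face.side, ne_eq, MidEdge.vert.injEq, reduceCtorEq, not_false_eq_true] <;> omega

/-- The root is not a side of `rootS`. [cite: GlazmanManolescu2019, §1 (the lattice of rhombi and its mid-edges); lane plumbing] -/
theorem rootS_side_ne_root (t : Side) : (rootS w).side t ≠ w.side .W := by
  obtain ⟨k, j⟩ := w
  cases t <;> simp only [rootS, Face.side, ne_eq, MidEdge.vert.injEq, reduceCtorEq, not_false_eq_true] <;> omega

/-- The root is not a side of `rootN`. [cite: GlazmanManolescu2019, §1 (the lattice of rhombi and its mid-edges); lane plumbing] -/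
theorem rootN_side_ne_root (t : Side) : (rootN w).side t ≠ w.side .W := by
  obtain ⟨k, j⟩ := w
  cases t <;> simp only [rootN, Face.side, ne_eq, MidEdge.vert.injEq, reduceCtorEq, not_false_eq_true] <;> omega

/-- The root is not a side of `farNW`. [cite: GlazmanManolescu2019, §1 (the lattice of rhombi and its mid-edges); lane plumbing] -/
theorem farNW_side_ne_root (t : Side) : (farNW w).side t ≠ w.side .W := by
  obtain ⟨k, j⟩ := w
  cases t <;> simp only [farNW, Face.side, ne_eq, MidEdge.vert.injEq, reduceCtorEq, not_false_eq_true] <;> omega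

/-- A cell of the domain is a rooted rhombus of the hole root as soon as the hole is not in the domain.
[cite: GlazmanManolescu2019, Lemma 2.1 (setting: a rhombus of the domain and a boundary root)] -/
theorem rootedFace_of_hole {D : Set Face} {w c : Face} (hf : c ∈ D) (hh : holeFaceW w ∉ D) :
    RootedFace D (w.side .W) c := by
  refine ⟨hf, ?_⟩
  rw [root_faces_W]
  exact fun hb => hh hb.1

end RingCells

/-! ## Safe closing points for the three cells -/

section RingSafe

/-- Safe closing offsets for `rootS` (frame of `farSW`): odd-odd points and centre of the cell, its corner with the hole,
two points inside the hole. [folklore] -/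
def safeOffsetsSE : List (ℤ × ℤ) := [(9, 1), (9, 3), (11, 1), (11, 3), (10, 2), (8, 4), (7, 5), (6, 6)]

/-- Safe closing offsets for `rootN`. [folklore] -/
def safeOffsetsNE : List (ℤ × ℤ) := [(9, 9), (9, 11), (11, 9), (11, 11), (10, 10), (8, 8), (7, 7), (6, 6)]

/-- Safe closing offsets for `farNW`. [folklore] -/
def safeOffsetsNW : List (ℤ × ℤ) := [(1, 9), (1, 11), (3, 9), (3, 11), (2, 10), (4, 8), (5, 7), (6, 6)]

/-- Safe closing offsets for `latS` (the closing leaves through the midpoint of the dead side into the hole). [folklore] -/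
def safeOffsetsLS : List (ℤ × ℤ) := [(5, 1), (5, 3), (7, 1), (7, 3), (6, 2), (6, 4), (6, 5), (6, 6)]

/-- `x² + y² ≥ 5` from a linear case description. [folklore] -/
private theorem five_le_sq_add_sq_ring {x y : ℤ}
    (h : 3 ≤ x ∨ x ≤ -3 ∨ 3 ≤ y ∨ y ≤ -3 ∨ ((2 ≤ x ∨ x ≤ -2) ∧ (1 ≤ y ∨ y ≤ -1)) ∨
      ((1 ≤ x ∨ x ≤ -1) ∧ (2 ≤ y ∨ y ≤ -2))) : 5 ≤ x ^ 2 + y ^ 2 := by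
  rcases h with h | h | h | h | ⟨h1, h2⟩ | ⟨h1, h2⟩
  · nlinarith [sq_nonneg y, mul_nonneg (show (0:ℤ) ≤ x - 3 by omega) (show (0:ℤ) ≤ x + 3 by omega)]
  · nlinarith [sq_nonneg y, mul_nonneg (show (0:ℤ) ≤ -x - 3 by omega) (show (0:ℤ) ≤ -x + 3 by omega)]
  · nlinarith [sq_nonneg x, mul_nonneg (show (0:ℤ) ≤ y - 3 by omega) (show (0:ℤ) ≤ y + 3 by omega)]
  · nlinarith [sq_nonneg x, mul_nonneg (show (0:ℤ) ≤ -y - 3 by omega) (show (0:ℤ) ≤ -y + 3 by omega)]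
  · have hx : 4 ≤ x ^ 2 := by rcases h1 with h1 | h1 <;> nlinarith
    have hy : 1 ≤ y ^ 2 := by rcases h2 with h2 | h2 <;> nlinarith
    omega
  · have hx : 1 ≤ x ^ 2 := by rcases h1 with h1 | h1 <;> nlinarith
    have hy : 4 ≤ y ^ 2 := by rcases h2 with h2 | h2 <;> nlinarith
    omega

/-- The inner offsets lie in `{1, 2, 3}²`, one coordinate being `2`. [folklore] -/
private theorem inOff_cases_ring (s : Side) :
    (s.inOff.1 = 2 ∧ (s.inOff.2 = 1 ∨ s.inOff.2 = 3)) ∨ (s.inOff.2 = 2 ∧ (s.inOff.1 = 1 ∨ s.inOff.1 = 3)) := by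
  cases s <;> simp [Side.inOff, Side.offset, Side.nIn]

/-- ★ Inner points of faces other than `rootS w` and the hole stay at squared distance `≥ 5` from `safeOffsetsSE`.
[cite: Hopf1935, Nr. 4 eq. (22) (curves with corners); lane plumbing] -/
theorem five_le_dsq_innerPt_safeOffsetsSE {w : Face} (g : Face) (s : Side) (hg : g ≠ rootS w)
    (hh : g ≠ holeFaceW w) (q : ℤ × ℤ) (hq : q ∈ safeOffsetsSE) : 5 ≤ dsq (innerPt g s) ((farSW w).base + q) := by
  obtain ⟨k, j⟩ := g
  obtain ⟨a, c⟩ := w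
  have hne : ¬(k = a ∧ j = c - 1) := fun e => hg (Prod.ext e.1 e.2)
  have hne' : ¬(k = a - 1 ∧ j = c) := fun e => hh (Prod.ext e.1 e.2)
  have hs := inOff_cases_ring s
  simp only [dsq, innerPt, Face.base, farSW, Prod.fst_add, Prod.snd_add]
  set ox := s.inOff.1
  set oy := s.inOff.2
  apply five_le_sq_add_sq_ring
  simp only [safeOffsetsSE, List.mem_cons, List.mem_nil_iff, or_false] at hq
  rcases hq with rfl | rfl | rfl | rfl | rfl | rfl | rfl | rfl <;> simp only <;> omega

/-- ★ The `rootN` twin. [cite: Hopf1935, Nr. 4 eq. (22) (curves with corners); lane plumbing] -/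
theorem five_le_dsq_innerPt_safeOffsetsNE {w : Face} (g : Face) (s : Side) (hg : g ≠ rootN w)
    (hh : g ≠ holeFaceW w) (q : ℤ × ℤ) (hq : q ∈ safeOffsetsNE) : 5 ≤ dsq (innerPt g s) ((farSW w).base + q) := by
  obtain ⟨k, j⟩ := g
  obtain ⟨a, c⟩ := w
  have hne : ¬(k = a ∧ j = c + 1) := fun e => hg (Prod.ext e.1 e.2)
  have hne' : ¬(k = a - 1 ∧ j = c) := fun e => hh (Prod.ext e.1 e.2)
  have hs := inOff_cases_ring s
  simp only [dsq, innerPt, Face.base, farSW, Prod.fst_add, Prod.snd_add]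
  set ox := s.inOff.1
  set oy := s.inOff.2
  apply five_le_sq_add_sq_ring
  simp only [safeOffsetsNE, List.mem_cons, List.mem_nil_iff, or_false] at hq
  rcases hq with rfl | rfl | rfl | rfl | rfl | rfl | rfl | rfl <;> simp only <;> omega

/-- ★ The `farNW` twin. [cite: Hopf1935, Nr. 4 eq. (22) (curves with corners); lane plumbing] -/
theorem five_le_dsq_innerPt_safeOffsetsNW {w : Face} (g : Face) (s : Side) (hg : g ≠ farNW w)
    (hh : g ≠ holeFaceW w) (q : ℤ × ℤ) (hq : q ∈ safeOffsetsNW) : 5 ≤ dsq (innerPt g s) ((farSW w).base + q) := by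
  obtain ⟨k, j⟩ := g
  obtain ⟨a, c⟩ := w
  have hne : ¬(k = a - 2 ∧ j = c + 1) := fun e => hg (Prod.ext e.1 e.2)
  have hne' : ¬(k = a - 1 ∧ j = c) := fun e => hh (Prod.ext e.1 e.2)
  have hs := inOff_cases_ring s
  simp only [dsq, innerPt, Face.base, farSW, Prod.fst_add, Prod.snd_add]
  set ox := s.inOff.1
  set oy := s.inOff.2
  apply five_le_sq_add_sq_ring
  simp only [safeOffsetsNW, List.mem_cons, List.mem_nil_iff, or_false] at hq
  rcases hq with rfl | rfl | rfl | rfl | rfl | rfl | rfl | rfl <;> simp only <;> omega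

/-- ★ The `latS` twin. [cite: Hopf1935, Nr. 4 eq. (22) (curves with corners); lane plumbing] -/
theorem five_le_dsq_innerPt_safeOffsetsLS {w : Face} (g : Face) (s : Side) (hg : g ≠ latS w)
    (hh : g ≠ holeFaceW w) (q : ℤ × ℤ) (hq : q ∈ safeOffsetsLS) : 5 ≤ dsq (innerPt g s) ((farSW w).base + q) := by
  obtain ⟨k, j⟩ := g
  obtain ⟨a, c⟩ := w
  have hne : ¬(k = a - 1 ∧ j = c - 1) := fun e => hg (Prod.ext e.1 e.2)
  have hne' : ¬(k = a - 1 ∧ j = c) := fun e => hh (Prod.ext e.1 e.2)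
  have hs := inOff_cases_ring s
  simp only [dsq, innerPt, Face.base, farSW, Prod.fst_add, Prod.snd_add]
  set ox := s.inOff.1
  set oy := s.inOff.2
  apply five_le_sq_add_sq_ring
  simp only [safeOffsetsLS, List.mem_cons, List.mem_nil_iff, or_false] at hq
  rcases hq with rfl | rfl | rfl | rfl | rfl | rfl | rfl | rfl <;> simp only <;> omega

end RingSafe

/-- Two faces sharing a side: the sides are opposite. [folklore] -/
private theorem side_eq_opp_of_side_eq_ring {g f : Face} {s t : Side} (h : g.side s = f.side t) (hg : g ≠ f) :
    s = t.opp := by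
  obtain ⟨k, j⟩ := g
  obtain ⟨k', j'⟩ := f
  have hne : ¬(k = k' ∧ j = j') := fun e => hg (Prod.ext e.1 e.2)
  cases s <;> cases t <;>
    simp only [Face.side, MidEdge.vert.injEq, MidEdge.slant.injEq, reduceCtorEq, Side.opp] at h ⊢ <;> omega

/-- Opposite sides have opposite inward normals. [folklore] -/
private theorem nIn_opp_ring (s : Side) : s.opp.nIn = -s.nIn := by
  cases s <;> simp [Side.opp, Side.nIn]

namespace YBWalk

/-- The `i`-th arc read through `nth`. [cite: GlazmanManolescu2019, §1 (the lattice of rhombi and its mid-edges); lane plumbing] -/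
private theorem arcFace_nth_eq_some_fc_ring {D : Set Face} {a z : MidEdge} (γ : YBWalk D a z) {i : ℕ}
    (hi : i < γ.arcs.length) : arcFace (γ.nth i, γ.nth (i + 1)) = some (γ.fc i) := by
  have h1 := (YBWalk.arcFace_arcAt (γ := γ) hi).1
  have hl := γ.length_eq
  rwa [YBWalk.arcAt_eq hi, ← γ.nth_eq_getElem (by omega), ← γ.nth_eq_getElem (by omega)] at h1

end YBWalk

/-! ## Cell-parametric plumbing: the prefix and the whole walk of a class-`B2a` walk at ANY cell `c` of the hole root -/

namespace ΩG

variable {D : Set Face} {w c : Face}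

section PrefixC

variable (ω : ΩG D (w.side .W) c)

/-- The PREFIX of a class-`B2a` walk at the cell `c`: its first `firstHitG` arcs.
[cite: Glazman2015WeightedSAW, Lemma 3.1 (proof, pp. 6–7: the classes of walks through a rhombus)] -/
def preC (h : ω.IsB2a) : YBWalk D (w.side .W) (ω.2.nth ω.2.firstHitG) :=
  ω.2.take ω.2.firstHitG (ω.fh_lt h).le

variable {ω}

/-- The prefix has `firstHitG` arcs. [folklore] -/
private theorem preC_length (h : ω.IsB2a) : (ω.preC h).arcs.length = ω.2.firstHitG := YBWalk.take_length _ _ _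

/-- The mid-edges of the prefix. [folklore] -/
private theorem preC_nth (h : ω.IsB2a) {i : ℕ} (hi : i ≤ ω.2.firstHitG) : (ω.preC h).nth i = ω.2.nth i :=
  YBWalk.take_nth _ _ _ hi

/-- **The turning of the prefix is `WP`.** [cite: GlazmanManolescu2019, Lemma 2.1 (proof: [Gl])] -/
theorem preC_winding (h : ω.IsB2a) (Θ : ℤ → ℝ) : (ω.preC h).winding Θ = ω.WP Θ := by
  unfold YBWalk.winding ΩG.WP
  rw [preC, YBWalk.take_arcs]

/-- The prefix is not empty when the root is not a side of the cell. [folklore] -/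
private theorem fhC_pos (hc : ∀ t, c.side t ≠ w.side .W) (ω : ΩG D (w.side .W) c) : 0 < ω.2.firstHitG := by
  by_contra h0
  push Not at h0
  have e := ω.2.nth_firstHitG
  rw [Nat.le_zero.1 h0, ω.2.nth_zero] at e
  exact hc _ e.symm

/-- The faces of the prefix arcs lie in the domain and are neither the cell nor the hole.
[cite: Glazman2015WeightedSAW, Lemma 3.1 (proof, pp. 6–7: the classes of walks through a rhombus)] -/
theorem preC_fc (hh : holeFaceW w ∉ D) (h : ω.IsB2a) {i : ℕ} (hi : i < ω.2.firstHitG) :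
    (ω.preC h).fc i ∈ D ∧ (ω.preC h).fc i ≠ c ∧ (ω.preC h).fc i ≠ holeFaceW w := by
  have hlen := preC_length (ω := ω) h
  have hD := (YBWalk.arcFace_arcAt (γ := ω.preC h) (i := i) (by rw [hlen]; exact hi)).2
  refine ⟨hD, fun e => ?_, fun e => hh (e ▸ hD)⟩
  have h1 := (ω.preC h).arcFace_nth_eq_some_fc_ring (i := i) (by rw [hlen]; exact hi)
  rw [preC_nth h hi.le, preC_nth h hi, e] at h1
  exact ω.2.arcFace_ne_of_lt_firstHitG hi (by have := ω.fh_lt h; omega) h1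

/-- The last arc of the prefix leaves its face through the side opposite to the first side of the cell.
[cite: Glazman2015WeightedSAW, Lemma 3.1 (proof, pp. 6–7)] -/
theorem preC_sOut_last (hh : holeFaceW w ∉ D) (hc : ∀ t, c.side t ≠ w.side .W) (h : ω.IsB2a) :
    (ω.preC h).sOut (ω.2.firstHitG - 1) = ω.2.firstSideG.opp ∧
      ((ω.preC h).fc (ω.2.firstHitG - 1)).side ((ω.preC h).sOut (ω.2.firstHitG - 1)) = c.side ω.2.firstSideG := by
  have hlen := preC_length (ω := ω) h
  have hfh := fhC_pos hc ω
  obtain ⟨-, ht, -⟩ := YBWalk.side_sIn (γ := ω.preC h) (i := ω.2.firstHitG - 1) (by rw [hlen]; omega)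
  have e1 : ω.2.firstHitG - 1 + 1 = ω.2.firstHitG := by omega
  rw [← (ω.preC h).nth_eq_getElem (by rw [(ω.preC h).length_eq, hlen]; omega)] at ht
  simp only [e1] at ht
  rw [preC_nth h le_rfl] at ht
  have ht' := ht.trans ω.2.nth_firstHitG
  exact ⟨side_eq_opp_of_side_eq_ring ht' (preC_fc hh h (by omega)).2.1, ht'⟩

/-- The inner vertices of the prefix polyline are inner points of faces other than the cell and the hole. [folklore] -/
private theorem preC_vtx_generic (hh : holeFaceW w ∉ D) (h : ω.IsB2a) {j : ℕ} (hj1 : 1 ≤ j)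
    (hj2 : j ≤ 2 * (ω.preC h).arcs.length) :
    (∃ g s, g ≠ c ∧ g ≠ holeFaceW w ∧ (ω.preC h).vtx j = innerPt g s) ∨
      ∃ p ∈ ([] : List (ℤ × ℤ)), (ω.preC h).vtx j = (farSW w).base + p := by
  left
  have hlen := preC_length (ω := ω) h
  rcases YBWalk.index_cases (γ := ω.preC h) j (by omega) with h0 | ⟨i, hi, rfl⟩ | ⟨i, hi, rfl⟩ | h0
  · omega
  · obtain ⟨-, h1, h2⟩ := preC_fc hh h (i := i) (by rw [← hlen]; exact hi)
    exact ⟨_, _, h1, h2, YBWalk.vtx_odd hi⟩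
  · obtain ⟨-, h1, h2⟩ := preC_fc hh h (i := i) (by rw [← hlen]; exact hi)
    exact ⟨_, _, h1, h2, YBWalk.vtx_even hi⟩
  · omega

/-- The last vertex of the prefix polyline, in the diagonal-cell frame. [folklore] -/
private theorem preC_vtx_last (h : ω.IsB2a) {δ : ℤ × ℤ} (hcb : c.base = (farSW w).base + δ) :
    (ω.preC h).vtx (2 * (ω.preC h).arcs.length + 1) = (farSW w).base + (δ + ω.2.firstSideG.offset) := by
  rw [YBWalk.vtx_last, ω.2.nth_firstHitG, midPt_side, hcb, add_assoc]

/-- The last-but-one vertex of the prefix polyline: one unit outside the first side. [folklore] -/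
private theorem preC_vtx_penult (hh : holeFaceW w ∉ D) (hc : ∀ t, c.side t ≠ w.side .W) (h : ω.IsB2a)
    {δ : ℤ × ℤ} (hcb : c.base = (farSW w).base + δ) :
    (ω.preC h).vtx (2 * (ω.preC h).arcs.length) =
      (farSW w).base + (δ + (ω.2.firstSideG.offset - ω.2.firstSideG.nIn)) := by
  have hlen := preC_length (ω := ω) h
  have hfh := fhC_pos hc ω
  have e := YBWalk.vtx_even (γ := ω.preC h) (i := ω.2.firstHitG - 1) (by rw [hlen]; omega)
  rw [show 2 * (ω.2.firstHitG - 1) + 2 = 2 * ω.2.firstHitG by omega] at e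
  obtain ⟨hs, ht⟩ := preC_sOut_last hh hc h
  rw [hlen, e, YBWalk.ptOut, innerPt_eq, ht, hs, midPt_side, hcb, nIn_opp_ring, add_assoc, add_assoc, ← sub_eq_add_neg]

/-- ★★ **Hopf for the closed PREFIX polygon at a cell `c` of the ring** (cell-parametric form of
`ΩG.WP_hopf_of_tables`): for every closing list passing the finite tables, `WP(π/2) + T·π/4 = ±2π`.
[cite: Hopf1935, Nr. 2 (Umlaufsatz, p. 53) and Nr. 4 eq. (22) (curves with corners, pp. 60–61)]
[cite: GlazmanManolescu2019, Lemma 2.1 (proof: [Gl])] -/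
theorem WP_hopf_of_tables_cell (hh : holeFaceW w ∉ D) (hc : ∀ t, c.side t ≠ w.side .W) (h : ω.IsB2a)
    {δ : ℤ × ℤ} (hcb : c.base = (farSW w).base + δ) (safe : List (ℤ × ℤ))
    (hsafe : ∀ (g : Face) (s : Side), g ≠ c → g ≠ holeFaceW w → ∀ q ∈ safe, 5 ≤ dsq (innerPt g s) ((farSW w).base + q))
    (cl : List (ℤ × ℤ)) (hcl : cl ≠ [])
    (hT1 : ∀ q ∈ cl, q ∈ safe ∧ q ∉ ([] : List (ℤ × ℤ)) ++ [δ + ω.2.firstSideG.offset, (8, 6)])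
    (hT2 : cl.Nodup)
    (hT3 : ∀ i < cl.length + 1,
      dsq (((δ + ω.2.firstSideG.offset) :: (cl ++ [(8, 6)])).getD i 0)
          (((δ + ω.2.firstSideG.offset) :: (cl ++ [(8, 6)])).getD (i + 1) 0) ≤ 4 ∧
        ∀ p ∈ ([] : List (ℤ × ℤ)) ++ [δ + ω.2.firstSideG.offset, (8, 6)] ++ cl,
          p ≠ ((δ + ω.2.firstSideG.offset) :: (cl ++ [(8, 6)])).getD i 0 →
          p ≠ ((δ + ω.2.firstSideG.offset) :: (cl ++ [(8, 6)])).getD (i + 1) 0 →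
            dsq (((δ + ω.2.firstSideG.offset) :: (cl ++ [(8, 6)])).getD i 0)
                (((δ + ω.2.firstSideG.offset) :: (cl ++ [(8, 6)])).getD (i + 1) 0) <
              dsq (((δ + ω.2.firstSideG.offset) :: (cl ++ [(8, 6)])).getD i 0) p +
                dsq (((δ + ω.2.firstSideG.offset) :: (cl ++ [(8, 6)])).getD (i + 1) 0) p)
    (hT4 : ∀ p ∈ ([] : List (ℤ × ℤ)) ++ [δ + ω.2.firstSideG.offset, (8, 6)],
      ∀ p' ∈ ([] : List (ℤ × ℤ)) ++ [δ + ω.2.firstSideG.offset, (8, 6)], p ≠ p' → dsq p p' ≤ 4 →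
        ∀ q ∈ cl, dsq p p' < dsq p q + dsq p' q)
    (hOK : triplesOK ((δ + (ω.2.firstSideG.offset - ω.2.firstSideG.nIn)) :: (δ + ω.2.firstSideG.offset) ::
      (cl ++ [(8, 6), (9, 6)])) = true) :
    ω.WP (fun _ => π / 2) + (triplesTurn ((δ + (ω.2.firstSideG.offset - ω.2.firstSideG.nIn)) ::
        (δ + ω.2.firstSideG.offset) :: (cl ++ [(8, 6), (9, 6)])) : ℝ) * (π / 4) = 2 * π ∨
      ω.WP (fun _ => π / 2) + (triplesTurn ((δ + (ω.2.firstSideG.offset - ω.2.firstSideG.nIn)) ::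
        (δ + ω.2.firstSideG.offset) :: (cl ++ [(8, 6), (9, 6)])) : ℝ) * (π / 4) = -(2 * π) := by
  have hlen := preC_length (ω := ω) h
  have hn : 0 < (ω.preC h).arcs.length := by rw [hlen]; exact fhC_pos hc ω
  have key := YBWalk.diagCyc_hopf (γ := ω.preC h) (cl := cl) hn c safe [] (δ + ω.2.firstSideG.offset)
    hsafe (fun j hj1 hj2 => preC_vtx_generic hh h hj1 hj2) (preC_vtx_last h hcb) hcl hT1 hT2 hT3 hT4
  rwa [YBWalk.sum_extAng_diagCyc hh hn _ _ (preC_vtx_penult hh hc h hcb) (preC_vtx_last h hcb) hcl hOK, preC_winding]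
    at key

/-- **Transfer of the pinned prefix turning to every angle** (cell-parametric): if `WP(π/2) = v` then
`WP(θ) = v + (θ − π/2)·slantInd(z₀)`. [cite: GlazmanManolescu2019, Lemma 2.1 (proof: [Gl])] -/
theorem WP_cell_of_pinned (h : ω.IsB2a) (θ : ℝ) {v : ℝ} (hv : ω.WP (fun _ => π / 2) = v) :
    ω.WP (fun _ => θ) = v + (θ - π / 2) * ω.2.firstSideG.slantInd := by
  subst hv
  have e : slantPot (fun _ => θ) (ω.2.nth ω.2.firstHitG) = (θ - π / 2) * ω.2.firstSideG.slantInd := by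
    rw [ω.2.nth_firstHitG, slantPot_side]
  have e0 : slantPot (fun _ : ℤ => θ) (w.side .W) = 0 := by rw [slantPot_side]; simp [Side.slantInd]
  rw [← preC_winding h, ← preC_winding h, YBWalk.winding_eq_winding_pi_div_two_add (fun _ => θ) (ω.preC h), e, e0]
  ring

end PrefixC

section WholeC

variable {ω : ΩG D (w.side .W) c}

/-- In class `B2a` the walk has at least `firstHitG + 3` arcs (any cell). [cite: Glazman2015WeightedSAW, Lemma 3.1 (proof, pp. 6–7)] -/
theorem fh_add_three_le_cell (hr : RootedFace D (w.side .W) c) (h : ω.IsB2a) :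
    ω.2.firstHitG + 3 ≤ ω.2.arcs.length := by
  have := ω.2.firstHit_add_three_le_returnHitG hr h.1; rw [h.2] at this; exact this

/-- **The arc inside the cell**: face `c`, entry side `z₀`, exit side `z₁`.
[cite: Glazman2015WeightedSAW, Lemma 3.1 (proof, pp. 6–7: the classes of walks through a rhombus)] -/
theorem fc_firstHit_cell (hr : RootedFace D (w.side .W) c) (h : ω.IsB2a) :
    ω.2.fc ω.2.firstHitG = c ∧ ω.2.sIn ω.2.firstHitG = ω.2.firstSideG ∧ ω.2.sOut ω.2.firstHitG = ω.z1 hr h := by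
  have hfh := ω.fh_lt h
  obtain ⟨hz01, -, -⟩ := ω.firstSide_exit_return_distinct hr h
  have hlen := ω.2.length_eq
  obtain ⟨hs, ht, -⟩ := YBWalk.side_sIn (γ := ω.2) hfh
  rw [← ω.2.nth_eq_getElem (by omega), ω.2.nth_firstHitG] at hs
  rw [← ω.2.nth_eq_getElem (by omega), (ω.2.exitSide_specG hr hfh).1] at ht
  have hface : ω.2.fc ω.2.firstHitG = c := by
    have h1 := ω.2.arcFace_nth_eq_some_fc_ring hfh
    rw [ω.2.nth_firstHitG, (ω.2.exitSide_specG hr hfh).1,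
      arcFace_side_side c ω.2.firstSideG (ω.2.exitSideG hr hfh) hz01] at h1
    exact (Option.some_injective _ h1).symm
  refine ⟨hface, ?_, ?_⟩
  · rw [hface] at hs; exact Face.side_injective _ hs
  · rw [hface] at ht; exact Face.side_injective _ ht

/-- **The total turning splits at the cell**: `winding = WP + arcTurn(θ; z₀, z₁) + WE`.
[cite: GlazmanManolescu2019, Lemma 2.1 (proof: [Gl])] -/
theorem winding_eq_WP_add_cell (hr : RootedFace D (w.side .W) c) (h : ω.IsB2a) (Θ : ℤ → ℝ) :
    ω.2.winding Θ = ω.WP Θ + arcTurn (Θ c.1) ω.2.firstSideG (ω.z1 hr h) + ω.WE Θ := by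
  have hfh := ω.fh_lt h
  obtain ⟨hfc, hsIn, hsOut⟩ := fc_firstHit_cell hr h
  have hsplit : ω.2.arcs = ω.2.arcs.take ω.2.firstHitG ++
      (ω.2.arcAt ω.2.firstHitG :: ω.2.arcs.drop (ω.2.firstHitG + 1)) := by
    rw [YBWalk.arcAt, List.getD_eq_getElem' hfh, ← List.drop_eq_getElem_cons hfh, List.take_append_drop]
  have e1 : (ω.2.fc ω.2.firstHitG).1 = c.1 := by rw [hfc]
  have e2 : sideIn (ω.2.arcAt ω.2.firstHitG) = ω.2.firstSideG := hsIn
  have e3 : sideOut (ω.2.arcAt ω.2.firstHitG) = ω.z1 hr h := hsOut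
  unfold YBWalk.winding ΩG.WP ΩG.WE
  conv_lhs => rw [hsplit]
  rw [List.map_append, List.map_cons, List.sum_append, List.sum_cons,
    arcTurnOf_eq_arcTurn (YBWalk.arcFace_arcAt (γ := ω.2) hfh).1, e1, e2, e3]
  ring

/-- The faces of the arcs other than the one inside the cell are neither the cell nor the hole.
[cite: Glazman2015WeightedSAW, Lemma 3.1 (proof, pp. 6–7)] -/
theorem fc_ne_cell (hh : holeFaceW w ∉ D) (hr : RootedFace D (w.side .W) c) (h : ω.IsB2a) {i : ℕ}
    (hi : i < ω.2.arcs.length) (hne : i ≠ ω.2.firstHitG) :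
    ω.2.fc i ∈ D ∧ ω.2.fc i ≠ c ∧ ω.2.fc i ≠ holeFaceW w := by
  have hD := (YBWalk.arcFace_arcAt (γ := ω.2) hi).2
  refine ⟨hD, fun e => ?_, fun e => hh (e ▸ hD)⟩
  have h1 := ω.2.arcFace_nth_eq_some_fc_ring hi
  rw [e] at h1
  rcases Nat.lt_or_gt_of_ne hne with hlt | hgt
  · exact ω.2.arcFace_ne_of_lt_firstHitG hlt hi h1
  · exact ω.2.arcFace_ne_of_excursionG hr h.1 hgt (by rw [h.2]; exact hi) h1

/-- The inner vertices of the whole walk: generic, or the two inner points of the arc inside the cell. [folklore] -/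
private theorem vtx_generic_cell (hh : holeFaceW w ∉ D) (hr : RootedFace D (w.side .W) c) (h : ω.IsB2a)
    {δ : ℤ × ℤ} (hcb : c.base = (farSW w).base + δ) {j : ℕ} (hj1 : 1 ≤ j) (hj2 : j ≤ 2 * ω.2.arcs.length) :
    (∃ g s, g ≠ c ∧ g ≠ holeFaceW w ∧ ω.2.vtx j = innerPt g s) ∨
      ∃ p ∈ [δ + ω.2.firstSideG.inOff, δ + (ω.z1 hr h).inOff], ω.2.vtx j = (farSW w).base + p := by
  rcases YBWalk.index_cases (γ := ω.2) j (by omega) with h0 | ⟨i, hi, rfl⟩ | ⟨i, hi, rfl⟩ | h0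
  · omega
  · by_cases hif : i = ω.2.firstHitG
    · subst hif
      obtain ⟨hfc, hsIn, -⟩ := fc_firstHit_cell hr h
      right
      exact ⟨δ + ω.2.firstSideG.inOff, by simp, by rw [YBWalk.vtx_odd hi, YBWalk.ptIn, hfc, hsIn, innerPt, hcb, add_assoc]⟩
    · obtain ⟨-, h1, h2⟩ := fc_ne_cell hh hr h hi hif
      exact Or.inl ⟨_, _, h1, h2, YBWalk.vtx_odd hi⟩
  · by_cases hif : i = ω.2.firstHitG
    · subst hif
      obtain ⟨hfc, -, hsOut⟩ := fc_firstHit_cell hr h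
      right
      exact ⟨δ + (ω.z1 hr h).inOff, by simp, by rw [YBWalk.vtx_even hi, YBWalk.ptOut, hfc, hsOut, innerPt, hcb, add_assoc]⟩
    · obtain ⟨-, h1, h2⟩ := fc_ne_cell hh hr h hi hif
      exact Or.inl ⟨_, _, h1, h2, YBWalk.vtx_even hi⟩
  · omega

/-- The last vertex of the whole walk: the midpoint of the return side. [folklore] -/
private theorem vtx_last_cell (ω : ΩG D (w.side .W) c) {δ : ℤ × ℤ} (hcb : c.base = (farSW w).base + δ) :
    ω.2.vtx (2 * ω.2.arcs.length + 1) = (farSW w).base + (δ + (ω.1).offset) := by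
  rw [YBWalk.vtx_last, midPt_side, hcb, add_assoc]

/-- The last-but-one vertex of the whole walk: one unit outside the return side. [folklore] -/
private theorem vtx_penult_cell (hh : holeFaceW w ∉ D) (hr : RootedFace D (w.side .W) c) (h : ω.IsB2a)
    {δ : ℤ × ℤ} (hcb : c.base = (farSW w).base + δ) :
    ω.2.vtx (2 * ω.2.arcs.length) = (farSW w).base + (δ + ((ω.1).offset - (ω.1).nIn)) := by
  have h3 := fh_add_three_le_cell hr h
  have hlen := ω.2.length_eq
  have e := YBWalk.vtx_even (γ := ω.2) (i := ω.2.arcs.length - 1) (by omega)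
  rw [show 2 * (ω.2.arcs.length - 1) + 2 = 2 * ω.2.arcs.length by omega] at e
  obtain ⟨-, ht, -⟩ := YBWalk.side_sIn (γ := ω.2) (i := ω.2.arcs.length - 1) (by omega)
  rw [← ω.2.nth_eq_getElem (by omega)] at ht
  simp only [show ω.2.arcs.length - 1 + 1 = ω.2.arcs.length by omega] at ht
  rw [ω.2.nth_length] at ht
  have hs := side_eq_opp_of_side_eq_ring ht (fc_ne_cell hh hr h (by omega) (by omega)).2.1
  rw [e, YBWalk.ptOut, innerPt_eq, ht, hs, midPt_side, hcb, nIn_opp_ring, add_assoc, add_assoc, ← sub_eq_add_neg]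

/-- ★★ **Hopf for the closed WHOLE-WALK polygon at a cell `c` of the ring** (cell-parametric form of
`ΩG.winding_hopf_of_tables`). [cite: Hopf1935, Nr. 2 (Umlaufsatz, p. 53) and Nr. 4 eq. (22) (curves with corners, pp. 60–61)]
[cite: GlazmanManolescu2019, Lemma 2.1 (proof: [Gl])] -/
theorem winding_hopf_of_tables_cell (hh : holeFaceW w ∉ D) (hr : RootedFace D (w.side .W) c) (h : ω.IsB2a)
    {δ : ℤ × ℤ} (hcb : c.base = (farSW w).base + δ) (safe : List (ℤ × ℤ))
    (hsafe : ∀ (g : Face) (s : Side), g ≠ c → g ≠ holeFaceW w → ∀ q ∈ safe, 5 ≤ dsq (innerPt g s) ((farSW w).base + q))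
    (cl : List (ℤ × ℤ)) (hcl : cl ≠ [])
    (hT1 : ∀ q ∈ cl, q ∈ safe ∧
      q ∉ [δ + ω.2.firstSideG.inOff, δ + (ω.z1 hr h).inOff] ++ [δ + (ω.1).offset, (8, 6)])
    (hT2 : cl.Nodup)
    (hT3 : ∀ i < cl.length + 1,
      dsq (((δ + (ω.1).offset) :: (cl ++ [(8, 6)])).getD i 0) (((δ + (ω.1).offset) :: (cl ++ [(8, 6)])).getD (i + 1) 0) ≤ 4 ∧
        ∀ p ∈ [δ + ω.2.firstSideG.inOff, δ + (ω.z1 hr h).inOff] ++ [δ + (ω.1).offset, (8, 6)] ++ cl,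
          p ≠ ((δ + (ω.1).offset) :: (cl ++ [(8, 6)])).getD i 0 →
          p ≠ ((δ + (ω.1).offset) :: (cl ++ [(8, 6)])).getD (i + 1) 0 →
            dsq (((δ + (ω.1).offset) :: (cl ++ [(8, 6)])).getD i 0) (((δ + (ω.1).offset) :: (cl ++ [(8, 6)])).getD (i + 1) 0) <
              dsq (((δ + (ω.1).offset) :: (cl ++ [(8, 6)])).getD i 0) p +
                dsq (((δ + (ω.1).offset) :: (cl ++ [(8, 6)])).getD (i + 1) 0) p)
    (hT4 : ∀ p ∈ [δ + ω.2.firstSideG.inOff, δ + (ω.z1 hr h).inOff] ++ [δ + (ω.1).offset, (8, 6)],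
      ∀ p' ∈ [δ + ω.2.firstSideG.inOff, δ + (ω.z1 hr h).inOff] ++ [δ + (ω.1).offset, (8, 6)], p ≠ p' → dsq p p' ≤ 4 →
        ∀ q ∈ cl, dsq p p' < dsq p q + dsq p' q)
    (hOK : triplesOK ((δ + ((ω.1).offset - (ω.1).nIn)) :: (δ + (ω.1).offset) :: (cl ++ [(8, 6), (9, 6)])) = true) :
    ω.2.winding (fun _ => π / 2) +
        (triplesTurn ((δ + ((ω.1).offset - (ω.1).nIn)) :: (δ + (ω.1).offset) :: (cl ++ [(8, 6), (9, 6)])) : ℝ) * (π / 4) =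
          2 * π ∨
      ω.2.winding (fun _ => π / 2) +
        (triplesTurn ((δ + ((ω.1).offset - (ω.1).nIn)) :: (δ + (ω.1).offset) :: (cl ++ [(8, 6), (9, 6)])) : ℝ) * (π / 4) =
          -(2 * π) := by
  have hn : 0 < ω.2.arcs.length := by have := ω.fh_lt h; omega
  have key := YBWalk.diagCyc_hopf (γ := ω.2) (cl := cl) hn c safe _ (δ + (ω.1).offset)
    hsafe (fun j hj1 hj2 => vtx_generic_cell hh hr h hcb hj1 hj2) (vtx_last_cell ω hcb) hcl hT1 hT2 hT3 hT4
  rwa [YBWalk.sum_extAng_diagCyc hh hn _ _ (vtx_penult_cell hh hr h hcb) (vtx_last_cell ω hcb) hcl hOK] at key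

/-- **Woundness does not depend on the angle** (any cell). [cite: GlazmanManolescu2019, Lemma 2.1 (proof: [Gl])] -/
theorem WE_sub_excursionWinding_const_cell (hr : RootedFace D (w.side .W) c) (h : ω.IsB2a) (θ : ℝ) :
    ω.WE (fun _ => θ) - excursionWinding θ ω.2.firstSideG (ω.z1 hr h) ω.1 =
      ω.WE (fun _ => π / 2) - excursionWinding (π / 2) ω.2.firstSideG (ω.z1 hr h) ω.1 := by
  obtain ⟨hz01, hz02, hz12⟩ := ω.firstSide_exit_return_distinct hr h
  have e1 := ω.WE_eq_WE_pi_div_two_add hr h (fun _ => θ)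
  have e2 := excursionWinding_theta θ hz01 hz02 hz12
  unfold ΩG.z1 at e2 ⊢
  rw [e1, e2]; ring

/-- The excursion winding of a WOUND walk from the sign law (any cell).
[cite: GlazmanManolescu2019, Lemma 2.1 (statement, "in the form given in [Gl]")] [cite: Glazman2015WeightedSAW, Lemma 3.1 (proof, pp. 6–7)] -/
theorem WE_sub_eq_of_wound_cell (hr : RootedFace D (w.side .W) c) (h : ω.IsB2a) (θ : ℝ)
    (hW : ω.WE (fun _ => θ) ≠ excursionWinding θ ω.2.firstSideG (ω.z1 hr h) ω.1) :
    ω.WE (fun _ => θ) - excursionWinding θ ω.2.firstSideG (ω.z1 hr h) ω.1 =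
      4 * π * chordSign ω.2.firstSideG (ω.z1 hr h) ω.1 := by
  rcases ω.sign_law hr h θ with ⟨hWE, -⟩ | ⟨hWE, -⟩
  · exact absurd hWE hW
  · exact hWE

end WholeC

end ΩG

end Literature.Probability.RandomPlanarGeometry.SAW.YangBaxter

/-! # The four remaining ring cells (generated instances) -/

namespace Literature.Probability.RandomPlanarGeometry.SAW.YangBaxter

open Real Complex

/-! ## § Ring cell SE: the cell SOUTH of the root plaquette (`SE` of the hole) — instances, pinning, assembly -/

namespace ΩG

variable {D : Set Face} {w : Face} {ω : ΩG D (w.side .W) (rootS w)}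

section CellSE

/-- ★★ **The prefix turns by one of two values** at the cell SOUTH of the root plaquette (`SE` of the hole): `N`: `{7 * π / 2, -(π / 2)}`; `E`: `{3 * π, -π}`; `S`: `{5 * π / 2, -(3 * π / 2)}`; `W`: `{2 * π, -(2 * π)}`. [cite: Hopf1935, Nr. 2 (Umlaufsatz, p. 53) and Nr. 4 eq. (22) (curves with corners, pp. 60–61)] [cite: GlazmanManolescu2019, Lemma 2.1 (proof: [Gl])] -/
theorem WP_SE_pi_div_two_mem (hh : holeFaceW w ∉ D) (h : ω.IsB2a) :
    (ω.2.firstSideG = .N → ω.WP (fun _ => π / 2) = 7 * π / 2 ∨ ω.WP (fun _ => π / 2) = -(π / 2)) ∧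
      (ω.2.firstSideG = .E → ω.WP (fun _ => π / 2) = 3 * π ∨ ω.WP (fun _ => π / 2) = -π) ∧
      (ω.2.firstSideG = .S → ω.WP (fun _ => π / 2) = 5 * π / 2 ∨ ω.WP (fun _ => π / 2) = -(3 * π / 2)) ∧
      (ω.2.firstSideG = .W → ω.WP (fun _ => π / 2) = 2 * π ∨ ω.WP (fun _ => π / 2) = -(2 * π)) := by
  have hπ := Real.pi_pos
  refine ⟨fun hz => ?_, fun hz => ?_, fun hz => ?_, fun hz => ?_⟩
  · have key := WP_hopf_of_tables_cell (ω := ω) hh (rootS_side_ne_root w) h (rootS_base w) safeOffsetsSE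
      five_le_dsq_innerPt_safeOffsetsSE [((8 : ℤ), (4 : ℤ))] (by simp)
      (by rw [hz]; decide) (by decide) (by rw [hz]; decide) (by rw [hz]; decide) (by rw [hz]; decide)
    rw [hz] at key
    have e : triplesTurn (((8, 0) + (Side.N.offset - Side.N.nIn)) :: ((8, 0) + Side.N.offset) ::
        ([((8 : ℤ), (4 : ℤ))] ++ [(8, 6), (9, 6)])) = -6 := by decide
    rw [e] at key
    push_cast at key
    rcases key with k | k
    · left; linarith
    · right; linarith
  · have key := WP_hopf_of_tables_cell (ω := ω) hh (rootS_side_ne_root w) h (rootS_base w) safeOffsetsSE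
      five_le_dsq_innerPt_safeOffsetsSE [((10 : ℤ), (2 : ℤ)), (9, 3), (8, 4)] (by simp)
      (by rw [hz]; decide) (by decide) (by rw [hz]; decide) (by rw [hz]; decide) (by rw [hz]; decide)
    rw [hz] at key
    have e : triplesTurn (((8, 0) + (Side.E.offset - Side.E.nIn)) :: ((8, 0) + Side.E.offset) ::
        ([((10 : ℤ), (2 : ℤ)), (9, 3), (8, 4)] ++ [(8, 6), (9, 6)])) = -4 := by decide
    rw [e] at key
    push_cast at key
    rcases key with k | k
    · left; linarith
    · right; linarith
  · have key := WP_hopf_of_tables_cell (ω := ω) hh (rootS_side_ne_root w) h (rootS_base w) safeOffsetsSE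
      five_le_dsq_innerPt_safeOffsetsSE [((10 : ℤ), (2 : ℤ)), (9, 3), (8, 4)] (by simp)
      (by rw [hz]; decide) (by decide) (by rw [hz]; decide) (by rw [hz]; decide) (by rw [hz]; decide)
    rw [hz] at key
    have e : triplesTurn (((8, 0) + (Side.S.offset - Side.S.nIn)) :: ((8, 0) + Side.S.offset) ::
        ([((10 : ℤ), (2 : ℤ)), (9, 3), (8, 4)] ++ [(8, 6), (9, 6)])) = -2 := by decide
    rw [e] at key
    push_cast at key
    rcases key with k | k
    · left; linarith
    · right; linarith
  · have key := WP_hopf_of_tables_cell (ω := ω) hh (rootS_side_ne_root w) h (rootS_base w) safeOffsetsSE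
      five_le_dsq_innerPt_safeOffsetsSE [((8 : ℤ), (4 : ℤ))] (by simp)
      (by rw [hz]; decide) (by decide) (by rw [hz]; decide) (by rw [hz]; decide) (by rw [hz]; decide)
    rw [hz] at key
    have e : triplesTurn (((8, 0) + (Side.W.offset - Side.W.nIn)) :: ((8, 0) + Side.W.offset) ::
        ([((8 : ℤ), (4 : ℤ))] ++ [(8, 6), (9, 6)])) = 0 := by decide
    rw [e] at key
    push_cast at key
    rcases key with k | k
    · left; linarith
    · right; linarith

/-- Whole-walk Umlaufsatz, cell SE, pattern `(N, E, S)`. [cite: Hopf1935, Nr. 2 (Umlaufsatz, p. 53) and Nr. 4 eq. (22) (curves with corners, pp. 60–61)] -/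
theorem winding_SE_NES (hh : holeFaceW w ∉ D) (hr : RootedFace D (w.side .W) (rootS w)) (h : ω.IsB2a)
    (hz0 : ω.2.firstSideG = .N) (hz1 : ω.z1 hr h = .E) (hz2 : ω.1 = .S) :
    ω.2.winding (fun _ => π / 2) = 5 * π / 2 ∨ ω.2.winding (fun _ => π / 2) = -(3 * π / 2) := by
  have hπ := Real.pi_pos
  have key := winding_hopf_of_tables_cell hh hr h (rootS_base w) safeOffsetsSE five_le_dsq_innerPt_safeOffsetsSE
    [((9 : ℤ), (1 : ℤ)), (9, 3), (8, 4)] (by simp)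
    (by rw [hz0, hz1, hz2]; decide) (by decide) (by rw [hz0, hz1, hz2]; decide) (by rw [hz0, hz1, hz2]; decide)
    (by rw [hz2]; decide)
  have e : triplesTurn (((8, 0) + ((ω.1).offset - (ω.1).nIn)) :: ((8, 0) + (ω.1).offset) ::
      ([((9 : ℤ), (1 : ℤ)), (9, 3), (8, 4)] ++ [(8, 6), (9, 6)])) = -2 := by rw [hz2]; decide
  rw [e] at key
  push_cast at key
  rcases key with k | k
  · left; linarith
  · right; linarith

/-- Whole-walk Umlaufsatz, cell SE, pattern `(N, E, W)`. [cite: Hopf1935, Nr. 2 (Umlaufsatz, p. 53) and Nr. 4 eq. (22) (curves with corners, pp. 60–61)] -/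
theorem winding_SE_NEW (hh : holeFaceW w ∉ D) (hr : RootedFace D (w.side .W) (rootS w)) (h : ω.IsB2a)
    (hz0 : ω.2.firstSideG = .N) (hz1 : ω.z1 hr h = .E) (hz2 : ω.1 = .W) :
    ω.2.winding (fun _ => π / 2) = 2 * π ∨ ω.2.winding (fun _ => π / 2) = -(2 * π) := by
  have hπ := Real.pi_pos
  have key := winding_hopf_of_tables_cell hh hr h (rootS_base w) safeOffsetsSE five_le_dsq_innerPt_safeOffsetsSE
    [((8 : ℤ), (4 : ℤ))] (by simp)
    (by rw [hz0, hz1, hz2]; decide) (by decide) (by rw [hz0, hz1, hz2]; decide) (by rw [hz0, hz1, hz2]; decide)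
    (by rw [hz2]; decide)
  have e : triplesTurn (((8, 0) + ((ω.1).offset - (ω.1).nIn)) :: ((8, 0) + (ω.1).offset) ::
      ([((8 : ℤ), (4 : ℤ))] ++ [(8, 6), (9, 6)])) = 0 := by rw [hz2]; decide
  rw [e] at key
  push_cast at key
  rcases key with k | k
  · left; linarith
  · right; linarith

/-- Whole-walk Umlaufsatz, cell SE, pattern `(N, S, W)`. [cite: Hopf1935, Nr. 2 (Umlaufsatz, p. 53) and Nr. 4 eq. (22) (curves with corners, pp. 60–61)] -/
theorem winding_SE_NSW (hh : holeFaceW w ∉ D) (hr : RootedFace D (w.side .W) (rootS w)) (h : ω.IsB2a)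
    (hz0 : ω.2.firstSideG = .N) (hz1 : ω.z1 hr h = .S) (hz2 : ω.1 = .W) :
    ω.2.winding (fun _ => π / 2) = 2 * π ∨ ω.2.winding (fun _ => π / 2) = -(2 * π) := by
  have hπ := Real.pi_pos
  have key := winding_hopf_of_tables_cell hh hr h (rootS_base w) safeOffsetsSE five_le_dsq_innerPt_safeOffsetsSE
    [((8 : ℤ), (4 : ℤ))] (by simp)
    (by rw [hz0, hz1, hz2]; decide) (by decide) (by rw [hz0, hz1, hz2]; decide) (by rw [hz0, hz1, hz2]; decide)
    (by rw [hz2]; decide)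
  have e : triplesTurn (((8, 0) + ((ω.1).offset - (ω.1).nIn)) :: ((8, 0) + (ω.1).offset) ::
      ([((8 : ℤ), (4 : ℤ))] ++ [(8, 6), (9, 6)])) = 0 := by rw [hz2]; decide
  rw [e] at key
  push_cast at key
  rcases key with k | k
  · left; linarith
  · right; linarith

/-- Whole-walk Umlaufsatz, cell SE, pattern `(E, N, S)`. [cite: Hopf1935, Nr. 2 (Umlaufsatz, p. 53) and Nr. 4 eq. (22) (curves with corners, pp. 60–61)] -/
theorem winding_SE_ENS (hh : holeFaceW w ∉ D) (hr : RootedFace D (w.side .W) (rootS w)) (h : ω.IsB2a)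
    (hz0 : ω.2.firstSideG = .E) (hz1 : ω.z1 hr h = .N) (hz2 : ω.1 = .S) :
    ω.2.winding (fun _ => π / 2) = 5 * π / 2 ∨ ω.2.winding (fun _ => π / 2) = -(3 * π / 2) := by
  have hπ := Real.pi_pos
  have key := winding_hopf_of_tables_cell hh hr h (rootS_base w) safeOffsetsSE five_le_dsq_innerPt_safeOffsetsSE
    [((9 : ℤ), (1 : ℤ)), (9, 3), (8, 4)] (by simp)
    (by rw [hz0, hz1, hz2]; decide) (by decide) (by rw [hz0, hz1, hz2]; decide) (by rw [hz0, hz1, hz2]; decide)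
    (by rw [hz2]; decide)
  have e : triplesTurn (((8, 0) + ((ω.1).offset - (ω.1).nIn)) :: ((8, 0) + (ω.1).offset) ::
      ([((9 : ℤ), (1 : ℤ)), (9, 3), (8, 4)] ++ [(8, 6), (9, 6)])) = -2 := by rw [hz2]; decide
  rw [e] at key
  push_cast at key
  rcases key with k | k
  · left; linarith
  · right; linarith

/-- Whole-walk Umlaufsatz, cell SE, pattern `(E, N, W)`. [cite: Hopf1935, Nr. 2 (Umlaufsatz, p. 53) and Nr. 4 eq. (22) (curves with corners, pp. 60–61)] -/
theorem winding_SE_ENW (hh : holeFaceW w ∉ D) (hr : RootedFace D (w.side .W) (rootS w)) (h : ω.IsB2a)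
    (hz0 : ω.2.firstSideG = .E) (hz1 : ω.z1 hr h = .N) (hz2 : ω.1 = .W) :
    ω.2.winding (fun _ => π / 2) = 2 * π ∨ ω.2.winding (fun _ => π / 2) = -(2 * π) := by
  have hπ := Real.pi_pos
  have key := winding_hopf_of_tables_cell hh hr h (rootS_base w) safeOffsetsSE five_le_dsq_innerPt_safeOffsetsSE
    [((8 : ℤ), (4 : ℤ))] (by simp)
    (by rw [hz0, hz1, hz2]; decide) (by decide) (by rw [hz0, hz1, hz2]; decide) (by rw [hz0, hz1, hz2]; decide)
    (by rw [hz2]; decide)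
  have e : triplesTurn (((8, 0) + ((ω.1).offset - (ω.1).nIn)) :: ((8, 0) + (ω.1).offset) ::
      ([((8 : ℤ), (4 : ℤ))] ++ [(8, 6), (9, 6)])) = 0 := by rw [hz2]; decide
  rw [e] at key
  push_cast at key
  rcases key with k | k
  · left; linarith
  · right; linarith

/-- Whole-walk Umlaufsatz, cell SE, pattern `(E, S, N)`. [cite: Hopf1935, Nr. 2 (Umlaufsatz, p. 53) and Nr. 4 eq. (22) (curves with corners, pp. 60–61)] -/
theorem winding_SE_ESN (hh : holeFaceW w ∉ D) (hr : RootedFace D (w.side .W) (rootS w)) (h : ω.IsB2a)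
    (hz0 : ω.2.firstSideG = .E) (hz1 : ω.z1 hr h = .S) (hz2 : ω.1 = .N) :
    ω.2.winding (fun _ => π / 2) = 7 * π / 2 ∨ ω.2.winding (fun _ => π / 2) = -(π / 2) := by
  have hπ := Real.pi_pos
  have key := winding_hopf_of_tables_cell hh hr h (rootS_base w) safeOffsetsSE five_le_dsq_innerPt_safeOffsetsSE
    [((8 : ℤ), (4 : ℤ))] (by simp)
    (by rw [hz0, hz1, hz2]; decide) (by decide) (by rw [hz0, hz1, hz2]; decide) (by rw [hz0, hz1, hz2]; decide)
    (by rw [hz2]; decide)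
  have e : triplesTurn (((8, 0) + ((ω.1).offset - (ω.1).nIn)) :: ((8, 0) + (ω.1).offset) ::
      ([((8 : ℤ), (4 : ℤ))] ++ [(8, 6), (9, 6)])) = -6 := by rw [hz2]; decide
  rw [e] at key
  push_cast at key
  rcases key with k | k
  · left; linarith
  · right; linarith

/-- Whole-walk Umlaufsatz, cell SE, pattern `(E, S, W)`. [cite: Hopf1935, Nr. 2 (Umlaufsatz, p. 53) and Nr. 4 eq. (22) (curves with corners, pp. 60–61)] -/
theorem winding_SE_ESW (hh : holeFaceW w ∉ D) (hr : RootedFace D (w.side .W) (rootS w)) (h : ω.IsB2a)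
    (hz0 : ω.2.firstSideG = .E) (hz1 : ω.z1 hr h = .S) (hz2 : ω.1 = .W) :
    ω.2.winding (fun _ => π / 2) = 2 * π ∨ ω.2.winding (fun _ => π / 2) = -(2 * π) := by
  have hπ := Real.pi_pos
  have key := winding_hopf_of_tables_cell hh hr h (rootS_base w) safeOffsetsSE five_le_dsq_innerPt_safeOffsetsSE
    [((8 : ℤ), (4 : ℤ))] (by simp)
    (by rw [hz0, hz1, hz2]; decide) (by decide) (by rw [hz0, hz1, hz2]; decide) (by rw [hz0, hz1, hz2]; decide)
    (by rw [hz2]; decide)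
  have e : triplesTurn (((8, 0) + ((ω.1).offset - (ω.1).nIn)) :: ((8, 0) + (ω.1).offset) ::
      ([((8 : ℤ), (4 : ℤ))] ++ [(8, 6), (9, 6)])) = 0 := by rw [hz2]; decide
  rw [e] at key
  push_cast at key
  rcases key with k | k
  · left; linarith
  · right; linarith

/-- Whole-walk Umlaufsatz, cell SE, pattern `(E, W, N)`. [cite: Hopf1935, Nr. 2 (Umlaufsatz, p. 53) and Nr. 4 eq. (22) (curves with corners, pp. 60–61)] -/
theorem winding_SE_EWN (hh : holeFaceW w ∉ D) (hr : RootedFace D (w.side .W) (rootS w)) (h : ω.IsB2a)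
    (hz0 : ω.2.firstSideG = .E) (hz1 : ω.z1 hr h = .W) (hz2 : ω.1 = .N) :
    ω.2.winding (fun _ => π / 2) = 7 * π / 2 ∨ ω.2.winding (fun _ => π / 2) = -(π / 2) := by
  have hπ := Real.pi_pos
  have key := winding_hopf_of_tables_cell hh hr h (rootS_base w) safeOffsetsSE five_le_dsq_innerPt_safeOffsetsSE
    [((8 : ℤ), (4 : ℤ))] (by simp)
    (by rw [hz0, hz1, hz2]; decide) (by decide) (by rw [hz0, hz1, hz2]; decide) (by rw [hz0, hz1, hz2]; decide)
    (by rw [hz2]; decide)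
  have e : triplesTurn (((8, 0) + ((ω.1).offset - (ω.1).nIn)) :: ((8, 0) + (ω.1).offset) ::
      ([((8 : ℤ), (4 : ℤ))] ++ [(8, 6), (9, 6)])) = -6 := by rw [hz2]; decide
  rw [e] at key
  push_cast at key
  rcases key with k | k
  · left; linarith
  · right; linarith

/-- Whole-walk Umlaufsatz, cell SE, pattern `(S, N, W)`. [cite: Hopf1935, Nr. 2 (Umlaufsatz, p. 53) and Nr. 4 eq. (22) (curves with corners, pp. 60–61)] -/
theorem winding_SE_SNW (hh : holeFaceW w ∉ D) (hr : RootedFace D (w.side .W) (rootS w)) (h : ω.IsB2a)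
    (hz0 : ω.2.firstSideG = .S) (hz1 : ω.z1 hr h = .N) (hz2 : ω.1 = .W) :
    ω.2.winding (fun _ => π / 2) = 2 * π ∨ ω.2.winding (fun _ => π / 2) = -(2 * π) := by
  have hπ := Real.pi_pos
  have key := winding_hopf_of_tables_cell hh hr h (rootS_base w) safeOffsetsSE five_le_dsq_innerPt_safeOffsetsSE
    [((8 : ℤ), (4 : ℤ))] (by simp)
    (by rw [hz0, hz1, hz2]; decide) (by decide) (by rw [hz0, hz1, hz2]; decide) (by rw [hz0, hz1, hz2]; decide)
    (by rw [hz2]; decide)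
  have e : triplesTurn (((8, 0) + ((ω.1).offset - (ω.1).nIn)) :: ((8, 0) + (ω.1).offset) ::
      ([((8 : ℤ), (4 : ℤ))] ++ [(8, 6), (9, 6)])) = 0 := by rw [hz2]; decide
  rw [e] at key
  push_cast at key
  rcases key with k | k
  · left; linarith
  · right; linarith

/-- Whole-walk Umlaufsatz, cell SE, pattern `(S, E, N)`. [cite: Hopf1935, Nr. 2 (Umlaufsatz, p. 53) and Nr. 4 eq. (22) (curves with corners, pp. 60–61)] -/
theorem winding_SE_SEN (hh : holeFaceW w ∉ D) (hr : RootedFace D (w.side .W) (rootS w)) (h : ω.IsB2a)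
    (hz0 : ω.2.firstSideG = .S) (hz1 : ω.z1 hr h = .E) (hz2 : ω.1 = .N) :
    ω.2.winding (fun _ => π / 2) = 7 * π / 2 ∨ ω.2.winding (fun _ => π / 2) = -(π / 2) := by
  have hπ := Real.pi_pos
  have key := winding_hopf_of_tables_cell hh hr h (rootS_base w) safeOffsetsSE five_le_dsq_innerPt_safeOffsetsSE
    [((8 : ℤ), (4 : ℤ))] (by simp)
    (by rw [hz0, hz1, hz2]; decide) (by decide) (by rw [hz0, hz1, hz2]; decide) (by rw [hz0, hz1, hz2]; decide)
    (by rw [hz2]; decide)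
  have e : triplesTurn (((8, 0) + ((ω.1).offset - (ω.1).nIn)) :: ((8, 0) + (ω.1).offset) ::
      ([((8 : ℤ), (4 : ℤ))] ++ [(8, 6), (9, 6)])) = -6 := by rw [hz2]; decide
  rw [e] at key
  push_cast at key
  rcases key with k | k
  · left; linarith
  · right; linarith

/-- Whole-walk Umlaufsatz, cell SE, pattern `(S, E, W)`. [cite: Hopf1935, Nr. 2 (Umlaufsatz, p. 53) and Nr. 4 eq. (22) (curves with corners, pp. 60–61)] -/
theorem winding_SE_SEW (hh : holeFaceW w ∉ D) (hr : RootedFace D (w.side .W) (rootS w)) (h : ω.IsB2a)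
    (hz0 : ω.2.firstSideG = .S) (hz1 : ω.z1 hr h = .E) (hz2 : ω.1 = .W) :
    ω.2.winding (fun _ => π / 2) = 2 * π ∨ ω.2.winding (fun _ => π / 2) = -(2 * π) := by
  have hπ := Real.pi_pos
  have key := winding_hopf_of_tables_cell hh hr h (rootS_base w) safeOffsetsSE five_le_dsq_innerPt_safeOffsetsSE
    [((8 : ℤ), (4 : ℤ))] (by simp)
    (by rw [hz0, hz1, hz2]; decide) (by decide) (by rw [hz0, hz1, hz2]; decide) (by rw [hz0, hz1, hz2]; decide)
    (by rw [hz2]; decide)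
  have e : triplesTurn (((8, 0) + ((ω.1).offset - (ω.1).nIn)) :: ((8, 0) + (ω.1).offset) ::
      ([((8 : ℤ), (4 : ℤ))] ++ [(8, 6), (9, 6)])) = 0 := by rw [hz2]; decide
  rw [e] at key
  push_cast at key
  rcases key with k | k
  · left; linarith
  · right; linarith

/-- Whole-walk Umlaufsatz, cell SE, pattern `(S, W, N)`. [cite: Hopf1935, Nr. 2 (Umlaufsatz, p. 53) and Nr. 4 eq. (22) (curves with corners, pp. 60–61)] -/
theorem winding_SE_SWN (hh : holeFaceW w ∉ D) (hr : RootedFace D (w.side .W) (rootS w)) (h : ω.IsB2a)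
    (hz0 : ω.2.firstSideG = .S) (hz1 : ω.z1 hr h = .W) (hz2 : ω.1 = .N) :
    ω.2.winding (fun _ => π / 2) = 7 * π / 2 ∨ ω.2.winding (fun _ => π / 2) = -(π / 2) := by
  have hπ := Real.pi_pos
  have key := winding_hopf_of_tables_cell hh hr h (rootS_base w) safeOffsetsSE five_le_dsq_innerPt_safeOffsetsSE
    [((8 : ℤ), (4 : ℤ))] (by simp)
    (by rw [hz0, hz1, hz2]; decide) (by decide) (by rw [hz0, hz1, hz2]; decide) (by rw [hz0, hz1, hz2]; decide)
    (by rw [hz2]; decide)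
  have e : triplesTurn (((8, 0) + ((ω.1).offset - (ω.1).nIn)) :: ((8, 0) + (ω.1).offset) ::
      ([((8 : ℤ), (4 : ℤ))] ++ [(8, 6), (9, 6)])) = -6 := by rw [hz2]; decide
  rw [e] at key
  push_cast at key
  rcases key with k | k
  · left; linarith
  · right; linarith

/-- Whole-walk Umlaufsatz, cell SE, pattern `(S, W, E)`. [cite: Hopf1935, Nr. 2 (Umlaufsatz, p. 53) and Nr. 4 eq. (22) (curves with corners, pp. 60–61)] -/
theorem winding_SE_SWE (hh : holeFaceW w ∉ D) (hr : RootedFace D (w.side .W) (rootS w)) (h : ω.IsB2a)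
    (hz0 : ω.2.firstSideG = .S) (hz1 : ω.z1 hr h = .W) (hz2 : ω.1 = .E) :
    ω.2.winding (fun _ => π / 2) = 3 * π ∨ ω.2.winding (fun _ => π / 2) = -π := by
  have hπ := Real.pi_pos
  have key := winding_hopf_of_tables_cell hh hr h (rootS_base w) safeOffsetsSE five_le_dsq_innerPt_safeOffsetsSE
    [((11 : ℤ), (3 : ℤ)), (9, 3), (8, 4)] (by simp)
    (by rw [hz0, hz1, hz2]; decide) (by decide) (by rw [hz0, hz1, hz2]; decide) (by rw [hz0, hz1, hz2]; decide)
    (by rw [hz2]; decide)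
  have e : triplesTurn (((8, 0) + ((ω.1).offset - (ω.1).nIn)) :: ((8, 0) + (ω.1).offset) ::
      ([((11 : ℤ), (3 : ℤ)), (9, 3), (8, 4)] ++ [(8, 6), (9, 6)])) = -4 := by rw [hz2]; decide
  rw [e] at key
  push_cast at key
  rcases key with k | k
  · left; linarith
  · right; linarith

/-- Whole-walk Umlaufsatz, cell SE, pattern `(W, E, N)`. [cite: Hopf1935, Nr. 2 (Umlaufsatz, p. 53) and Nr. 4 eq. (22) (curves with corners, pp. 60–61)] -/
theorem winding_SE_WEN (hh : holeFaceW w ∉ D) (hr : RootedFace D (w.side .W) (rootS w)) (h : ω.IsB2a)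
    (hz0 : ω.2.firstSideG = .W) (hz1 : ω.z1 hr h = .E) (hz2 : ω.1 = .N) :
    ω.2.winding (fun _ => π / 2) = 7 * π / 2 ∨ ω.2.winding (fun _ => π / 2) = -(π / 2) := by
  have hπ := Real.pi_pos
  have key := winding_hopf_of_tables_cell hh hr h (rootS_base w) safeOffsetsSE five_le_dsq_innerPt_safeOffsetsSE
    [((8 : ℤ), (4 : ℤ))] (by simp)
    (by rw [hz0, hz1, hz2]; decide) (by decide) (by rw [hz0, hz1, hz2]; decide) (by rw [hz0, hz1, hz2]; decide)
    (by rw [hz2]; decide)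
  have e : triplesTurn (((8, 0) + ((ω.1).offset - (ω.1).nIn)) :: ((8, 0) + (ω.1).offset) ::
      ([((8 : ℤ), (4 : ℤ))] ++ [(8, 6), (9, 6)])) = -6 := by rw [hz2]; decide
  rw [e] at key
  push_cast at key
  rcases key with k | k
  · left; linarith
  · right; linarith

/-- Whole-walk Umlaufsatz, cell SE, pattern `(W, S, N)`. [cite: Hopf1935, Nr. 2 (Umlaufsatz, p. 53) and Nr. 4 eq. (22) (curves with corners, pp. 60–61)] -/
theorem winding_SE_WSN (hh : holeFaceW w ∉ D) (hr : RootedFace D (w.side .W) (rootS w)) (h : ω.IsB2a)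
    (hz0 : ω.2.firstSideG = .W) (hz1 : ω.z1 hr h = .S) (hz2 : ω.1 = .N) :
    ω.2.winding (fun _ => π / 2) = 7 * π / 2 ∨ ω.2.winding (fun _ => π / 2) = -(π / 2) := by
  have hπ := Real.pi_pos
  have key := winding_hopf_of_tables_cell hh hr h (rootS_base w) safeOffsetsSE five_le_dsq_innerPt_safeOffsetsSE
    [((8 : ℤ), (4 : ℤ))] (by simp)
    (by rw [hz0, hz1, hz2]; decide) (by decide) (by rw [hz0, hz1, hz2]; decide) (by rw [hz0, hz1, hz2]; decide)
    (by rw [hz2]; decide)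
  have e : triplesTurn (((8, 0) + ((ω.1).offset - (ω.1).nIn)) :: ((8, 0) + (ω.1).offset) ::
      ([((8 : ℤ), (4 : ℤ))] ++ [(8, 6), (9, 6)])) = -6 := by rw [hz2]; decide
  rw [e] at key
  push_cast at key
  rcases key with k | k
  · left; linarith
  · right; linarith

/-- Whole-walk Umlaufsatz, cell SE, pattern `(W, S, E)`. [cite: Hopf1935, Nr. 2 (Umlaufsatz, p. 53) and Nr. 4 eq. (22) (curves with corners, pp. 60–61)] -/
theorem winding_SE_WSE (hh : holeFaceW w ∉ D) (hr : RootedFace D (w.side .W) (rootS w)) (h : ω.IsB2a)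
    (hz0 : ω.2.firstSideG = .W) (hz1 : ω.z1 hr h = .S) (hz2 : ω.1 = .E) :
    ω.2.winding (fun _ => π / 2) = 3 * π ∨ ω.2.winding (fun _ => π / 2) = -π := by
  have hπ := Real.pi_pos
  have key := winding_hopf_of_tables_cell hh hr h (rootS_base w) safeOffsetsSE five_le_dsq_innerPt_safeOffsetsSE
    [((11 : ℤ), (3 : ℤ)), (9, 3), (8, 4)] (by simp)
    (by rw [hz0, hz1, hz2]; decide) (by decide) (by rw [hz0, hz1, hz2]; decide) (by rw [hz0, hz1, hz2]; decide)
    (by rw [hz2]; decide)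
  have e : triplesTurn (((8, 0) + ((ω.1).offset - (ω.1).nIn)) :: ((8, 0) + (ω.1).offset) ::
      ([((11 : ℤ), (3 : ℤ)), (9, 3), (8, 4)] ++ [(8, 6), (9, 6)])) = -4 := by rw [hz2]; decide
  rw [e] at key
  push_cast at key
  rcases key with k | k
  · left; linarith
  · right; linarith

/-- ★ Cell SE, pattern `(N, E, S)`, wound: `WP(π/2) = -(π / 2)`. [cite: GlazmanManolescu2019, Lemma 2.1 (proof: [Gl])] [cite: DuminilCopinSmirnov2012, proof of Lemma 1 (the winding bookkeeping)] -/
theorem WP_SE_NES (hh : holeFaceW w ∉ D) (hr : RootedFace D (w.side .W) (rootS w)) (h : ω.IsB2a)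
    (hz0 : ω.2.firstSideG = .N) (hz1 : ω.z1 hr h = .E) (hz2 : ω.1 = .S)
    (hW : ω.WE (fun _ => π / 2) ≠ excursionWinding (π / 2) ω.2.firstSideG (ω.z1 hr h) ω.1) :
    ω.WP (fun _ => π / 2) = -(π / 2) := by
  have hπ := Real.pi_pos
  have hC := (WP_SE_pi_div_two_mem hh h).1 hz0
  have hP := winding_SE_NES hh hr h hz0 hz1 hz2
  rw [winding_eq_WP_add_cell hr h] at hP
  have hWE := WE_sub_eq_of_wound_cell hr h (π / 2) hW
  rw [hz0, hz1] at hP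
  rw [hz0, hz1, hz2] at hWE
  have haT : arcTurn ((fun _ : ℤ => π / 2) (rootS w).1) Side.N Side.E = π - π / 2 := rfl
  have heW : excursionWinding (π / 2) Side.N Side.E Side.S = -2 * π + π / 2 := rfl
  have hcs : chordSign Side.N Side.E Side.S = 1 := by decide
  rw [haT] at hP
  rw [heW, hcs] at hWE
  push_cast at hWE
  rcases hC with hC | hC <;> rcases hP with hP | hP <;> first | exact hC | (exfalso; linarith)

/-- ★ Cell SE, pattern `(N, E, W)`, wound: `WP(π/2) = -(π / 2)`. [cite: GlazmanManolescu2019, Lemma 2.1 (proof: [Gl])] [cite: DuminilCopinSmirnov2012, proof of Lemma 1 (the winding bookkeeping)] -/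
theorem WP_SE_NEW (hh : holeFaceW w ∉ D) (hr : RootedFace D (w.side .W) (rootS w)) (h : ω.IsB2a)
    (hz0 : ω.2.firstSideG = .N) (hz1 : ω.z1 hr h = .E) (hz2 : ω.1 = .W)
    (hW : ω.WE (fun _ => π / 2) ≠ excursionWinding (π / 2) ω.2.firstSideG (ω.z1 hr h) ω.1) :
    ω.WP (fun _ => π / 2) = -(π / 2) := by
  have hπ := Real.pi_pos
  have hC := (WP_SE_pi_div_two_mem hh h).1 hz0
  have hP := winding_SE_NEW hh hr h hz0 hz1 hz2
  rw [winding_eq_WP_add_cell hr h] at hP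
  have hWE := WE_sub_eq_of_wound_cell hr h (π / 2) hW
  rw [hz0, hz1] at hP
  rw [hz0, hz1, hz2] at hWE
  have haT : arcTurn ((fun _ : ℤ => π / 2) (rootS w).1) Side.N Side.E = π - π / 2 := rfl
  have heW : excursionWinding (π / 2) Side.N Side.E Side.W = -2 * π := rfl
  have hcs : chordSign Side.N Side.E Side.W = 1 := by decide
  rw [haT] at hP
  rw [heW, hcs] at hWE
  push_cast at hWE
  rcases hC with hC | hC <;> rcases hP with hP | hP <;> first | exact hC | (exfalso; linarith)

/-- ★ Cell SE, pattern `(N, S, W)`, wound: `WP(π/2) = -(π / 2)`. [cite: GlazmanManolescu2019, Lemma 2.1 (proof: [Gl])] [cite: DuminilCopinSmirnov2012, proof of Lemma 1 (the winding bookkeeping)] -/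
theorem WP_SE_NSW (hh : holeFaceW w ∉ D) (hr : RootedFace D (w.side .W) (rootS w)) (h : ω.IsB2a)
    (hz0 : ω.2.firstSideG = .N) (hz1 : ω.z1 hr h = .S) (hz2 : ω.1 = .W)
    (hW : ω.WE (fun _ => π / 2) ≠ excursionWinding (π / 2) ω.2.firstSideG (ω.z1 hr h) ω.1) :
    ω.WP (fun _ => π / 2) = -(π / 2) := by
  have hπ := Real.pi_pos
  have hC := (WP_SE_pi_div_two_mem hh h).1 hz0
  have hP := winding_SE_NSW hh hr h hz0 hz1 hz2
  rw [winding_eq_WP_add_cell hr h] at hP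
  have hWE := WE_sub_eq_of_wound_cell hr h (π / 2) hW
  rw [hz0, hz1] at hP
  rw [hz0, hz1, hz2] at hWE
  have haT : arcTurn ((fun _ : ℤ => π / 2) (rootS w).1) Side.N Side.S = 0 := rfl
  have heW : excursionWinding (π / 2) Side.N Side.S Side.W = -π - π / 2 := rfl
  have hcs : chordSign Side.N Side.S Side.W = 1 := by decide
  rw [haT] at hP
  rw [heW, hcs] at hWE
  push_cast at hWE
  rcases hC with hC | hC <;> rcases hP with hP | hP <;> first | exact hC | (exfalso; linarith)

/-- ★ Cell SE: pattern `(E, N, S)` is impossible (wound or not). [cite: GlazmanManolescu2019, Lemma 2.1 (proof: [Gl])] [cite: DuminilCopinSmirnov2012, proof of Lemma 1 (the winding bookkeeping)] -/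
theorem no_SE_ENS (hh : holeFaceW w ∉ D) (hr : RootedFace D (w.side .W) (rootS w)) (h : ω.IsB2a)
    (hz0 : ω.2.firstSideG = .E) (hz1 : ω.z1 hr h = .N) (hz2 : ω.1 = .S) : False := by
  have hπ := Real.pi_pos
  have hC := (WP_SE_pi_div_two_mem hh h).2.1 hz0
  have hP := winding_SE_ENS hh hr h hz0 hz1 hz2
  rw [winding_eq_WP_add_cell hr h] at hP
  rw [hz0, hz1] at hP
  have haT : arcTurn ((fun _ : ℤ => π / 2) (rootS w).1) Side.E Side.N = π / 2 - π := rfl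
  have heW : excursionWinding (π / 2) Side.E Side.N Side.S = 2 * π := rfl
  have hcs : chordSign Side.E Side.N Side.S = -1 := by decide
  rw [haT] at hP
  rcases ω.sign_law hr h (π / 2) with ⟨hWE, -⟩ | ⟨hWE, -⟩ <;> rw [hz0, hz1, hz2, heW] at hWE
  · rcases hC with hC | hC <;> rcases hP with hP | hP <;> linarith
  · rw [hcs] at hWE
    push_cast at hWE
    rcases hC with hC | hC <;> rcases hP with hP | hP <;> linarith

/-- ★ Cell SE: pattern `(E, N, W)` is impossible (wound or not). [cite: GlazmanManolescu2019, Lemma 2.1 (proof: [Gl])] [cite: DuminilCopinSmirnov2012, proof of Lemma 1 (the winding bookkeeping)] -/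
theorem no_SE_ENW (hh : holeFaceW w ∉ D) (hr : RootedFace D (w.side .W) (rootS w)) (h : ω.IsB2a)
    (hz0 : ω.2.firstSideG = .E) (hz1 : ω.z1 hr h = .N) (hz2 : ω.1 = .W) : False := by
  have hπ := Real.pi_pos
  have hC := (WP_SE_pi_div_two_mem hh h).2.1 hz0
  have hP := winding_SE_ENW hh hr h hz0 hz1 hz2
  rw [winding_eq_WP_add_cell hr h] at hP
  rw [hz0, hz1] at hP
  have haT : arcTurn ((fun _ : ℤ => π / 2) (rootS w).1) Side.E Side.N = π / 2 - π := rfl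
  have heW : excursionWinding (π / 2) Side.E Side.N Side.W = 2 * π - π / 2 := rfl
  have hcs : chordSign Side.E Side.N Side.W = -1 := by decide
  rw [haT] at hP
  rcases ω.sign_law hr h (π / 2) with ⟨hWE, -⟩ | ⟨hWE, -⟩ <;> rw [hz0, hz1, hz2, heW] at hWE
  · rcases hC with hC | hC <;> rcases hP with hP | hP <;> linarith
  · rw [hcs] at hWE
    push_cast at hWE
    rcases hC with hC | hC <;> rcases hP with hP | hP <;> linarith

/-- ★ Cell SE: pattern `(E, S, N)` is impossible (wound or not). [cite: GlazmanManolescu2019, Lemma 2.1 (proof: [Gl])] [cite: DuminilCopinSmirnov2012, proof of Lemma 1 (the winding bookkeeping)] -/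
theorem no_SE_ESN (hh : holeFaceW w ∉ D) (hr : RootedFace D (w.side .W) (rootS w)) (h : ω.IsB2a)
    (hz0 : ω.2.firstSideG = .E) (hz1 : ω.z1 hr h = .S) (hz2 : ω.1 = .N) : False := by
  have hπ := Real.pi_pos
  have hC := (WP_SE_pi_div_two_mem hh h).2.1 hz0
  have hP := winding_SE_ESN hh hr h hz0 hz1 hz2
  rw [winding_eq_WP_add_cell hr h] at hP
  rw [hz0, hz1] at hP
  have haT : arcTurn ((fun _ : ℤ => π / 2) (rootS w).1) Side.E Side.S = π / 2 := rfl
  have heW : excursionWinding (π / 2) Side.E Side.S Side.N = -2 * π := rfl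
  have hcs : chordSign Side.E Side.S Side.N = 1 := by decide
  rw [haT] at hP
  rcases ω.sign_law hr h (π / 2) with ⟨hWE, -⟩ | ⟨hWE, -⟩ <;> rw [hz0, hz1, hz2, heW] at hWE
  · rcases hC with hC | hC <;> rcases hP with hP | hP <;> linarith
  · rw [hcs] at hWE
    push_cast at hWE
    rcases hC with hC | hC <;> rcases hP with hP | hP <;> linarith

/-- ★ Cell SE, pattern `(E, S, W)`, wound: `WP(π/2) = -π`. [cite: GlazmanManolescu2019, Lemma 2.1 (proof: [Gl])] [cite: DuminilCopinSmirnov2012, proof of Lemma 1 (the winding bookkeeping)] -/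
theorem WP_SE_ESW (hh : holeFaceW w ∉ D) (hr : RootedFace D (w.side .W) (rootS w)) (h : ω.IsB2a)
    (hz0 : ω.2.firstSideG = .E) (hz1 : ω.z1 hr h = .S) (hz2 : ω.1 = .W)
    (hW : ω.WE (fun _ => π / 2) ≠ excursionWinding (π / 2) ω.2.firstSideG (ω.z1 hr h) ω.1) :
    ω.WP (fun _ => π / 2) = -π := by
  have hπ := Real.pi_pos
  have hC := (WP_SE_pi_div_two_mem hh h).2.1 hz0
  have hP := winding_SE_ESW hh hr h hz0 hz1 hz2
  rw [winding_eq_WP_add_cell hr h] at hP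
  have hWE := WE_sub_eq_of_wound_cell hr h (π / 2) hW
  rw [hz0, hz1] at hP
  rw [hz0, hz1, hz2] at hWE
  have haT : arcTurn ((fun _ : ℤ => π / 2) (rootS w).1) Side.E Side.S = π / 2 := rfl
  have heW : excursionWinding (π / 2) Side.E Side.S Side.W = -π - π / 2 := rfl
  have hcs : chordSign Side.E Side.S Side.W = 1 := by decide
  rw [haT] at hP
  rw [heW, hcs] at hWE
  push_cast at hWE
  rcases hC with hC | hC <;> rcases hP with hP | hP <;> first | exact hC | (exfalso; linarith)

/-- ★ Cell SE: pattern `(E, W, N)` is impossible (wound or not). [cite: GlazmanManolescu2019, Lemma 2.1 (proof: [Gl])] [cite: DuminilCopinSmirnov2012, proof of Lemma 1 (the winding bookkeeping)] -/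
theorem no_SE_EWN (hh : holeFaceW w ∉ D) (hr : RootedFace D (w.side .W) (rootS w)) (h : ω.IsB2a)
    (hz0 : ω.2.firstSideG = .E) (hz1 : ω.z1 hr h = .W) (hz2 : ω.1 = .N) : False := by
  have hπ := Real.pi_pos
  have hC := (WP_SE_pi_div_two_mem hh h).2.1 hz0
  have hP := winding_SE_EWN hh hr h hz0 hz1 hz2
  rw [winding_eq_WP_add_cell hr h] at hP
  rw [hz0, hz1] at hP
  have haT : arcTurn ((fun _ : ℤ => π / 2) (rootS w).1) Side.E Side.W = 0 := rfl
  have heW : excursionWinding (π / 2) Side.E Side.W Side.N = -2 * π + π / 2 := rfl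
  have hcs : chordSign Side.E Side.W Side.N = 1 := by decide
  rw [haT] at hP
  rcases ω.sign_law hr h (π / 2) with ⟨hWE, -⟩ | ⟨hWE, -⟩ <;> rw [hz0, hz1, hz2, heW] at hWE
  · rcases hC with hC | hC <;> rcases hP with hP | hP <;> linarith
  · rw [hcs] at hWE
    push_cast at hWE
    rcases hC with hC | hC <;> rcases hP with hP | hP <;> linarith

/-- ★ Cell SE: pattern `(S, N, W)` is impossible (wound or not). [cite: GlazmanManolescu2019, Lemma 2.1 (proof: [Gl])] [cite: DuminilCopinSmirnov2012, proof of Lemma 1 (the winding bookkeeping)] -/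
theorem no_SE_SNW (hh : holeFaceW w ∉ D) (hr : RootedFace D (w.side .W) (rootS w)) (h : ω.IsB2a)
    (hz0 : ω.2.firstSideG = .S) (hz1 : ω.z1 hr h = .N) (hz2 : ω.1 = .W) : False := by
  have hπ := Real.pi_pos
  have hC := (WP_SE_pi_div_two_mem hh h).2.2.1 hz0
  have hP := winding_SE_SNW hh hr h hz0 hz1 hz2
  rw [winding_eq_WP_add_cell hr h] at hP
  rw [hz0, hz1] at hP
  have haT : arcTurn ((fun _ : ℤ => π / 2) (rootS w).1) Side.S Side.N = 0 := rfl
  have heW : excursionWinding (π / 2) Side.S Side.N Side.W = 2 * π - π / 2 := rfl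
  have hcs : chordSign Side.S Side.N Side.W = -1 := by decide
  rw [haT] at hP
  rcases ω.sign_law hr h (π / 2) with ⟨hWE, -⟩ | ⟨hWE, -⟩ <;> rw [hz0, hz1, hz2, heW] at hWE
  · rcases hC with hC | hC <;> rcases hP with hP | hP <;> linarith
  · rw [hcs] at hWE
    push_cast at hWE
    rcases hC with hC | hC <;> rcases hP with hP | hP <;> linarith

/-- ★ Cell SE, pattern `(S, E, N)`, wound: `WP(π/2) = 5 * π / 2`. [cite: GlazmanManolescu2019, Lemma 2.1 (proof: [Gl])] [cite: DuminilCopinSmirnov2012, proof of Lemma 1 (the winding bookkeeping)] -/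
theorem WP_SE_SEN (hh : holeFaceW w ∉ D) (hr : RootedFace D (w.side .W) (rootS w)) (h : ω.IsB2a)
    (hz0 : ω.2.firstSideG = .S) (hz1 : ω.z1 hr h = .E) (hz2 : ω.1 = .N)
    (hW : ω.WE (fun _ => π / 2) ≠ excursionWinding (π / 2) ω.2.firstSideG (ω.z1 hr h) ω.1) :
    ω.WP (fun _ => π / 2) = 5 * π / 2 := by
  have hπ := Real.pi_pos
  have hC := (WP_SE_pi_div_two_mem hh h).2.2.1 hz0
  have hP := winding_SE_SEN hh hr h hz0 hz1 hz2
  rw [winding_eq_WP_add_cell hr h] at hP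
  have hWE := WE_sub_eq_of_wound_cell hr h (π / 2) hW
  rw [hz0, hz1] at hP
  rw [hz0, hz1, hz2] at hWE
  have haT : arcTurn ((fun _ : ℤ => π / 2) (rootS w).1) Side.S Side.E = -(π / 2) := rfl
  have heW : excursionWinding (π / 2) Side.S Side.E Side.N = π + π / 2 := rfl
  have hcs : chordSign Side.S Side.E Side.N = -1 := by decide
  rw [haT] at hP
  rw [heW, hcs] at hWE
  push_cast at hWE
  rcases hC with hC | hC <;> rcases hP with hP | hP <;> first | exact hC | (exfalso; linarith)

/-- ★ Cell SE: pattern `(S, E, W)` is impossible (wound or not). [cite: GlazmanManolescu2019, Lemma 2.1 (proof: [Gl])] [cite: DuminilCopinSmirnov2012, proof of Lemma 1 (the winding bookkeeping)] -/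
theorem no_SE_SEW (hh : holeFaceW w ∉ D) (hr : RootedFace D (w.side .W) (rootS w)) (h : ω.IsB2a)
    (hz0 : ω.2.firstSideG = .S) (hz1 : ω.z1 hr h = .E) (hz2 : ω.1 = .W) : False := by
  have hπ := Real.pi_pos
  have hC := (WP_SE_pi_div_two_mem hh h).2.2.1 hz0
  have hP := winding_SE_SEW hh hr h hz0 hz1 hz2
  rw [winding_eq_WP_add_cell hr h] at hP
  rw [hz0, hz1] at hP
  have haT : arcTurn ((fun _ : ℤ => π / 2) (rootS w).1) Side.S Side.E = -(π / 2) := rfl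
  have heW : excursionWinding (π / 2) Side.S Side.E Side.W = 2 * π := rfl
  have hcs : chordSign Side.S Side.E Side.W = -1 := by decide
  rw [haT] at hP
  rcases ω.sign_law hr h (π / 2) with ⟨hWE, -⟩ | ⟨hWE, -⟩ <;> rw [hz0, hz1, hz2, heW] at hWE
  · rcases hC with hC | hC <;> rcases hP with hP | hP <;> linarith
  · rw [hcs] at hWE
    push_cast at hWE
    rcases hC with hC | hC <;> rcases hP with hP | hP <;> linarith

/-- ★ Cell SE: pattern `(S, W, N)` is impossible (wound or not). [cite: GlazmanManolescu2019, Lemma 2.1 (proof: [Gl])] [cite: DuminilCopinSmirnov2012, proof of Lemma 1 (the winding bookkeeping)] -/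
theorem no_SE_SWN (hh : holeFaceW w ∉ D) (hr : RootedFace D (w.side .W) (rootS w)) (h : ω.IsB2a)
    (hz0 : ω.2.firstSideG = .S) (hz1 : ω.z1 hr h = .W) (hz2 : ω.1 = .N) : False := by
  have hπ := Real.pi_pos
  have hC := (WP_SE_pi_div_two_mem hh h).2.2.1 hz0
  have hP := winding_SE_SWN hh hr h hz0 hz1 hz2
  rw [winding_eq_WP_add_cell hr h] at hP
  rw [hz0, hz1] at hP
  have haT : arcTurn ((fun _ : ℤ => π / 2) (rootS w).1) Side.S Side.W = π - π / 2 := rfl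
  have heW : excursionWinding (π / 2) Side.S Side.W Side.N = -2 * π + π / 2 := rfl
  have hcs : chordSign Side.S Side.W Side.N = 1 := by decide
  rw [haT] at hP
  rcases ω.sign_law hr h (π / 2) with ⟨hWE, -⟩ | ⟨hWE, -⟩ <;> rw [hz0, hz1, hz2, heW] at hWE
  · rcases hC with hC | hC <;> rcases hP with hP | hP <;> linarith
  · rw [hcs] at hWE
    push_cast at hWE
    rcases hC with hC | hC <;> rcases hP with hP | hP <;> linarith

/-- ★ Cell SE: pattern `(S, W, E)` is impossible (wound or not). [cite: GlazmanManolescu2019, Lemma 2.1 (proof: [Gl])] [cite: DuminilCopinSmirnov2012, proof of Lemma 1 (the winding bookkeeping)] -/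
theorem no_SE_SWE (hh : holeFaceW w ∉ D) (hr : RootedFace D (w.side .W) (rootS w)) (h : ω.IsB2a)
    (hz0 : ω.2.firstSideG = .S) (hz1 : ω.z1 hr h = .W) (hz2 : ω.1 = .E) : False := by
  have hπ := Real.pi_pos
  have hC := (WP_SE_pi_div_two_mem hh h).2.2.1 hz0
  have hP := winding_SE_SWE hh hr h hz0 hz1 hz2
  rw [winding_eq_WP_add_cell hr h] at hP
  rw [hz0, hz1] at hP
  have haT : arcTurn ((fun _ : ℤ => π / 2) (rootS w).1) Side.S Side.W = π - π / 2 := rfl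
  have heW : excursionWinding (π / 2) Side.S Side.W Side.E = -2 * π := rfl
  have hcs : chordSign Side.S Side.W Side.E = 1 := by decide
  rw [haT] at hP
  rcases ω.sign_law hr h (π / 2) with ⟨hWE, -⟩ | ⟨hWE, -⟩ <;> rw [hz0, hz1, hz2, heW] at hWE
  · rcases hC with hC | hC <;> rcases hP with hP | hP <;> linarith
  · rw [hcs] at hWE
    push_cast at hWE
    rcases hC with hC | hC <;> rcases hP with hP | hP <;> linarith

/-- ★ Cell SE, pattern `(W, E, N)`, wound: `WP(π/2) = 2 * π`. [cite: GlazmanManolescu2019, Lemma 2.1 (proof: [Gl])] [cite: DuminilCopinSmirnov2012, proof of Lemma 1 (the winding bookkeeping)] -/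
theorem WP_SE_WEN (hh : holeFaceW w ∉ D) (hr : RootedFace D (w.side .W) (rootS w)) (h : ω.IsB2a)
    (hz0 : ω.2.firstSideG = .W) (hz1 : ω.z1 hr h = .E) (hz2 : ω.1 = .N)
    (hW : ω.WE (fun _ => π / 2) ≠ excursionWinding (π / 2) ω.2.firstSideG (ω.z1 hr h) ω.1) :
    ω.WP (fun _ => π / 2) = 2 * π := by
  have hπ := Real.pi_pos
  have hC := (WP_SE_pi_div_two_mem hh h).2.2.2 hz0
  have hP := winding_SE_WEN hh hr h hz0 hz1 hz2
  rw [winding_eq_WP_add_cell hr h] at hP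
  have hWE := WE_sub_eq_of_wound_cell hr h (π / 2) hW
  rw [hz0, hz1] at hP
  rw [hz0, hz1, hz2] at hWE
  have haT : arcTurn ((fun _ : ℤ => π / 2) (rootS w).1) Side.W Side.E = 0 := rfl
  have heW : excursionWinding (π / 2) Side.W Side.E Side.N = π + π / 2 := rfl
  have hcs : chordSign Side.W Side.E Side.N = -1 := by decide
  rw [haT] at hP
  rw [heW, hcs] at hWE
  push_cast at hWE
  rcases hC with hC | hC <;> rcases hP with hP | hP <;> first | exact hC | (exfalso; linarith)

/-- ★ Cell SE, pattern `(W, S, N)`, wound: `WP(π/2) = 2 * π`. [cite: GlazmanManolescu2019, Lemma 2.1 (proof: [Gl])] [cite: DuminilCopinSmirnov2012, proof of Lemma 1 (the winding bookkeeping)] -/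
theorem WP_SE_WSN (hh : holeFaceW w ∉ D) (hr : RootedFace D (w.side .W) (rootS w)) (h : ω.IsB2a)
    (hz0 : ω.2.firstSideG = .W) (hz1 : ω.z1 hr h = .S) (hz2 : ω.1 = .N)
    (hW : ω.WE (fun _ => π / 2) ≠ excursionWinding (π / 2) ω.2.firstSideG (ω.z1 hr h) ω.1) :
    ω.WP (fun _ => π / 2) = 2 * π := by
  have hπ := Real.pi_pos
  have hC := (WP_SE_pi_div_two_mem hh h).2.2.2 hz0
  have hP := winding_SE_WSN hh hr h hz0 hz1 hz2
  rw [winding_eq_WP_add_cell hr h] at hP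
  have hWE := WE_sub_eq_of_wound_cell hr h (π / 2) hW
  rw [hz0, hz1] at hP
  rw [hz0, hz1, hz2] at hWE
  have haT : arcTurn ((fun _ : ℤ => π / 2) (rootS w).1) Side.W Side.S = π / 2 - π := rfl
  have heW : excursionWinding (π / 2) Side.W Side.S Side.N = 2 * π := rfl
  have hcs : chordSign Side.W Side.S Side.N = -1 := by decide
  rw [haT] at hP
  rw [heW, hcs] at hWE
  push_cast at hWE
  rcases hC with hC | hC <;> rcases hP with hP | hP <;> first | exact hC | (exfalso; linarith)

/-- ★ Cell SE, pattern `(W, S, E)`, wound: `WP(π/2) = 2 * π`. [cite: GlazmanManolescu2019, Lemma 2.1 (proof: [Gl])] [cite: DuminilCopinSmirnov2012, proof of Lemma 1 (the winding bookkeeping)] -/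
theorem WP_SE_WSE (hh : holeFaceW w ∉ D) (hr : RootedFace D (w.side .W) (rootS w)) (h : ω.IsB2a)
    (hz0 : ω.2.firstSideG = .W) (hz1 : ω.z1 hr h = .S) (hz2 : ω.1 = .E)
    (hW : ω.WE (fun _ => π / 2) ≠ excursionWinding (π / 2) ω.2.firstSideG (ω.z1 hr h) ω.1) :
    ω.WP (fun _ => π / 2) = 2 * π := by
  have hπ := Real.pi_pos
  have hC := (WP_SE_pi_div_two_mem hh h).2.2.2 hz0
  have hP := winding_SE_WSE hh hr h hz0 hz1 hz2
  rw [winding_eq_WP_add_cell hr h] at hP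
  have hWE := WE_sub_eq_of_wound_cell hr h (π / 2) hW
  rw [hz0, hz1] at hP
  rw [hz0, hz1, hz2] at hWE
  have haT : arcTurn ((fun _ : ℤ => π / 2) (rootS w).1) Side.W Side.S = π / 2 - π := rfl
  have heW : excursionWinding (π / 2) Side.W Side.S Side.E = 2 * π - π / 2 := rfl
  have hcs : chordSign Side.W Side.S Side.E = -1 := by decide
  rw [haT] at hP
  rw [heW, hcs] at hWE
  push_cast at hWE
  rcases hC with hC | hC <;> rcases hP with hP | hP <;> first | exact hC | (exfalso; linarith)

/-- **The forced prefix turning at cell SE**, by first side (at `θ = π/2`). [cite: GlazmanManolescu2019, Lemma 2.1 (proof: [Gl])] -/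
def ringTurnSE : Side → ℝ
  | .N => -(π / 2)
  | .E => -π
  | .S => 5 * π / 2
  | .W => 2 * π

/-- The directly treated patterns at cell SE (one orientation per pinned class, both orientations of the impossible
classes). [folklore] -/
def ringPatternsSE : List (Side × Side × Side) :=
  [(.N, .E, .S), (.N, .E, .W), (.N, .S, .W), (.E, .N, .S), (.E, .N, .W), (.E, .S, .N), (.E, .S, .W), (.E, .W, .N), (.S, .N, .W), (.S, .E, .N), (.S, .E, .W), (.S, .W, .N), (.S, .W, .E), (.W, .E, .N), (.W, .S, .N), (.W, .S, .E)]

/-- Every pattern of three distinct sides is treated directly or through its reversal. [folklore] -/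
private theorem ringPatternsSE_cover : ∀ a b c : Side, a ≠ b → a ≠ c → b ≠ c →
    (a, b, c) ∈ ringPatternsSE ∨ (a, c, b) ∈ ringPatternsSE := by decide

/-- ★★ The directly treated patterns at cell SE: wound ⇒ `WP(π/2) = ringTurnSE z₀`. [cite: Hopf1935, Nr. 2 (Umlaufsatz, p. 53) and Nr. 4 eq. (22) (curves with corners, pp. 60–61)] [cite: GlazmanManolescu2019, Lemma 2.1 (proof: [Gl])] -/
theorem WP_SE_eq_of_mem (hh : holeFaceW w ∉ D) (hr : RootedFace D (w.side .W) (rootS w)) (h : ω.IsB2a)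
    (hmem : (ω.2.firstSideG, ω.z1 hr h, ω.1) ∈ ringPatternsSE)
    (hW : ω.WE (fun _ => π / 2) ≠ excursionWinding (π / 2) ω.2.firstSideG (ω.z1 hr h) ω.1) :
    ω.WP (fun _ => π / 2) = ringTurnSE ω.2.firstSideG := by
  simp only [ringPatternsSE, List.mem_cons, Prod.mk.injEq, List.mem_nil_iff, or_false] at hmem
  rcases hmem with ⟨h0, h1, h2⟩ | ⟨h0, h1, h2⟩ | ⟨h0, h1, h2⟩ | ⟨h0, h1, h2⟩ | ⟨h0, h1, h2⟩ | ⟨h0, h1, h2⟩ | ⟨h0, h1, h2⟩ | ⟨h0, h1, h2⟩ | ⟨h0, h1, h2⟩ | ⟨h0, h1, h2⟩ | ⟨h0, h1, h2⟩ | ⟨h0, h1, h2⟩ | ⟨h0, h1, h2⟩ | ⟨h0, h1, h2⟩ | ⟨h0, h1, h2⟩ | ⟨h0, h1, h2⟩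
  · rw [WP_SE_NES hh hr h h0 h1 h2 hW, h0]; rfl
  · rw [WP_SE_NEW hh hr h h0 h1 h2 hW, h0]; rfl
  · rw [WP_SE_NSW hh hr h h0 h1 h2 hW, h0]; rfl
  · exact (no_SE_ENS hh hr h h0 h1 h2).elim
  · exact (no_SE_ENW hh hr h h0 h1 h2).elim
  · exact (no_SE_ESN hh hr h h0 h1 h2).elim
  · rw [WP_SE_ESW hh hr h h0 h1 h2 hW, h0]; rfl
  · exact (no_SE_EWN hh hr h h0 h1 h2).elim
  · exact (no_SE_SNW hh hr h h0 h1 h2).elim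
  · rw [WP_SE_SEN hh hr h h0 h1 h2 hW, h0]; rfl
  · exact (no_SE_SEW hh hr h h0 h1 h2).elim
  · exact (no_SE_SWN hh hr h h0 h1 h2).elim
  · exact (no_SE_SWE hh hr h h0 h1 h2).elim
  · rw [WP_SE_WEN hh hr h h0 h1 h2 hW, h0]; rfl
  · rw [WP_SE_WSN hh hr h h0 h1 h2 hW, h0]; rfl
  · rw [WP_SE_WSE hh hr h h0 h1 h2 hW, h0]; rfl

/-- ★★★ **THE TURNING RIGIDITY AT CELL SE (θ = π/2)**: for every WOUND class-`B2a` walk of the hole root `w.side W` at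
the cell SOUTH of the root plaquette (`SE` of the hole), the right-angle turning of the prefix is `ringTurnSE z₀` — fixed by the first side alone.
[cite: Hopf1935, Nr. 2 (Umlaufsatz, p. 53) and Nr. 4 eq. (22) (curves with corners, pp. 60–61)] [cite: GlazmanManolescu2019, Lemma 2.1 (proof: [Gl])] [cite: DuminilCopinSmirnov2012, proof of Lemma 1 (the winding bookkeeping)] -/
theorem WP_SE_pi_div_two_eq_of_wound (hh : holeFaceW w ∉ D) (hr : RootedFace D (w.side .W) (rootS w))
    (h : ω.IsB2a) (hW : ω.WE (fun _ => π / 2) ≠ excursionWinding (π / 2) ω.2.firstSideG (ω.z1 hr h) ω.1) :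
    ω.WP (fun _ => π / 2) = ringTurnSE ω.2.firstSideG := by
  obtain ⟨hz01, hz02, hz12⟩ := ω.firstSide_exit_return_distinct hr h
  rcases ringPatternsSE_cover _ _ _ hz01 hz02 hz12 with hd | hd
  · exact WP_SE_eq_of_mem hh hr h hd hW
  · have h'' := ω.rev_isB2a hr h
    have e1 : (ω.rev hr).z1 hr h'' = ω.1 := by unfold ΩG.z1; exact ω.rev_exitSide hr h
    have e2 : (ω.rev hr).1 = ω.z1 hr h := ω.rev_fst hr h
    have e0 : (ω.rev hr).2.firstSideG = ω.2.firstSideG := ω.rev_firstSide hr h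
    have hWr : (ω.rev hr).WE (fun _ => π / 2) ≠
        excursionWinding (π / 2) (ω.rev hr).2.firstSideG ((ω.rev hr).z1 hr h'') (ω.rev hr).1 := by
      rw [ω.rev_WE (fun _ => π / 2) hr h, e0, e1, e2, excursionWinding_swap]
      intro e; apply hW; linarith
    have key := WP_SE_eq_of_mem (ω := ω.rev hr) hh hr h'' (by rw [e0, e1, e2]; exact hd) hWr
    rwa [ω.rev_WP (fun _ => π / 2) hr h, e0] at key

/-- ★★ **ENTRY–EXIT EXCLUSION AT CELL SE** (wound or not): a walk that entered from `E` never uses the side `N`; a walk that entered from `S` never uses the side `W`. [cite: Hopf1935, Nr. 2 (Umlaufsatz, p. 53) and Nr. 4 eq. (22) (curves with corners, pp. 60–61)] [cite: GlazmanManolescu2019, Lemma 2.1 (proof: [Gl])] -/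
theorem SE_entry_exit_exclusion (hh : holeFaceW w ∉ D) (hr : RootedFace D (w.side .W) (rootS w)) (h : ω.IsB2a) :
    (ω.2.firstSideG = .E → ω.z1 hr h ≠ .N ∧ ω.1 ≠ .N) ∧
      (ω.2.firstSideG = .S → ω.z1 hr h ≠ .W ∧ ω.1 ≠ .W) := by
  obtain ⟨hz01, hz02, hz12⟩ := ω.firstSide_exit_return_distinct hr h
  constructor
  · intro hz0
    constructor
    · intro hz1
      rcases hω : ω.1 with _ | _ | _ | _
      · exact no_SE_ENW hh hr h hz0 hz1 hω
      · rw [hz0, hω] at hz02; exact hz02 rfl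
      · exact no_SE_ENS hh hr h hz0 hz1 hω
      · rw [hz1, hω] at hz12; exact hz12 rfl
    · intro hz2
      rcases hω : ω.z1 hr h with _ | _ | _ | _
      · exact no_SE_EWN hh hr h hz0 hω hz2
      · rw [hz0, hω] at hz01; exact hz01 rfl
      · exact no_SE_ESN hh hr h hz0 hω hz2
      · rw [hz2, hω] at hz12; exact hz12 rfl
  · intro hz0
    constructor
    · intro hz1
      rcases hω : ω.1 with _ | _ | _ | _
      · rw [hz1, hω] at hz12; exact hz12 rfl
      · exact no_SE_SWE hh hr h hz0 hz1 hω
      · rw [hz0, hω] at hz02; exact hz02 rfl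
      · exact no_SE_SWN hh hr h hz0 hz1 hω
    · intro hz2
      rcases hω : ω.z1 hr h with _ | _ | _ | _
      · rw [hz2, hω] at hz12; exact hz12 rfl
      · exact no_SE_SEW hh hr h hz0 hω hz2
      · rw [hz0, hω] at hz01; exact hz01 rfl
      · exact no_SE_SNW hh hr h hz0 hω hz2

/-- ★★★ **THE TURNING RIGIDITY AT CELL SE, every angle**: for every WOUND class-`B2a` walk at the cell SOUTH of the root plaquette (`SE` of the hole)
(hole `holeFaceW w ∉ D`): `N` ⇒ `θ - π`, `E` ⇒ `-π`, `S` ⇒ `θ + 2 * π`, `W` ⇒ `2 * π`. [cite: Hopf1935, Nr. 2 (Umlaufsatz, p. 53) and Nr. 4 eq. (22) (curves with corners, pp. 60–61)] [cite: GlazmanManolescu2019, Lemma 2.1 (proof: [Gl])] [cite: DuminilCopinSmirnov2012, proof of Lemma 1 (the winding bookkeeping)] -/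
theorem WP_SE_eq_of_wound (hh : holeFaceW w ∉ D) (hr : RootedFace D (w.side .W) (rootS w)) (h : ω.IsB2a)
    (θ : ℝ) (hW : ω.WE (fun _ => θ) ≠ excursionWinding θ ω.2.firstSideG (ω.z1 hr h) ω.1) :
    (ω.2.firstSideG = .N → ω.WP (fun _ => θ) = θ - π) ∧
      (ω.2.firstSideG = .E → ω.WP (fun _ => θ) = -π) ∧
      (ω.2.firstSideG = .S → ω.WP (fun _ => θ) = θ + 2 * π) ∧
      (ω.2.firstSideG = .W → ω.WP (fun _ => θ) = 2 * π) := by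
  have hW' : ω.WE (fun _ => π / 2) ≠ excursionWinding (π / 2) ω.2.firstSideG (ω.z1 hr h) ω.1 := by
    intro e; apply hW
    have := WE_sub_excursionWinding_const_cell (ω := ω) hr h θ
    linarith
  have key := WP_SE_pi_div_two_eq_of_wound hh hr h hW'
  have htr := WP_cell_of_pinned (ω := ω) h θ key
  refine ⟨fun hz => ?_, fun hz => ?_, fun hz => ?_, fun hz => ?_⟩ <;> rw [htr, hz] <;>
    simp only [ringTurnSE, Side.slantInd] <;> ring

end CellSE

end ΩG

/-! ## § Ring cell NE: the cell NORTH of the root plaquette (`NE` of the hole) — instances, pinning, assembly -/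

namespace ΩG

variable {D : Set Face} {w : Face} {ω : ΩG D (w.side .W) (rootN w)}

section CellNE

/-- ★★ **The prefix turns by one of two values** at the cell NORTH of the root plaquette (`NE` of the hole): `N`: `{3 * π / 2, -(5 * π / 2)}`; `E`: `{π, -(3 * π)}`; `S`: `{π / 2, -(7 * π / 2)}`; `W`: `{2 * π, -(2 * π)}`. [cite: Hopf1935, Nr. 2 (Umlaufsatz, p. 53) and Nr. 4 eq. (22) (curves with corners, pp. 60–61)] [cite: GlazmanManolescu2019, Lemma 2.1 (proof: [Gl])] -/
theorem WP_NE_pi_div_two_mem (hh : holeFaceW w ∉ D) (h : ω.IsB2a) :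
    (ω.2.firstSideG = .N → ω.WP (fun _ => π / 2) = 3 * π / 2 ∨ ω.WP (fun _ => π / 2) = -(5 * π / 2)) ∧
      (ω.2.firstSideG = .E → ω.WP (fun _ => π / 2) = π ∨ ω.WP (fun _ => π / 2) = -(3 * π)) ∧
      (ω.2.firstSideG = .S → ω.WP (fun _ => π / 2) = π / 2 ∨ ω.WP (fun _ => π / 2) = -(7 * π / 2)) ∧
      (ω.2.firstSideG = .W → ω.WP (fun _ => π / 2) = 2 * π ∨ ω.WP (fun _ => π / 2) = -(2 * π)) := by
  have hπ := Real.pi_pos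
  refine ⟨fun hz => ?_, fun hz => ?_, fun hz => ?_, fun hz => ?_⟩
  · have key := WP_hopf_of_tables_cell (ω := ω) hh (rootN_side_ne_root w) h (rootN_base w) safeOffsetsNE
      five_le_dsq_innerPt_safeOffsetsNE [((10 : ℤ), (10 : ℤ)), (9, 9), (8, 8)] (by simp)
      (by rw [hz]; decide) (by decide) (by rw [hz]; decide) (by rw [hz]; decide) (by rw [hz]; decide)
    rw [hz] at key
    have e : triplesTurn (((8, 8) + (Side.N.offset - Side.N.nIn)) :: ((8, 8) + Side.N.offset) ::
        ([((10 : ℤ), (10 : ℤ)), (9, 9), (8, 8)] ++ [(8, 6), (9, 6)])) = 2 := by decide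
    rw [e] at key
    push_cast at key
    rcases key with k | k
    · left; linarith
    · right; linarith
  · have key := WP_hopf_of_tables_cell (ω := ω) hh (rootN_side_ne_root w) h (rootN_base w) safeOffsetsNE
      five_le_dsq_innerPt_safeOffsetsNE [((10 : ℤ), (10 : ℤ)), (9, 9), (8, 8)] (by simp)
      (by rw [hz]; decide) (by decide) (by rw [hz]; decide) (by rw [hz]; decide) (by rw [hz]; decide)
    rw [hz] at key
    have e : triplesTurn (((8, 8) + (Side.E.offset - Side.E.nIn)) :: ((8, 8) + Side.E.offset) ::
        ([((10 : ℤ), (10 : ℤ)), (9, 9), (8, 8)] ++ [(8, 6), (9, 6)])) = 4 := by decide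
    rw [e] at key
    push_cast at key
    rcases key with k | k
    · left; linarith
    · right; linarith
  · have key := WP_hopf_of_tables_cell (ω := ω) hh (rootN_side_ne_root w) h (rootN_base w) safeOffsetsNE
      five_le_dsq_innerPt_safeOffsetsNE [((8 : ℤ), (8 : ℤ))] (by simp)
      (by rw [hz]; decide) (by decide) (by rw [hz]; decide) (by rw [hz]; decide) (by rw [hz]; decide)
    rw [hz] at key
    have e : triplesTurn (((8, 8) + (Side.S.offset - Side.S.nIn)) :: ((8, 8) + Side.S.offset) ::
        ([((8 : ℤ), (8 : ℤ))] ++ [(8, 6), (9, 6)])) = 6 := by decide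
    rw [e] at key
    push_cast at key
    rcases key with k | k
    · left; linarith
    · right; linarith
  · have key := WP_hopf_of_tables_cell (ω := ω) hh (rootN_side_ne_root w) h (rootN_base w) safeOffsetsNE
      five_le_dsq_innerPt_safeOffsetsNE [((8 : ℤ), (8 : ℤ))] (by simp)
      (by rw [hz]; decide) (by decide) (by rw [hz]; decide) (by rw [hz]; decide) (by rw [hz]; decide)
    rw [hz] at key
    have e : triplesTurn (((8, 8) + (Side.W.offset - Side.W.nIn)) :: ((8, 8) + Side.W.offset) ::
        ([((8 : ℤ), (8 : ℤ))] ++ [(8, 6), (9, 6)])) = 0 := by decide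
    rw [e] at key
    push_cast at key
    rcases key with k | k
    · left; linarith
    · right; linarith

/-- Whole-walk Umlaufsatz, cell NE, pattern `(N, E, S)`. [cite: Hopf1935, Nr. 2 (Umlaufsatz, p. 53) and Nr. 4 eq. (22) (curves with corners, pp. 60–61)] -/
theorem winding_NE_NES (hh : holeFaceW w ∉ D) (hr : RootedFace D (w.side .W) (rootN w)) (h : ω.IsB2a)
    (hz0 : ω.2.firstSideG = .N) (hz1 : ω.z1 hr h = .E) (hz2 : ω.1 = .S) :
    ω.2.winding (fun _ => π / 2) = π / 2 ∨ ω.2.winding (fun _ => π / 2) = -(7 * π / 2) := by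
  have hπ := Real.pi_pos
  have key := winding_hopf_of_tables_cell hh hr h (rootN_base w) safeOffsetsNE five_le_dsq_innerPt_safeOffsetsNE
    [((8 : ℤ), (8 : ℤ))] (by simp)
    (by rw [hz0, hz1, hz2]; decide) (by decide) (by rw [hz0, hz1, hz2]; decide) (by rw [hz0, hz1, hz2]; decide)
    (by rw [hz2]; decide)
  have e : triplesTurn (((8, 8) + ((ω.1).offset - (ω.1).nIn)) :: ((8, 8) + (ω.1).offset) ::
      ([((8 : ℤ), (8 : ℤ))] ++ [(8, 6), (9, 6)])) = 6 := by rw [hz2]; decide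
  rw [e] at key
  push_cast at key
  rcases key with k | k
  · left; linarith
  · right; linarith

/-- Whole-walk Umlaufsatz, cell NE, pattern `(N, E, W)`. [cite: Hopf1935, Nr. 2 (Umlaufsatz, p. 53) and Nr. 4 eq. (22) (curves with corners, pp. 60–61)] -/
theorem winding_NE_NEW (hh : holeFaceW w ∉ D) (hr : RootedFace D (w.side .W) (rootN w)) (h : ω.IsB2a)
    (hz0 : ω.2.firstSideG = .N) (hz1 : ω.z1 hr h = .E) (hz2 : ω.1 = .W) :
    ω.2.winding (fun _ => π / 2) = 2 * π ∨ ω.2.winding (fun _ => π / 2) = -(2 * π) := by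
  have hπ := Real.pi_pos
  have key := winding_hopf_of_tables_cell hh hr h (rootN_base w) safeOffsetsNE five_le_dsq_innerPt_safeOffsetsNE
    [((8 : ℤ), (8 : ℤ))] (by simp)
    (by rw [hz0, hz1, hz2]; decide) (by decide) (by rw [hz0, hz1, hz2]; decide) (by rw [hz0, hz1, hz2]; decide)
    (by rw [hz2]; decide)
  have e : triplesTurn (((8, 8) + ((ω.1).offset - (ω.1).nIn)) :: ((8, 8) + (ω.1).offset) ::
      ([((8 : ℤ), (8 : ℤ))] ++ [(8, 6), (9, 6)])) = 0 := by rw [hz2]; decide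
  rw [e] at key
  push_cast at key
  rcases key with k | k
  · left; linarith
  · right; linarith

/-- Whole-walk Umlaufsatz, cell NE, pattern `(N, S, W)`. [cite: Hopf1935, Nr. 2 (Umlaufsatz, p. 53) and Nr. 4 eq. (22) (curves with corners, pp. 60–61)] -/
theorem winding_NE_NSW (hh : holeFaceW w ∉ D) (hr : RootedFace D (w.side .W) (rootN w)) (h : ω.IsB2a)
    (hz0 : ω.2.firstSideG = .N) (hz1 : ω.z1 hr h = .S) (hz2 : ω.1 = .W) :
    ω.2.winding (fun _ => π / 2) = 2 * π ∨ ω.2.winding (fun _ => π / 2) = -(2 * π) := by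
  have hπ := Real.pi_pos
  have key := winding_hopf_of_tables_cell hh hr h (rootN_base w) safeOffsetsNE five_le_dsq_innerPt_safeOffsetsNE
    [((8 : ℤ), (8 : ℤ))] (by simp)
    (by rw [hz0, hz1, hz2]; decide) (by decide) (by rw [hz0, hz1, hz2]; decide) (by rw [hz0, hz1, hz2]; decide)
    (by rw [hz2]; decide)
  have e : triplesTurn (((8, 8) + ((ω.1).offset - (ω.1).nIn)) :: ((8, 8) + (ω.1).offset) ::
      ([((8 : ℤ), (8 : ℤ))] ++ [(8, 6), (9, 6)])) = 0 := by rw [hz2]; decide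
  rw [e] at key
  push_cast at key
  rcases key with k | k
  · left; linarith
  · right; linarith

/-- Whole-walk Umlaufsatz, cell NE, pattern `(N, W, E)`. [cite: Hopf1935, Nr. 2 (Umlaufsatz, p. 53) and Nr. 4 eq. (22) (curves with corners, pp. 60–61)] -/
theorem winding_NE_NWE (hh : holeFaceW w ∉ D) (hr : RootedFace D (w.side .W) (rootN w)) (h : ω.IsB2a)
    (hz0 : ω.2.firstSideG = .N) (hz1 : ω.z1 hr h = .W) (hz2 : ω.1 = .E) :
    ω.2.winding (fun _ => π / 2) = π ∨ ω.2.winding (fun _ => π / 2) = -(3 * π) := by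
  have hπ := Real.pi_pos
  have key := winding_hopf_of_tables_cell hh hr h (rootN_base w) safeOffsetsNE five_le_dsq_innerPt_safeOffsetsNE
    [((11 : ℤ), (9 : ℤ)), (9, 9), (8, 8)] (by simp)
    (by rw [hz0, hz1, hz2]; decide) (by decide) (by rw [hz0, hz1, hz2]; decide) (by rw [hz0, hz1, hz2]; decide)
    (by rw [hz2]; decide)
  have e : triplesTurn (((8, 8) + ((ω.1).offset - (ω.1).nIn)) :: ((8, 8) + (ω.1).offset) ::
      ([((11 : ℤ), (9 : ℤ)), (9, 9), (8, 8)] ++ [(8, 6), (9, 6)])) = 4 := by rw [hz2]; decide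
  rw [e] at key
  push_cast at key
  rcases key with k | k
  · left; linarith
  · right; linarith

/-- Whole-walk Umlaufsatz, cell NE, pattern `(N, W, S)`. [cite: Hopf1935, Nr. 2 (Umlaufsatz, p. 53) and Nr. 4 eq. (22) (curves with corners, pp. 60–61)] -/
theorem winding_NE_NWS (hh : holeFaceW w ∉ D) (hr : RootedFace D (w.side .W) (rootN w)) (h : ω.IsB2a)
    (hz0 : ω.2.firstSideG = .N) (hz1 : ω.z1 hr h = .W) (hz2 : ω.1 = .S) :
    ω.2.winding (fun _ => π / 2) = π / 2 ∨ ω.2.winding (fun _ => π / 2) = -(7 * π / 2) := by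
  have hπ := Real.pi_pos
  have key := winding_hopf_of_tables_cell hh hr h (rootN_base w) safeOffsetsNE five_le_dsq_innerPt_safeOffsetsNE
    [((8 : ℤ), (8 : ℤ))] (by simp)
    (by rw [hz0, hz1, hz2]; decide) (by decide) (by rw [hz0, hz1, hz2]; decide) (by rw [hz0, hz1, hz2]; decide)
    (by rw [hz2]; decide)
  have e : triplesTurn (((8, 8) + ((ω.1).offset - (ω.1).nIn)) :: ((8, 8) + (ω.1).offset) ::
      ([((8 : ℤ), (8 : ℤ))] ++ [(8, 6), (9, 6)])) = 6 := by rw [hz2]; decide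
  rw [e] at key
  push_cast at key
  rcases key with k | k
  · left; linarith
  · right; linarith

/-- Whole-walk Umlaufsatz, cell NE, pattern `(E, N, S)`. [cite: Hopf1935, Nr. 2 (Umlaufsatz, p. 53) and Nr. 4 eq. (22) (curves with corners, pp. 60–61)] -/
theorem winding_NE_ENS (hh : holeFaceW w ∉ D) (hr : RootedFace D (w.side .W) (rootN w)) (h : ω.IsB2a)
    (hz0 : ω.2.firstSideG = .E) (hz1 : ω.z1 hr h = .N) (hz2 : ω.1 = .S) :
    ω.2.winding (fun _ => π / 2) = π / 2 ∨ ω.2.winding (fun _ => π / 2) = -(7 * π / 2) := by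
  have hπ := Real.pi_pos
  have key := winding_hopf_of_tables_cell hh hr h (rootN_base w) safeOffsetsNE five_le_dsq_innerPt_safeOffsetsNE
    [((8 : ℤ), (8 : ℤ))] (by simp)
    (by rw [hz0, hz1, hz2]; decide) (by decide) (by rw [hz0, hz1, hz2]; decide) (by rw [hz0, hz1, hz2]; decide)
    (by rw [hz2]; decide)
  have e : triplesTurn (((8, 8) + ((ω.1).offset - (ω.1).nIn)) :: ((8, 8) + (ω.1).offset) ::
      ([((8 : ℤ), (8 : ℤ))] ++ [(8, 6), (9, 6)])) = 6 := by rw [hz2]; decide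
  rw [e] at key
  push_cast at key
  rcases key with k | k
  · left; linarith
  · right; linarith

/-- Whole-walk Umlaufsatz, cell NE, pattern `(E, N, W)`. [cite: Hopf1935, Nr. 2 (Umlaufsatz, p. 53) and Nr. 4 eq. (22) (curves with corners, pp. 60–61)] -/
theorem winding_NE_ENW (hh : holeFaceW w ∉ D) (hr : RootedFace D (w.side .W) (rootN w)) (h : ω.IsB2a)
    (hz0 : ω.2.firstSideG = .E) (hz1 : ω.z1 hr h = .N) (hz2 : ω.1 = .W) :
    ω.2.winding (fun _ => π / 2) = 2 * π ∨ ω.2.winding (fun _ => π / 2) = -(2 * π) := by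
  have hπ := Real.pi_pos
  have key := winding_hopf_of_tables_cell hh hr h (rootN_base w) safeOffsetsNE five_le_dsq_innerPt_safeOffsetsNE
    [((8 : ℤ), (8 : ℤ))] (by simp)
    (by rw [hz0, hz1, hz2]; decide) (by decide) (by rw [hz0, hz1, hz2]; decide) (by rw [hz0, hz1, hz2]; decide)
    (by rw [hz2]; decide)
  have e : triplesTurn (((8, 8) + ((ω.1).offset - (ω.1).nIn)) :: ((8, 8) + (ω.1).offset) ::
      ([((8 : ℤ), (8 : ℤ))] ++ [(8, 6), (9, 6)])) = 0 := by rw [hz2]; decide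
  rw [e] at key
  push_cast at key
  rcases key with k | k
  · left; linarith
  · right; linarith

/-- Whole-walk Umlaufsatz, cell NE, pattern `(E, S, N)`. [cite: Hopf1935, Nr. 2 (Umlaufsatz, p. 53) and Nr. 4 eq. (22) (curves with corners, pp. 60–61)] -/
theorem winding_NE_ESN (hh : holeFaceW w ∉ D) (hr : RootedFace D (w.side .W) (rootN w)) (h : ω.IsB2a)
    (hz0 : ω.2.firstSideG = .E) (hz1 : ω.z1 hr h = .S) (hz2 : ω.1 = .N) :
    ω.2.winding (fun _ => π / 2) = 3 * π / 2 ∨ ω.2.winding (fun _ => π / 2) = -(5 * π / 2) := by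
  have hπ := Real.pi_pos
  have key := winding_hopf_of_tables_cell hh hr h (rootN_base w) safeOffsetsNE five_le_dsq_innerPt_safeOffsetsNE
    [((9 : ℤ), (11 : ℤ)), (9, 9), (8, 8)] (by simp)
    (by rw [hz0, hz1, hz2]; decide) (by decide) (by rw [hz0, hz1, hz2]; decide) (by rw [hz0, hz1, hz2]; decide)
    (by rw [hz2]; decide)
  have e : triplesTurn (((8, 8) + ((ω.1).offset - (ω.1).nIn)) :: ((8, 8) + (ω.1).offset) ::
      ([((9 : ℤ), (11 : ℤ)), (9, 9), (8, 8)] ++ [(8, 6), (9, 6)])) = 2 := by rw [hz2]; decide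
  rw [e] at key
  push_cast at key
  rcases key with k | k
  · left; linarith
  · right; linarith

/-- Whole-walk Umlaufsatz, cell NE, pattern `(E, S, W)`. [cite: Hopf1935, Nr. 2 (Umlaufsatz, p. 53) and Nr. 4 eq. (22) (curves with corners, pp. 60–61)] -/
theorem winding_NE_ESW (hh : holeFaceW w ∉ D) (hr : RootedFace D (w.side .W) (rootN w)) (h : ω.IsB2a)
    (hz0 : ω.2.firstSideG = .E) (hz1 : ω.z1 hr h = .S) (hz2 : ω.1 = .W) :
    ω.2.winding (fun _ => π / 2) = 2 * π ∨ ω.2.winding (fun _ => π / 2) = -(2 * π) := by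
  have hπ := Real.pi_pos
  have key := winding_hopf_of_tables_cell hh hr h (rootN_base w) safeOffsetsNE five_le_dsq_innerPt_safeOffsetsNE
    [((8 : ℤ), (8 : ℤ))] (by simp)
    (by rw [hz0, hz1, hz2]; decide) (by decide) (by rw [hz0, hz1, hz2]; decide) (by rw [hz0, hz1, hz2]; decide)
    (by rw [hz2]; decide)
  have e : triplesTurn (((8, 8) + ((ω.1).offset - (ω.1).nIn)) :: ((8, 8) + (ω.1).offset) ::
      ([((8 : ℤ), (8 : ℤ))] ++ [(8, 6), (9, 6)])) = 0 := by rw [hz2]; decide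
  rw [e] at key
  push_cast at key
  rcases key with k | k
  · left; linarith
  · right; linarith

/-- Whole-walk Umlaufsatz, cell NE, pattern `(E, W, S)`. [cite: Hopf1935, Nr. 2 (Umlaufsatz, p. 53) and Nr. 4 eq. (22) (curves with corners, pp. 60–61)] -/
theorem winding_NE_EWS (hh : holeFaceW w ∉ D) (hr : RootedFace D (w.side .W) (rootN w)) (h : ω.IsB2a)
    (hz0 : ω.2.firstSideG = .E) (hz1 : ω.z1 hr h = .W) (hz2 : ω.1 = .S) :
    ω.2.winding (fun _ => π / 2) = π / 2 ∨ ω.2.winding (fun _ => π / 2) = -(7 * π / 2) := by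
  have hπ := Real.pi_pos
  have key := winding_hopf_of_tables_cell hh hr h (rootN_base w) safeOffsetsNE five_le_dsq_innerPt_safeOffsetsNE
    [((8 : ℤ), (8 : ℤ))] (by simp)
    (by rw [hz0, hz1, hz2]; decide) (by decide) (by rw [hz0, hz1, hz2]; decide) (by rw [hz0, hz1, hz2]; decide)
    (by rw [hz2]; decide)
  have e : triplesTurn (((8, 8) + ((ω.1).offset - (ω.1).nIn)) :: ((8, 8) + (ω.1).offset) ::
      ([((8 : ℤ), (8 : ℤ))] ++ [(8, 6), (9, 6)])) = 6 := by rw [hz2]; decide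
  rw [e] at key
  push_cast at key
  rcases key with k | k
  · left; linarith
  · right; linarith

/-- Whole-walk Umlaufsatz, cell NE, pattern `(S, N, W)`. [cite: Hopf1935, Nr. 2 (Umlaufsatz, p. 53) and Nr. 4 eq. (22) (curves with corners, pp. 60–61)] -/
theorem winding_NE_SNW (hh : holeFaceW w ∉ D) (hr : RootedFace D (w.side .W) (rootN w)) (h : ω.IsB2a)
    (hz0 : ω.2.firstSideG = .S) (hz1 : ω.z1 hr h = .N) (hz2 : ω.1 = .W) :
    ω.2.winding (fun _ => π / 2) = 2 * π ∨ ω.2.winding (fun _ => π / 2) = -(2 * π) := by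
  have hπ := Real.pi_pos
  have key := winding_hopf_of_tables_cell hh hr h (rootN_base w) safeOffsetsNE five_le_dsq_innerPt_safeOffsetsNE
    [((8 : ℤ), (8 : ℤ))] (by simp)
    (by rw [hz0, hz1, hz2]; decide) (by decide) (by rw [hz0, hz1, hz2]; decide) (by rw [hz0, hz1, hz2]; decide)
    (by rw [hz2]; decide)
  have e : triplesTurn (((8, 8) + ((ω.1).offset - (ω.1).nIn)) :: ((8, 8) + (ω.1).offset) ::
      ([((8 : ℤ), (8 : ℤ))] ++ [(8, 6), (9, 6)])) = 0 := by rw [hz2]; decide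
  rw [e] at key
  push_cast at key
  rcases key with k | k
  · left; linarith
  · right; linarith

/-- Whole-walk Umlaufsatz, cell NE, pattern `(S, E, N)`. [cite: Hopf1935, Nr. 2 (Umlaufsatz, p. 53) and Nr. 4 eq. (22) (curves with corners, pp. 60–61)] -/
theorem winding_NE_SEN (hh : holeFaceW w ∉ D) (hr : RootedFace D (w.side .W) (rootN w)) (h : ω.IsB2a)
    (hz0 : ω.2.firstSideG = .S) (hz1 : ω.z1 hr h = .E) (hz2 : ω.1 = .N) :
    ω.2.winding (fun _ => π / 2) = 3 * π / 2 ∨ ω.2.winding (fun _ => π / 2) = -(5 * π / 2) := by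
  have hπ := Real.pi_pos
  have key := winding_hopf_of_tables_cell hh hr h (rootN_base w) safeOffsetsNE five_le_dsq_innerPt_safeOffsetsNE
    [((9 : ℤ), (11 : ℤ)), (9, 9), (8, 8)] (by simp)
    (by rw [hz0, hz1, hz2]; decide) (by decide) (by rw [hz0, hz1, hz2]; decide) (by rw [hz0, hz1, hz2]; decide)
    (by rw [hz2]; decide)
  have e : triplesTurn (((8, 8) + ((ω.1).offset - (ω.1).nIn)) :: ((8, 8) + (ω.1).offset) ::
      ([((9 : ℤ), (11 : ℤ)), (9, 9), (8, 8)] ++ [(8, 6), (9, 6)])) = 2 := by rw [hz2]; decide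
  rw [e] at key
  push_cast at key
  rcases key with k | k
  · left; linarith
  · right; linarith

/-- Whole-walk Umlaufsatz, cell NE, pattern `(S, E, W)`. [cite: Hopf1935, Nr. 2 (Umlaufsatz, p. 53) and Nr. 4 eq. (22) (curves with corners, pp. 60–61)] -/
theorem winding_NE_SEW (hh : holeFaceW w ∉ D) (hr : RootedFace D (w.side .W) (rootN w)) (h : ω.IsB2a)
    (hz0 : ω.2.firstSideG = .S) (hz1 : ω.z1 hr h = .E) (hz2 : ω.1 = .W) :
    ω.2.winding (fun _ => π / 2) = 2 * π ∨ ω.2.winding (fun _ => π / 2) = -(2 * π) := by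
  have hπ := Real.pi_pos
  have key := winding_hopf_of_tables_cell hh hr h (rootN_base w) safeOffsetsNE five_le_dsq_innerPt_safeOffsetsNE
    [((8 : ℤ), (8 : ℤ))] (by simp)
    (by rw [hz0, hz1, hz2]; decide) (by decide) (by rw [hz0, hz1, hz2]; decide) (by rw [hz0, hz1, hz2]; decide)
    (by rw [hz2]; decide)
  have e : triplesTurn (((8, 8) + ((ω.1).offset - (ω.1).nIn)) :: ((8, 8) + (ω.1).offset) ::
      ([((8 : ℤ), (8 : ℤ))] ++ [(8, 6), (9, 6)])) = 0 := by rw [hz2]; decide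
  rw [e] at key
  push_cast at key
  rcases key with k | k
  · left; linarith
  · right; linarith

/-- Whole-walk Umlaufsatz, cell NE, pattern `(W, N, E)`. [cite: Hopf1935, Nr. 2 (Umlaufsatz, p. 53) and Nr. 4 eq. (22) (curves with corners, pp. 60–61)] -/
theorem winding_NE_WNE (hh : holeFaceW w ∉ D) (hr : RootedFace D (w.side .W) (rootN w)) (h : ω.IsB2a)
    (hz0 : ω.2.firstSideG = .W) (hz1 : ω.z1 hr h = .N) (hz2 : ω.1 = .E) :
    ω.2.winding (fun _ => π / 2) = π ∨ ω.2.winding (fun _ => π / 2) = -(3 * π) := by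
  have hπ := Real.pi_pos
  have key := winding_hopf_of_tables_cell hh hr h (rootN_base w) safeOffsetsNE five_le_dsq_innerPt_safeOffsetsNE
    [((11 : ℤ), (9 : ℤ)), (9, 9), (8, 8)] (by simp)
    (by rw [hz0, hz1, hz2]; decide) (by decide) (by rw [hz0, hz1, hz2]; decide) (by rw [hz0, hz1, hz2]; decide)
    (by rw [hz2]; decide)
  have e : triplesTurn (((8, 8) + ((ω.1).offset - (ω.1).nIn)) :: ((8, 8) + (ω.1).offset) ::
      ([((11 : ℤ), (9 : ℤ)), (9, 9), (8, 8)] ++ [(8, 6), (9, 6)])) = 4 := by rw [hz2]; decide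
  rw [e] at key
  push_cast at key
  rcases key with k | k
  · left; linarith
  · right; linarith

/-- Whole-walk Umlaufsatz, cell NE, pattern `(W, N, S)`. [cite: Hopf1935, Nr. 2 (Umlaufsatz, p. 53) and Nr. 4 eq. (22) (curves with corners, pp. 60–61)] -/
theorem winding_NE_WNS (hh : holeFaceW w ∉ D) (hr : RootedFace D (w.side .W) (rootN w)) (h : ω.IsB2a)
    (hz0 : ω.2.firstSideG = .W) (hz1 : ω.z1 hr h = .N) (hz2 : ω.1 = .S) :
    ω.2.winding (fun _ => π / 2) = π / 2 ∨ ω.2.winding (fun _ => π / 2) = -(7 * π / 2) := by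
  have hπ := Real.pi_pos
  have key := winding_hopf_of_tables_cell hh hr h (rootN_base w) safeOffsetsNE five_le_dsq_innerPt_safeOffsetsNE
    [((8 : ℤ), (8 : ℤ))] (by simp)
    (by rw [hz0, hz1, hz2]; decide) (by decide) (by rw [hz0, hz1, hz2]; decide) (by rw [hz0, hz1, hz2]; decide)
    (by rw [hz2]; decide)
  have e : triplesTurn (((8, 8) + ((ω.1).offset - (ω.1).nIn)) :: ((8, 8) + (ω.1).offset) ::
      ([((8 : ℤ), (8 : ℤ))] ++ [(8, 6), (9, 6)])) = 6 := by rw [hz2]; decide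
  rw [e] at key
  push_cast at key
  rcases key with k | k
  · left; linarith
  · right; linarith

/-- Whole-walk Umlaufsatz, cell NE, pattern `(W, E, S)`. [cite: Hopf1935, Nr. 2 (Umlaufsatz, p. 53) and Nr. 4 eq. (22) (curves with corners, pp. 60–61)] -/
theorem winding_NE_WES (hh : holeFaceW w ∉ D) (hr : RootedFace D (w.side .W) (rootN w)) (h : ω.IsB2a)
    (hz0 : ω.2.firstSideG = .W) (hz1 : ω.z1 hr h = .E) (hz2 : ω.1 = .S) :
    ω.2.winding (fun _ => π / 2) = π / 2 ∨ ω.2.winding (fun _ => π / 2) = -(7 * π / 2) := by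
  have hπ := Real.pi_pos
  have key := winding_hopf_of_tables_cell hh hr h (rootN_base w) safeOffsetsNE five_le_dsq_innerPt_safeOffsetsNE
    [((8 : ℤ), (8 : ℤ))] (by simp)
    (by rw [hz0, hz1, hz2]; decide) (by decide) (by rw [hz0, hz1, hz2]; decide) (by rw [hz0, hz1, hz2]; decide)
    (by rw [hz2]; decide)
  have e : triplesTurn (((8, 8) + ((ω.1).offset - (ω.1).nIn)) :: ((8, 8) + (ω.1).offset) ::
      ([((8 : ℤ), (8 : ℤ))] ++ [(8, 6), (9, 6)])) = 6 := by rw [hz2]; decide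
  rw [e] at key
  push_cast at key
  rcases key with k | k
  · left; linarith
  · right; linarith

/-- ★ Cell NE, pattern `(N, E, S)`, wound: `WP(π/2) = -(5 * π / 2)`. [cite: GlazmanManolescu2019, Lemma 2.1 (proof: [Gl])] [cite: DuminilCopinSmirnov2012, proof of Lemma 1 (the winding bookkeeping)] -/
theorem WP_NE_NES (hh : holeFaceW w ∉ D) (hr : RootedFace D (w.side .W) (rootN w)) (h : ω.IsB2a)
    (hz0 : ω.2.firstSideG = .N) (hz1 : ω.z1 hr h = .E) (hz2 : ω.1 = .S)
    (hW : ω.WE (fun _ => π / 2) ≠ excursionWinding (π / 2) ω.2.firstSideG (ω.z1 hr h) ω.1) :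
    ω.WP (fun _ => π / 2) = -(5 * π / 2) := by
  have hπ := Real.pi_pos
  have hC := (WP_NE_pi_div_two_mem hh h).1 hz0
  have hP := winding_NE_NES hh hr h hz0 hz1 hz2
  rw [winding_eq_WP_add_cell hr h] at hP
  have hWE := WE_sub_eq_of_wound_cell hr h (π / 2) hW
  rw [hz0, hz1] at hP
  rw [hz0, hz1, hz2] at hWE
  have haT : arcTurn ((fun _ : ℤ => π / 2) (rootN w).1) Side.N Side.E = π - π / 2 := rfl
  have heW : excursionWinding (π / 2) Side.N Side.E Side.S = -2 * π + π / 2 := rfl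
  have hcs : chordSign Side.N Side.E Side.S = 1 := by decide
  rw [haT] at hP
  rw [heW, hcs] at hWE
  push_cast at hWE
  rcases hC with hC | hC <;> rcases hP with hP | hP <;> first | exact hC | (exfalso; linarith)

/-- ★ Cell NE: pattern `(N, E, W)` is impossible (wound or not). [cite: GlazmanManolescu2019, Lemma 2.1 (proof: [Gl])] [cite: DuminilCopinSmirnov2012, proof of Lemma 1 (the winding bookkeeping)] -/
theorem no_NE_NEW (hh : holeFaceW w ∉ D) (hr : RootedFace D (w.side .W) (rootN w)) (h : ω.IsB2a)
    (hz0 : ω.2.firstSideG = .N) (hz1 : ω.z1 hr h = .E) (hz2 : ω.1 = .W) : False := by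
  have hπ := Real.pi_pos
  have hC := (WP_NE_pi_div_two_mem hh h).1 hz0
  have hP := winding_NE_NEW hh hr h hz0 hz1 hz2
  rw [winding_eq_WP_add_cell hr h] at hP
  rw [hz0, hz1] at hP
  have haT : arcTurn ((fun _ : ℤ => π / 2) (rootN w).1) Side.N Side.E = π - π / 2 := rfl
  have heW : excursionWinding (π / 2) Side.N Side.E Side.W = -2 * π := rfl
  have hcs : chordSign Side.N Side.E Side.W = 1 := by decide
  rw [haT] at hP
  rcases ω.sign_law hr h (π / 2) with ⟨hWE, -⟩ | ⟨hWE, -⟩ <;> rw [hz0, hz1, hz2, heW] at hWE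
  · rcases hC with hC | hC <;> rcases hP with hP | hP <;> linarith
  · rw [hcs] at hWE
    push_cast at hWE
    rcases hC with hC | hC <;> rcases hP with hP | hP <;> linarith

/-- ★ Cell NE: pattern `(N, S, W)` is impossible (wound or not). [cite: GlazmanManolescu2019, Lemma 2.1 (proof: [Gl])] [cite: DuminilCopinSmirnov2012, proof of Lemma 1 (the winding bookkeeping)] -/
theorem no_NE_NSW (hh : holeFaceW w ∉ D) (hr : RootedFace D (w.side .W) (rootN w)) (h : ω.IsB2a)
    (hz0 : ω.2.firstSideG = .N) (hz1 : ω.z1 hr h = .S) (hz2 : ω.1 = .W) : False := by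
  have hπ := Real.pi_pos
  have hC := (WP_NE_pi_div_two_mem hh h).1 hz0
  have hP := winding_NE_NSW hh hr h hz0 hz1 hz2
  rw [winding_eq_WP_add_cell hr h] at hP
  rw [hz0, hz1] at hP
  have haT : arcTurn ((fun _ : ℤ => π / 2) (rootN w).1) Side.N Side.S = 0 := rfl
  have heW : excursionWinding (π / 2) Side.N Side.S Side.W = -π - π / 2 := rfl
  have hcs : chordSign Side.N Side.S Side.W = 1 := by decide
  rw [haT] at hP
  rcases ω.sign_law hr h (π / 2) with ⟨hWE, -⟩ | ⟨hWE, -⟩ <;> rw [hz0, hz1, hz2, heW] at hWE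
  · rcases hC with hC | hC <;> rcases hP with hP | hP <;> linarith
  · rw [hcs] at hWE
    push_cast at hWE
    rcases hC with hC | hC <;> rcases hP with hP | hP <;> linarith

/-- ★ Cell NE: pattern `(N, W, E)` is impossible (wound or not). [cite: GlazmanManolescu2019, Lemma 2.1 (proof: [Gl])] [cite: DuminilCopinSmirnov2012, proof of Lemma 1 (the winding bookkeeping)] -/
theorem no_NE_NWE (hh : holeFaceW w ∉ D) (hr : RootedFace D (w.side .W) (rootN w)) (h : ω.IsB2a)
    (hz0 : ω.2.firstSideG = .N) (hz1 : ω.z1 hr h = .W) (hz2 : ω.1 = .E) : False := by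
  have hπ := Real.pi_pos
  have hC := (WP_NE_pi_div_two_mem hh h).1 hz0
  have hP := winding_NE_NWE hh hr h hz0 hz1 hz2
  rw [winding_eq_WP_add_cell hr h] at hP
  rw [hz0, hz1] at hP
  have haT : arcTurn ((fun _ : ℤ => π / 2) (rootN w).1) Side.N Side.W = -(π / 2) := rfl
  have heW : excursionWinding (π / 2) Side.N Side.W Side.E = 2 * π := rfl
  have hcs : chordSign Side.N Side.W Side.E = -1 := by decide
  rw [haT] at hP
  rcases ω.sign_law hr h (π / 2) with ⟨hWE, -⟩ | ⟨hWE, -⟩ <;> rw [hz0, hz1, hz2, heW] at hWE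
  · rcases hC with hC | hC <;> rcases hP with hP | hP <;> linarith
  · rw [hcs] at hWE
    push_cast at hWE
    rcases hC with hC | hC <;> rcases hP with hP | hP <;> linarith

/-- ★ Cell NE: pattern `(N, W, S)` is impossible (wound or not). [cite: GlazmanManolescu2019, Lemma 2.1 (proof: [Gl])] [cite: DuminilCopinSmirnov2012, proof of Lemma 1 (the winding bookkeeping)] -/
theorem no_NE_NWS (hh : holeFaceW w ∉ D) (hr : RootedFace D (w.side .W) (rootN w)) (h : ω.IsB2a)
    (hz0 : ω.2.firstSideG = .N) (hz1 : ω.z1 hr h = .W) (hz2 : ω.1 = .S) : False := by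
  have hπ := Real.pi_pos
  have hC := (WP_NE_pi_div_two_mem hh h).1 hz0
  have hP := winding_NE_NWS hh hr h hz0 hz1 hz2
  rw [winding_eq_WP_add_cell hr h] at hP
  rw [hz0, hz1] at hP
  have haT : arcTurn ((fun _ : ℤ => π / 2) (rootN w).1) Side.N Side.W = -(π / 2) := rfl
  have heW : excursionWinding (π / 2) Side.N Side.W Side.S = π + π / 2 := rfl
  have hcs : chordSign Side.N Side.W Side.S = -1 := by decide
  rw [haT] at hP
  rcases ω.sign_law hr h (π / 2) with ⟨hWE, -⟩ | ⟨hWE, -⟩ <;> rw [hz0, hz1, hz2, heW] at hWE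
  · rcases hC with hC | hC <;> rcases hP with hP | hP <;> linarith
  · rw [hcs] at hWE
    push_cast at hWE
    rcases hC with hC | hC <;> rcases hP with hP | hP <;> linarith

/-- ★ Cell NE: pattern `(E, N, S)` is impossible (wound or not). [cite: GlazmanManolescu2019, Lemma 2.1 (proof: [Gl])] [cite: DuminilCopinSmirnov2012, proof of Lemma 1 (the winding bookkeeping)] -/
theorem no_NE_ENS (hh : holeFaceW w ∉ D) (hr : RootedFace D (w.side .W) (rootN w)) (h : ω.IsB2a)
    (hz0 : ω.2.firstSideG = .E) (hz1 : ω.z1 hr h = .N) (hz2 : ω.1 = .S) : False := by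
  have hπ := Real.pi_pos
  have hC := (WP_NE_pi_div_two_mem hh h).2.1 hz0
  have hP := winding_NE_ENS hh hr h hz0 hz1 hz2
  rw [winding_eq_WP_add_cell hr h] at hP
  rw [hz0, hz1] at hP
  have haT : arcTurn ((fun _ : ℤ => π / 2) (rootN w).1) Side.E Side.N = π / 2 - π := rfl
  have heW : excursionWinding (π / 2) Side.E Side.N Side.S = 2 * π := rfl
  have hcs : chordSign Side.E Side.N Side.S = -1 := by decide
  rw [haT] at hP
  rcases ω.sign_law hr h (π / 2) with ⟨hWE, -⟩ | ⟨hWE, -⟩ <;> rw [hz0, hz1, hz2, heW] at hWE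
  · rcases hC with hC | hC <;> rcases hP with hP | hP <;> linarith
  · rw [hcs] at hWE
    push_cast at hWE
    rcases hC with hC | hC <;> rcases hP with hP | hP <;> linarith

/-- ★ Cell NE, pattern `(E, N, W)`, wound: `WP(π/2) = π`. [cite: GlazmanManolescu2019, Lemma 2.1 (proof: [Gl])] [cite: DuminilCopinSmirnov2012, proof of Lemma 1 (the winding bookkeeping)] -/
theorem WP_NE_ENW (hh : holeFaceW w ∉ D) (hr : RootedFace D (w.side .W) (rootN w)) (h : ω.IsB2a)
    (hz0 : ω.2.firstSideG = .E) (hz1 : ω.z1 hr h = .N) (hz2 : ω.1 = .W)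
    (hW : ω.WE (fun _ => π / 2) ≠ excursionWinding (π / 2) ω.2.firstSideG (ω.z1 hr h) ω.1) :
    ω.WP (fun _ => π / 2) = π := by
  have hπ := Real.pi_pos
  have hC := (WP_NE_pi_div_two_mem hh h).2.1 hz0
  have hP := winding_NE_ENW hh hr h hz0 hz1 hz2
  rw [winding_eq_WP_add_cell hr h] at hP
  have hWE := WE_sub_eq_of_wound_cell hr h (π / 2) hW
  rw [hz0, hz1] at hP
  rw [hz0, hz1, hz2] at hWE
  have haT : arcTurn ((fun _ : ℤ => π / 2) (rootN w).1) Side.E Side.N = π / 2 - π := rfl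
  have heW : excursionWinding (π / 2) Side.E Side.N Side.W = 2 * π - π / 2 := rfl
  have hcs : chordSign Side.E Side.N Side.W = -1 := by decide
  rw [haT] at hP
  rw [heW, hcs] at hWE
  push_cast at hWE
  rcases hC with hC | hC <;> rcases hP with hP | hP <;> first | exact hC | (exfalso; linarith)

/-- ★ Cell NE: pattern `(E, S, N)` is impossible (wound or not). [cite: GlazmanManolescu2019, Lemma 2.1 (proof: [Gl])] [cite: DuminilCopinSmirnov2012, proof of Lemma 1 (the winding bookkeeping)] -/
theorem no_NE_ESN (hh : holeFaceW w ∉ D) (hr : RootedFace D (w.side .W) (rootN w)) (h : ω.IsB2a)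
    (hz0 : ω.2.firstSideG = .E) (hz1 : ω.z1 hr h = .S) (hz2 : ω.1 = .N) : False := by
  have hπ := Real.pi_pos
  have hC := (WP_NE_pi_div_two_mem hh h).2.1 hz0
  have hP := winding_NE_ESN hh hr h hz0 hz1 hz2
  rw [winding_eq_WP_add_cell hr h] at hP
  rw [hz0, hz1] at hP
  have haT : arcTurn ((fun _ : ℤ => π / 2) (rootN w).1) Side.E Side.S = π / 2 := rfl
  have heW : excursionWinding (π / 2) Side.E Side.S Side.N = -2 * π := rfl
  have hcs : chordSign Side.E Side.S Side.N = 1 := by decide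
  rw [haT] at hP
  rcases ω.sign_law hr h (π / 2) with ⟨hWE, -⟩ | ⟨hWE, -⟩ <;> rw [hz0, hz1, hz2, heW] at hWE
  · rcases hC with hC | hC <;> rcases hP with hP | hP <;> linarith
  · rw [hcs] at hWE
    push_cast at hWE
    rcases hC with hC | hC <;> rcases hP with hP | hP <;> linarith

/-- ★ Cell NE: pattern `(E, S, W)` is impossible (wound or not). [cite: GlazmanManolescu2019, Lemma 2.1 (proof: [Gl])] [cite: DuminilCopinSmirnov2012, proof of Lemma 1 (the winding bookkeeping)] -/
theorem no_NE_ESW (hh : holeFaceW w ∉ D) (hr : RootedFace D (w.side .W) (rootN w)) (h : ω.IsB2a)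
    (hz0 : ω.2.firstSideG = .E) (hz1 : ω.z1 hr h = .S) (hz2 : ω.1 = .W) : False := by
  have hπ := Real.pi_pos
  have hC := (WP_NE_pi_div_two_mem hh h).2.1 hz0
  have hP := winding_NE_ESW hh hr h hz0 hz1 hz2
  rw [winding_eq_WP_add_cell hr h] at hP
  rw [hz0, hz1] at hP
  have haT : arcTurn ((fun _ : ℤ => π / 2) (rootN w).1) Side.E Side.S = π / 2 := rfl
  have heW : excursionWinding (π / 2) Side.E Side.S Side.W = -π - π / 2 := rfl
  have hcs : chordSign Side.E Side.S Side.W = 1 := by decide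
  rw [haT] at hP
  rcases ω.sign_law hr h (π / 2) with ⟨hWE, -⟩ | ⟨hWE, -⟩ <;> rw [hz0, hz1, hz2, heW] at hWE
  · rcases hC with hC | hC <;> rcases hP with hP | hP <;> linarith
  · rw [hcs] at hWE
    push_cast at hWE
    rcases hC with hC | hC <;> rcases hP with hP | hP <;> linarith

/-- ★ Cell NE: pattern `(E, W, S)` is impossible (wound or not). [cite: GlazmanManolescu2019, Lemma 2.1 (proof: [Gl])] [cite: DuminilCopinSmirnov2012, proof of Lemma 1 (the winding bookkeeping)] -/
theorem no_NE_EWS (hh : holeFaceW w ∉ D) (hr : RootedFace D (w.side .W) (rootN w)) (h : ω.IsB2a)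
    (hz0 : ω.2.firstSideG = .E) (hz1 : ω.z1 hr h = .W) (hz2 : ω.1 = .S) : False := by
  have hπ := Real.pi_pos
  have hC := (WP_NE_pi_div_two_mem hh h).2.1 hz0
  have hP := winding_NE_EWS hh hr h hz0 hz1 hz2
  rw [winding_eq_WP_add_cell hr h] at hP
  rw [hz0, hz1] at hP
  have haT : arcTurn ((fun _ : ℤ => π / 2) (rootN w).1) Side.E Side.W = 0 := rfl
  have heW : excursionWinding (π / 2) Side.E Side.W Side.S = π + π / 2 := rfl
  have hcs : chordSign Side.E Side.W Side.S = -1 := by decide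
  rw [haT] at hP
  rcases ω.sign_law hr h (π / 2) with ⟨hWE, -⟩ | ⟨hWE, -⟩ <;> rw [hz0, hz1, hz2, heW] at hWE
  · rcases hC with hC | hC <;> rcases hP with hP | hP <;> linarith
  · rw [hcs] at hWE
    push_cast at hWE
    rcases hC with hC | hC <;> rcases hP with hP | hP <;> linarith

/-- ★ Cell NE, pattern `(S, N, W)`, wound: `WP(π/2) = π / 2`. [cite: GlazmanManolescu2019, Lemma 2.1 (proof: [Gl])] [cite: DuminilCopinSmirnov2012, proof of Lemma 1 (the winding bookkeeping)] -/
theorem WP_NE_SNW (hh : holeFaceW w ∉ D) (hr : RootedFace D (w.side .W) (rootN w)) (h : ω.IsB2a)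
    (hz0 : ω.2.firstSideG = .S) (hz1 : ω.z1 hr h = .N) (hz2 : ω.1 = .W)
    (hW : ω.WE (fun _ => π / 2) ≠ excursionWinding (π / 2) ω.2.firstSideG (ω.z1 hr h) ω.1) :
    ω.WP (fun _ => π / 2) = π / 2 := by
  have hπ := Real.pi_pos
  have hC := (WP_NE_pi_div_two_mem hh h).2.2.1 hz0
  have hP := winding_NE_SNW hh hr h hz0 hz1 hz2
  rw [winding_eq_WP_add_cell hr h] at hP
  have hWE := WE_sub_eq_of_wound_cell hr h (π / 2) hW
  rw [hz0, hz1] at hP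
  rw [hz0, hz1, hz2] at hWE
  have haT : arcTurn ((fun _ : ℤ => π / 2) (rootN w).1) Side.S Side.N = 0 := rfl
  have heW : excursionWinding (π / 2) Side.S Side.N Side.W = 2 * π - π / 2 := rfl
  have hcs : chordSign Side.S Side.N Side.W = -1 := by decide
  rw [haT] at hP
  rw [heW, hcs] at hWE
  push_cast at hWE
  rcases hC with hC | hC <;> rcases hP with hP | hP <;> first | exact hC | (exfalso; linarith)

/-- ★ Cell NE, pattern `(S, E, N)`, wound: `WP(π/2) = π / 2`. [cite: GlazmanManolescu2019, Lemma 2.1 (proof: [Gl])] [cite: DuminilCopinSmirnov2012, proof of Lemma 1 (the winding bookkeeping)] -/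
theorem WP_NE_SEN (hh : holeFaceW w ∉ D) (hr : RootedFace D (w.side .W) (rootN w)) (h : ω.IsB2a)
    (hz0 : ω.2.firstSideG = .S) (hz1 : ω.z1 hr h = .E) (hz2 : ω.1 = .N)
    (hW : ω.WE (fun _ => π / 2) ≠ excursionWinding (π / 2) ω.2.firstSideG (ω.z1 hr h) ω.1) :
    ω.WP (fun _ => π / 2) = π / 2 := by
  have hπ := Real.pi_pos
  have hC := (WP_NE_pi_div_two_mem hh h).2.2.1 hz0
  have hP := winding_NE_SEN hh hr h hz0 hz1 hz2
  rw [winding_eq_WP_add_cell hr h] at hP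
  have hWE := WE_sub_eq_of_wound_cell hr h (π / 2) hW
  rw [hz0, hz1] at hP
  rw [hz0, hz1, hz2] at hWE
  have haT : arcTurn ((fun _ : ℤ => π / 2) (rootN w).1) Side.S Side.E = -(π / 2) := rfl
  have heW : excursionWinding (π / 2) Side.S Side.E Side.N = π + π / 2 := rfl
  have hcs : chordSign Side.S Side.E Side.N = -1 := by decide
  rw [haT] at hP
  rw [heW, hcs] at hWE
  push_cast at hWE
  rcases hC with hC | hC <;> rcases hP with hP | hP <;> first | exact hC | (exfalso; linarith)

/-- ★ Cell NE, pattern `(S, E, W)`, wound: `WP(π/2) = π / 2`. [cite: GlazmanManolescu2019, Lemma 2.1 (proof: [Gl])] [cite: DuminilCopinSmirnov2012, proof of Lemma 1 (the winding bookkeeping)] -/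
theorem WP_NE_SEW (hh : holeFaceW w ∉ D) (hr : RootedFace D (w.side .W) (rootN w)) (h : ω.IsB2a)
    (hz0 : ω.2.firstSideG = .S) (hz1 : ω.z1 hr h = .E) (hz2 : ω.1 = .W)
    (hW : ω.WE (fun _ => π / 2) ≠ excursionWinding (π / 2) ω.2.firstSideG (ω.z1 hr h) ω.1) :
    ω.WP (fun _ => π / 2) = π / 2 := by
  have hπ := Real.pi_pos
  have hC := (WP_NE_pi_div_two_mem hh h).2.2.1 hz0
  have hP := winding_NE_SEW hh hr h hz0 hz1 hz2
  rw [winding_eq_WP_add_cell hr h] at hP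
  have hWE := WE_sub_eq_of_wound_cell hr h (π / 2) hW
  rw [hz0, hz1] at hP
  rw [hz0, hz1, hz2] at hWE
  have haT : arcTurn ((fun _ : ℤ => π / 2) (rootN w).1) Side.S Side.E = -(π / 2) := rfl
  have heW : excursionWinding (π / 2) Side.S Side.E Side.W = 2 * π := rfl
  have hcs : chordSign Side.S Side.E Side.W = -1 := by decide
  rw [haT] at hP
  rw [heW, hcs] at hWE
  push_cast at hWE
  rcases hC with hC | hC <;> rcases hP with hP | hP <;> first | exact hC | (exfalso; linarith)

/-- ★ Cell NE, pattern `(W, N, E)`, wound: `WP(π/2) = -(2 * π)`. [cite: GlazmanManolescu2019, Lemma 2.1 (proof: [Gl])] [cite: DuminilCopinSmirnov2012, proof of Lemma 1 (the winding bookkeeping)] -/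
theorem WP_NE_WNE (hh : holeFaceW w ∉ D) (hr : RootedFace D (w.side .W) (rootN w)) (h : ω.IsB2a)
    (hz0 : ω.2.firstSideG = .W) (hz1 : ω.z1 hr h = .N) (hz2 : ω.1 = .E)
    (hW : ω.WE (fun _ => π / 2) ≠ excursionWinding (π / 2) ω.2.firstSideG (ω.z1 hr h) ω.1) :
    ω.WP (fun _ => π / 2) = -(2 * π) := by
  have hπ := Real.pi_pos
  have hC := (WP_NE_pi_div_two_mem hh h).2.2.2 hz0
  have hP := winding_NE_WNE hh hr h hz0 hz1 hz2
  rw [winding_eq_WP_add_cell hr h] at hP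
  have hWE := WE_sub_eq_of_wound_cell hr h (π / 2) hW
  rw [hz0, hz1] at hP
  rw [hz0, hz1, hz2] at hWE
  have haT : arcTurn ((fun _ : ℤ => π / 2) (rootN w).1) Side.W Side.N = π / 2 := rfl
  have heW : excursionWinding (π / 2) Side.W Side.N Side.E = -π - π / 2 := rfl
  have hcs : chordSign Side.W Side.N Side.E = 1 := by decide
  rw [haT] at hP
  rw [heW, hcs] at hWE
  push_cast at hWE
  rcases hC with hC | hC <;> rcases hP with hP | hP <;> first | exact hC | (exfalso; linarith)

/-- ★ Cell NE, pattern `(W, N, S)`, wound: `WP(π/2) = -(2 * π)`. [cite: GlazmanManolescu2019, Lemma 2.1 (proof: [Gl])] [cite: DuminilCopinSmirnov2012, proof of Lemma 1 (the winding bookkeeping)] -/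
theorem WP_NE_WNS (hh : holeFaceW w ∉ D) (hr : RootedFace D (w.side .W) (rootN w)) (h : ω.IsB2a)
    (hz0 : ω.2.firstSideG = .W) (hz1 : ω.z1 hr h = .N) (hz2 : ω.1 = .S)
    (hW : ω.WE (fun _ => π / 2) ≠ excursionWinding (π / 2) ω.2.firstSideG (ω.z1 hr h) ω.1) :
    ω.WP (fun _ => π / 2) = -(2 * π) := by
  have hπ := Real.pi_pos
  have hC := (WP_NE_pi_div_two_mem hh h).2.2.2 hz0
  have hP := winding_NE_WNS hh hr h hz0 hz1 hz2
  rw [winding_eq_WP_add_cell hr h] at hP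
  have hWE := WE_sub_eq_of_wound_cell hr h (π / 2) hW
  rw [hz0, hz1] at hP
  rw [hz0, hz1, hz2] at hWE
  have haT : arcTurn ((fun _ : ℤ => π / 2) (rootN w).1) Side.W Side.N = π / 2 := rfl
  have heW : excursionWinding (π / 2) Side.W Side.N Side.S = -2 * π := rfl
  have hcs : chordSign Side.W Side.N Side.S = 1 := by decide
  rw [haT] at hP
  rw [heW, hcs] at hWE
  push_cast at hWE
  rcases hC with hC | hC <;> rcases hP with hP | hP <;> first | exact hC | (exfalso; linarith)

/-- ★ Cell NE, pattern `(W, E, S)`, wound: `WP(π/2) = -(2 * π)`. [cite: GlazmanManolescu2019, Lemma 2.1 (proof: [Gl])] [cite: DuminilCopinSmirnov2012, proof of Lemma 1 (the winding bookkeeping)] -/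
theorem WP_NE_WES (hh : holeFaceW w ∉ D) (hr : RootedFace D (w.side .W) (rootN w)) (h : ω.IsB2a)
    (hz0 : ω.2.firstSideG = .W) (hz1 : ω.z1 hr h = .E) (hz2 : ω.1 = .S)
    (hW : ω.WE (fun _ => π / 2) ≠ excursionWinding (π / 2) ω.2.firstSideG (ω.z1 hr h) ω.1) :
    ω.WP (fun _ => π / 2) = -(2 * π) := by
  have hπ := Real.pi_pos
  have hC := (WP_NE_pi_div_two_mem hh h).2.2.2 hz0
  have hP := winding_NE_WES hh hr h hz0 hz1 hz2
  rw [winding_eq_WP_add_cell hr h] at hP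
  have hWE := WE_sub_eq_of_wound_cell hr h (π / 2) hW
  rw [hz0, hz1] at hP
  rw [hz0, hz1, hz2] at hWE
  have haT : arcTurn ((fun _ : ℤ => π / 2) (rootN w).1) Side.W Side.E = 0 := rfl
  have heW : excursionWinding (π / 2) Side.W Side.E Side.S = -2 * π + π / 2 := rfl
  have hcs : chordSign Side.W Side.E Side.S = 1 := by decide
  rw [haT] at hP
  rw [heW, hcs] at hWE
  push_cast at hWE
  rcases hC with hC | hC <;> rcases hP with hP | hP <;> first | exact hC | (exfalso; linarith)

/-- **The forced prefix turning at cell NE**, by first side (at `θ = π/2`). [cite: GlazmanManolescu2019, Lemma 2.1 (proof: [Gl])] -/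
def ringTurnNE : Side → ℝ
  | .N => -(5 * π / 2)
  | .E => π
  | .S => π / 2
  | .W => -(2 * π)

/-- The directly treated patterns at cell NE (one orientation per pinned class, both orientations of the impossible
classes). [folklore] -/
def ringPatternsNE : List (Side × Side × Side) :=
  [(.N, .E, .S), (.N, .E, .W), (.N, .S, .W), (.N, .W, .E), (.N, .W, .S), (.E, .N, .S), (.E, .N, .W), (.E, .S, .N), (.E, .S, .W), (.E, .W, .S), (.S, .N, .W), (.S, .E, .N), (.S, .E, .W), (.W, .N, .E), (.W, .N, .S), (.W, .E, .S)]

/-- Every pattern of three distinct sides is treated directly or through its reversal. [folklore] -/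
private theorem ringPatternsNE_cover : ∀ a b c : Side, a ≠ b → a ≠ c → b ≠ c →
    (a, b, c) ∈ ringPatternsNE ∨ (a, c, b) ∈ ringPatternsNE := by decide

/-- ★★ The directly treated patterns at cell NE: wound ⇒ `WP(π/2) = ringTurnNE z₀`. [cite: Hopf1935, Nr. 2 (Umlaufsatz, p. 53) and Nr. 4 eq. (22) (curves with corners, pp. 60–61)] [cite: GlazmanManolescu2019, Lemma 2.1 (proof: [Gl])] -/
theorem WP_NE_eq_of_mem (hh : holeFaceW w ∉ D) (hr : RootedFace D (w.side .W) (rootN w)) (h : ω.IsB2a)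
    (hmem : (ω.2.firstSideG, ω.z1 hr h, ω.1) ∈ ringPatternsNE)
    (hW : ω.WE (fun _ => π / 2) ≠ excursionWinding (π / 2) ω.2.firstSideG (ω.z1 hr h) ω.1) :
    ω.WP (fun _ => π / 2) = ringTurnNE ω.2.firstSideG := by
  simp only [ringPatternsNE, List.mem_cons, Prod.mk.injEq, List.mem_nil_iff, or_false] at hmem
  rcases hmem with ⟨h0, h1, h2⟩ | ⟨h0, h1, h2⟩ | ⟨h0, h1, h2⟩ | ⟨h0, h1, h2⟩ | ⟨h0, h1, h2⟩ | ⟨h0, h1, h2⟩ | ⟨h0, h1, h2⟩ | ⟨h0, h1, h2⟩ | ⟨h0, h1, h2⟩ | ⟨h0, h1, h2⟩ | ⟨h0, h1, h2⟩ | ⟨h0, h1, h2⟩ | ⟨h0, h1, h2⟩ | ⟨h0, h1, h2⟩ | ⟨h0, h1, h2⟩ | ⟨h0, h1, h2⟩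
  · rw [WP_NE_NES hh hr h h0 h1 h2 hW, h0]; rfl
  · exact (no_NE_NEW hh hr h h0 h1 h2).elim
  · exact (no_NE_NSW hh hr h h0 h1 h2).elim
  · exact (no_NE_NWE hh hr h h0 h1 h2).elim
  · exact (no_NE_NWS hh hr h h0 h1 h2).elim
  · exact (no_NE_ENS hh hr h h0 h1 h2).elim
  · rw [WP_NE_ENW hh hr h h0 h1 h2 hW, h0]; rfl
  · exact (no_NE_ESN hh hr h h0 h1 h2).elim
  · exact (no_NE_ESW hh hr h h0 h1 h2).elim
  · exact (no_NE_EWS hh hr h h0 h1 h2).elim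
  · rw [WP_NE_SNW hh hr h h0 h1 h2 hW, h0]; rfl
  · rw [WP_NE_SEN hh hr h h0 h1 h2 hW, h0]; rfl
  · rw [WP_NE_SEW hh hr h h0 h1 h2 hW, h0]; rfl
  · rw [WP_NE_WNE hh hr h h0 h1 h2 hW, h0]; rfl
  · rw [WP_NE_WNS hh hr h h0 h1 h2 hW, h0]; rfl
  · rw [WP_NE_WES hh hr h h0 h1 h2 hW, h0]; rfl

/-- ★★★ **THE TURNING RIGIDITY AT CELL NE (θ = π/2)**: for every WOUND class-`B2a` walk of the hole root `w.side W` at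
the cell NORTH of the root plaquette (`NE` of the hole), the right-angle turning of the prefix is `ringTurnNE z₀` — fixed by the first side alone.
[cite: Hopf1935, Nr. 2 (Umlaufsatz, p. 53) and Nr. 4 eq. (22) (curves with corners, pp. 60–61)] [cite: GlazmanManolescu2019, Lemma 2.1 (proof: [Gl])] [cite: DuminilCopinSmirnov2012, proof of Lemma 1 (the winding bookkeeping)] -/
theorem WP_NE_pi_div_two_eq_of_wound (hh : holeFaceW w ∉ D) (hr : RootedFace D (w.side .W) (rootN w))
    (h : ω.IsB2a) (hW : ω.WE (fun _ => π / 2) ≠ excursionWinding (π / 2) ω.2.firstSideG (ω.z1 hr h) ω.1) :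
    ω.WP (fun _ => π / 2) = ringTurnNE ω.2.firstSideG := by
  obtain ⟨hz01, hz02, hz12⟩ := ω.firstSide_exit_return_distinct hr h
  rcases ringPatternsNE_cover _ _ _ hz01 hz02 hz12 with hd | hd
  · exact WP_NE_eq_of_mem hh hr h hd hW
  · have h'' := ω.rev_isB2a hr h
    have e1 : (ω.rev hr).z1 hr h'' = ω.1 := by unfold ΩG.z1; exact ω.rev_exitSide hr h
    have e2 : (ω.rev hr).1 = ω.z1 hr h := ω.rev_fst hr h
    have e0 : (ω.rev hr).2.firstSideG = ω.2.firstSideG := ω.rev_firstSide hr h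
    have hWr : (ω.rev hr).WE (fun _ => π / 2) ≠
        excursionWinding (π / 2) (ω.rev hr).2.firstSideG ((ω.rev hr).z1 hr h'') (ω.rev hr).1 := by
      rw [ω.rev_WE (fun _ => π / 2) hr h, e0, e1, e2, excursionWinding_swap]
      intro e; apply hW; linarith
    have key := WP_NE_eq_of_mem (ω := ω.rev hr) hh hr h'' (by rw [e0, e1, e2]; exact hd) hWr
    rwa [ω.rev_WP (fun _ => π / 2) hr h, e0] at key

/-- ★★ **ENTRY–EXIT EXCLUSION AT CELL NE** (wound or not): a walk that entered from `E` never uses the side `S`; a walk that entered from `N` never uses the side `W`. [cite: Hopf1935, Nr. 2 (Umlaufsatz, p. 53) and Nr. 4 eq. (22) (curves with corners, pp. 60–61)] [cite: GlazmanManolescu2019, Lemma 2.1 (proof: [Gl])] -/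
theorem NE_entry_exit_exclusion (hh : holeFaceW w ∉ D) (hr : RootedFace D (w.side .W) (rootN w)) (h : ω.IsB2a) :
    (ω.2.firstSideG = .E → ω.z1 hr h ≠ .S ∧ ω.1 ≠ .S) ∧
      (ω.2.firstSideG = .N → ω.z1 hr h ≠ .W ∧ ω.1 ≠ .W) := by
  obtain ⟨hz01, hz02, hz12⟩ := ω.firstSide_exit_return_distinct hr h
  constructor
  · intro hz0
    constructor
    · intro hz1
      rcases hω : ω.1 with _ | _ | _ | _
      · exact no_NE_ESW hh hr h hz0 hz1 hω
      · rw [hz0, hω] at hz02; exact hz02 rfl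
      · rw [hz1, hω] at hz12; exact hz12 rfl
      · exact no_NE_ESN hh hr h hz0 hz1 hω
    · intro hz2
      rcases hω : ω.z1 hr h with _ | _ | _ | _
      · exact no_NE_EWS hh hr h hz0 hω hz2
      · rw [hz0, hω] at hz01; exact hz01 rfl
      · rw [hz2, hω] at hz12; exact hz12 rfl
      · exact no_NE_ENS hh hr h hz0 hω hz2
  · intro hz0
    constructor
    · intro hz1
      rcases hω : ω.1 with _ | _ | _ | _
      · rw [hz1, hω] at hz12; exact hz12 rfl
      · exact no_NE_NWE hh hr h hz0 hz1 hω
      · exact no_NE_NWS hh hr h hz0 hz1 hω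
      · rw [hz0, hω] at hz02; exact hz02 rfl
    · intro hz2
      rcases hω : ω.z1 hr h with _ | _ | _ | _
      · rw [hz2, hω] at hz12; exact hz12 rfl
      · exact no_NE_NEW hh hr h hz0 hω hz2
      · exact no_NE_NSW hh hr h hz0 hω hz2
      · rw [hz0, hω] at hz01; exact hz01 rfl

/-- ★★★ **THE TURNING RIGIDITY AT CELL NE, every angle**: for every WOUND class-`B2a` walk at the cell NORTH of the root plaquette (`NE` of the hole)
(hole `holeFaceW w ∉ D`): `N` ⇒ `θ - 3 * π`, `E` ⇒ `π`, `S` ⇒ `θ`, `W` ⇒ `-(2 * π)`. [cite: Hopf1935, Nr. 2 (Umlaufsatz, p. 53) and Nr. 4 eq. (22) (curves with corners, pp. 60–61)] [cite: GlazmanManolescu2019, Lemma 2.1 (proof: [Gl])] [cite: DuminilCopinSmirnov2012, proof of Lemma 1 (the winding bookkeeping)] -/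
theorem WP_NE_eq_of_wound (hh : holeFaceW w ∉ D) (hr : RootedFace D (w.side .W) (rootN w)) (h : ω.IsB2a)
    (θ : ℝ) (hW : ω.WE (fun _ => θ) ≠ excursionWinding θ ω.2.firstSideG (ω.z1 hr h) ω.1) :
    (ω.2.firstSideG = .N → ω.WP (fun _ => θ) = θ - 3 * π) ∧
      (ω.2.firstSideG = .E → ω.WP (fun _ => θ) = π) ∧
      (ω.2.firstSideG = .S → ω.WP (fun _ => θ) = θ) ∧
      (ω.2.firstSideG = .W → ω.WP (fun _ => θ) = -(2 * π)) := by
  have hW' : ω.WE (fun _ => π / 2) ≠ excursionWinding (π / 2) ω.2.firstSideG (ω.z1 hr h) ω.1 := by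
    intro e; apply hW
    have := WE_sub_excursionWinding_const_cell (ω := ω) hr h θ
    linarith
  have key := WP_NE_pi_div_two_eq_of_wound hh hr h hW'
  have htr := WP_cell_of_pinned (ω := ω) h θ key
  refine ⟨fun hz => ?_, fun hz => ?_, fun hz => ?_, fun hz => ?_⟩ <;> rw [htr, hz] <;>
    simp only [ringTurnNE, Side.slantInd] <;> ring

end CellNE

end ΩG

/-! ## § Ring cell NW: the cell `NW` of the hole (north of the far cell) — instances, pinning, assembly -/

namespace ΩG

variable {D : Set Face} {w : Face} {ω : ΩG D (w.side .W) (farNW w)}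

section CellNW

/-- ★★ **The prefix turns by one of two values** at the cell `NW` of the hole (north of the far cell): `N`: `{3 * π / 2, -(5 * π / 2)}`; `E`: `{π, -(3 * π)}`; `S`: `{5 * π / 2, -(3 * π / 2)}`; `W`: `{2 * π, -(2 * π)}`. [cite: Hopf1935, Nr. 2 (Umlaufsatz, p. 53) and Nr. 4 eq. (22) (curves with corners, pp. 60–61)] [cite: GlazmanManolescu2019, Lemma 2.1 (proof: [Gl])] -/
theorem WP_NW_pi_div_two_mem (hh : holeFaceW w ∉ D) (h : ω.IsB2a) :
    (ω.2.firstSideG = .N → ω.WP (fun _ => π / 2) = 3 * π / 2 ∨ ω.WP (fun _ => π / 2) = -(5 * π / 2)) ∧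
      (ω.2.firstSideG = .E → ω.WP (fun _ => π / 2) = π ∨ ω.WP (fun _ => π / 2) = -(3 * π)) ∧
      (ω.2.firstSideG = .S → ω.WP (fun _ => π / 2) = 5 * π / 2 ∨ ω.WP (fun _ => π / 2) = -(3 * π / 2)) ∧
      (ω.2.firstSideG = .W → ω.WP (fun _ => π / 2) = 2 * π ∨ ω.WP (fun _ => π / 2) = -(2 * π)) := by
  have hπ := Real.pi_pos
  refine ⟨fun hz => ?_, fun hz => ?_, fun hz => ?_, fun hz => ?_⟩
  · have key := WP_hopf_of_tables_cell (ω := ω) hh (farNW_side_ne_root w) h (farNW_base w) safeOffsetsNW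
      five_le_dsq_innerPt_safeOffsetsNW [((3 : ℤ), (11 : ℤ)), (3, 9), (4, 8), (5, 7), (6, 6)] (by simp)
      (by rw [hz]; decide) (by decide) (by rw [hz]; decide) (by rw [hz]; decide) (by rw [hz]; decide)
    rw [hz] at key
    have e : triplesTurn (((0, 8) + (Side.N.offset - Side.N.nIn)) :: ((0, 8) + Side.N.offset) ::
        ([((3 : ℤ), (11 : ℤ)), (3, 9), (4, 8), (5, 7), (6, 6)] ++ [(8, 6), (9, 6)])) = 2 := by decide
    rw [e] at key
    push_cast at key
    rcases key with k | k
    · left; linarith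
    · right; linarith
  · have key := WP_hopf_of_tables_cell (ω := ω) hh (farNW_side_ne_root w) h (farNW_base w) safeOffsetsNW
      five_le_dsq_innerPt_safeOffsetsNW [((3 : ℤ), (9 : ℤ)), (4, 8), (5, 7), (6, 6)] (by simp)
      (by rw [hz]; decide) (by decide) (by rw [hz]; decide) (by rw [hz]; decide) (by rw [hz]; decide)
    rw [hz] at key
    have e : triplesTurn (((0, 8) + (Side.E.offset - Side.E.nIn)) :: ((0, 8) + Side.E.offset) ::
        ([((3 : ℤ), (9 : ℤ)), (4, 8), (5, 7), (6, 6)] ++ [(8, 6), (9, 6)])) = 4 := by decide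
    rw [e] at key
    push_cast at key
    rcases key with k | k
    · left; linarith
    · right; linarith
  · have key := WP_hopf_of_tables_cell (ω := ω) hh (farNW_side_ne_root w) h (farNW_base w) safeOffsetsNW
      five_le_dsq_innerPt_safeOffsetsNW [((3 : ℤ), (9 : ℤ)), (4, 8), (5, 7), (6, 6)] (by simp)
      (by rw [hz]; decide) (by decide) (by rw [hz]; decide) (by rw [hz]; decide) (by rw [hz]; decide)
    rw [hz] at key
    have e : triplesTurn (((0, 8) + (Side.S.offset - Side.S.nIn)) :: ((0, 8) + Side.S.offset) ::
        ([((3 : ℤ), (9 : ℤ)), (4, 8), (5, 7), (6, 6)] ++ [(8, 6), (9, 6)])) = -2 := by decide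
    rw [e] at key
    push_cast at key
    rcases key with k | k
    · left; linarith
    · right; linarith
  · have key := WP_hopf_of_tables_cell (ω := ω) hh (farNW_side_ne_root w) h (farNW_base w) safeOffsetsNW
      five_le_dsq_innerPt_safeOffsetsNW [((1 : ℤ), (9 : ℤ)), (3, 9), (4, 8), (5, 7), (6, 6)] (by simp)
      (by rw [hz]; decide) (by decide) (by rw [hz]; decide) (by rw [hz]; decide) (by rw [hz]; decide)
    rw [hz] at key
    have e : triplesTurn (((0, 8) + (Side.W.offset - Side.W.nIn)) :: ((0, 8) + Side.W.offset) ::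
        ([((1 : ℤ), (9 : ℤ)), (3, 9), (4, 8), (5, 7), (6, 6)] ++ [(8, 6), (9, 6)])) = 0 := by decide
    rw [e] at key
    push_cast at key
    rcases key with k | k
    · left; linarith
    · right; linarith

/-- Whole-walk Umlaufsatz, cell NW, pattern `(N, E, S)`. [cite: Hopf1935, Nr. 2 (Umlaufsatz, p. 53) and Nr. 4 eq. (22) (curves with corners, pp. 60–61)] -/
theorem winding_NW_NES (hh : holeFaceW w ∉ D) (hr : RootedFace D (w.side .W) (farNW w)) (h : ω.IsB2a)
    (hz0 : ω.2.firstSideG = .N) (hz1 : ω.z1 hr h = .E) (hz2 : ω.1 = .S) :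
    ω.2.winding (fun _ => π / 2) = 5 * π / 2 ∨ ω.2.winding (fun _ => π / 2) = -(3 * π / 2) := by
  have hπ := Real.pi_pos
  have key := winding_hopf_of_tables_cell hh hr h (farNW_base w) safeOffsetsNW five_le_dsq_innerPt_safeOffsetsNW
    [((3 : ℤ), (9 : ℤ)), (4, 8), (5, 7), (6, 6)] (by simp)
    (by rw [hz0, hz1, hz2]; decide) (by decide) (by rw [hz0, hz1, hz2]; decide) (by rw [hz0, hz1, hz2]; decide)
    (by rw [hz2]; decide)
  have e : triplesTurn (((0, 8) + ((ω.1).offset - (ω.1).nIn)) :: ((0, 8) + (ω.1).offset) ::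
      ([((3 : ℤ), (9 : ℤ)), (4, 8), (5, 7), (6, 6)] ++ [(8, 6), (9, 6)])) = -2 := by rw [hz2]; decide
  rw [e] at key
  push_cast at key
  rcases key with k | k
  · left; linarith
  · right; linarith

/-- Whole-walk Umlaufsatz, cell NW, pattern `(N, E, W)`. [cite: Hopf1935, Nr. 2 (Umlaufsatz, p. 53) and Nr. 4 eq. (22) (curves with corners, pp. 60–61)] -/
theorem winding_NW_NEW (hh : holeFaceW w ∉ D) (hr : RootedFace D (w.side .W) (farNW w)) (h : ω.IsB2a)
    (hz0 : ω.2.firstSideG = .N) (hz1 : ω.z1 hr h = .E) (hz2 : ω.1 = .W) :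
    ω.2.winding (fun _ => π / 2) = 2 * π ∨ ω.2.winding (fun _ => π / 2) = -(2 * π) := by
  have hπ := Real.pi_pos
  have key := winding_hopf_of_tables_cell hh hr h (farNW_base w) safeOffsetsNW five_le_dsq_innerPt_safeOffsetsNW
    [((1 : ℤ), (9 : ℤ)), (3, 9), (4, 8), (5, 7), (6, 6)] (by simp)
    (by rw [hz0, hz1, hz2]; decide) (by decide) (by rw [hz0, hz1, hz2]; decide) (by rw [hz0, hz1, hz2]; decide)
    (by rw [hz2]; decide)
  have e : triplesTurn (((0, 8) + ((ω.1).offset - (ω.1).nIn)) :: ((0, 8) + (ω.1).offset) ::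
      ([((1 : ℤ), (9 : ℤ)), (3, 9), (4, 8), (5, 7), (6, 6)] ++ [(8, 6), (9, 6)])) = 0 := by rw [hz2]; decide
  rw [e] at key
  push_cast at key
  rcases key with k | k
  · left; linarith
  · right; linarith

/-- Whole-walk Umlaufsatz, cell NW, pattern `(N, S, E)`. [cite: Hopf1935, Nr. 2 (Umlaufsatz, p. 53) and Nr. 4 eq. (22) (curves with corners, pp. 60–61)] -/
theorem winding_NW_NSE (hh : holeFaceW w ∉ D) (hr : RootedFace D (w.side .W) (farNW w)) (h : ω.IsB2a)
    (hz0 : ω.2.firstSideG = .N) (hz1 : ω.z1 hr h = .S) (hz2 : ω.1 = .E) :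
    ω.2.winding (fun _ => π / 2) = π ∨ ω.2.winding (fun _ => π / 2) = -(3 * π) := by
  have hπ := Real.pi_pos
  have key := winding_hopf_of_tables_cell hh hr h (farNW_base w) safeOffsetsNW five_le_dsq_innerPt_safeOffsetsNW
    [((3 : ℤ), (9 : ℤ)), (4, 8), (5, 7), (6, 6)] (by simp)
    (by rw [hz0, hz1, hz2]; decide) (by decide) (by rw [hz0, hz1, hz2]; decide) (by rw [hz0, hz1, hz2]; decide)
    (by rw [hz2]; decide)
  have e : triplesTurn (((0, 8) + ((ω.1).offset - (ω.1).nIn)) :: ((0, 8) + (ω.1).offset) ::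
      ([((3 : ℤ), (9 : ℤ)), (4, 8), (5, 7), (6, 6)] ++ [(8, 6), (9, 6)])) = 4 := by rw [hz2]; decide
  rw [e] at key
  push_cast at key
  rcases key with k | k
  · left; linarith
  · right; linarith

/-- Whole-walk Umlaufsatz, cell NW, pattern `(N, W, E)`. [cite: Hopf1935, Nr. 2 (Umlaufsatz, p. 53) and Nr. 4 eq. (22) (curves with corners, pp. 60–61)] -/
theorem winding_NW_NWE (hh : holeFaceW w ∉ D) (hr : RootedFace D (w.side .W) (farNW w)) (h : ω.IsB2a)
    (hz0 : ω.2.firstSideG = .N) (hz1 : ω.z1 hr h = .W) (hz2 : ω.1 = .E) :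
    ω.2.winding (fun _ => π / 2) = π ∨ ω.2.winding (fun _ => π / 2) = -(3 * π) := by
  have hπ := Real.pi_pos
  have key := winding_hopf_of_tables_cell hh hr h (farNW_base w) safeOffsetsNW five_le_dsq_innerPt_safeOffsetsNW
    [((3 : ℤ), (9 : ℤ)), (4, 8), (5, 7), (6, 6)] (by simp)
    (by rw [hz0, hz1, hz2]; decide) (by decide) (by rw [hz0, hz1, hz2]; decide) (by rw [hz0, hz1, hz2]; decide)
    (by rw [hz2]; decide)
  have e : triplesTurn (((0, 8) + ((ω.1).offset - (ω.1).nIn)) :: ((0, 8) + (ω.1).offset) ::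
      ([((3 : ℤ), (9 : ℤ)), (4, 8), (5, 7), (6, 6)] ++ [(8, 6), (9, 6)])) = 4 := by rw [hz2]; decide
  rw [e] at key
  push_cast at key
  rcases key with k | k
  · left; linarith
  · right; linarith

/-- Whole-walk Umlaufsatz, cell NW, pattern `(N, W, S)`. [cite: Hopf1935, Nr. 2 (Umlaufsatz, p. 53) and Nr. 4 eq. (22) (curves with corners, pp. 60–61)] -/
theorem winding_NW_NWS (hh : holeFaceW w ∉ D) (hr : RootedFace D (w.side .W) (farNW w)) (h : ω.IsB2a)
    (hz0 : ω.2.firstSideG = .N) (hz1 : ω.z1 hr h = .W) (hz2 : ω.1 = .S) :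
    ω.2.winding (fun _ => π / 2) = 5 * π / 2 ∨ ω.2.winding (fun _ => π / 2) = -(3 * π / 2) := by
  have hπ := Real.pi_pos
  have key := winding_hopf_of_tables_cell hh hr h (farNW_base w) safeOffsetsNW five_le_dsq_innerPt_safeOffsetsNW
    [((3 : ℤ), (9 : ℤ)), (4, 8), (5, 7), (6, 6)] (by simp)
    (by rw [hz0, hz1, hz2]; decide) (by decide) (by rw [hz0, hz1, hz2]; decide) (by rw [hz0, hz1, hz2]; decide)
    (by rw [hz2]; decide)
  have e : triplesTurn (((0, 8) + ((ω.1).offset - (ω.1).nIn)) :: ((0, 8) + (ω.1).offset) ::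
      ([((3 : ℤ), (9 : ℤ)), (4, 8), (5, 7), (6, 6)] ++ [(8, 6), (9, 6)])) = -2 := by rw [hz2]; decide
  rw [e] at key
  push_cast at key
  rcases key with k | k
  · left; linarith
  · right; linarith

/-- Whole-walk Umlaufsatz, cell NW, pattern `(E, N, S)`. [cite: Hopf1935, Nr. 2 (Umlaufsatz, p. 53) and Nr. 4 eq. (22) (curves with corners, pp. 60–61)] -/
theorem winding_NW_ENS (hh : holeFaceW w ∉ D) (hr : RootedFace D (w.side .W) (farNW w)) (h : ω.IsB2a)
    (hz0 : ω.2.firstSideG = .E) (hz1 : ω.z1 hr h = .N) (hz2 : ω.1 = .S) :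
    ω.2.winding (fun _ => π / 2) = 5 * π / 2 ∨ ω.2.winding (fun _ => π / 2) = -(3 * π / 2) := by
  have hπ := Real.pi_pos
  have key := winding_hopf_of_tables_cell hh hr h (farNW_base w) safeOffsetsNW five_le_dsq_innerPt_safeOffsetsNW
    [((3 : ℤ), (9 : ℤ)), (4, 8), (5, 7), (6, 6)] (by simp)
    (by rw [hz0, hz1, hz2]; decide) (by decide) (by rw [hz0, hz1, hz2]; decide) (by rw [hz0, hz1, hz2]; decide)
    (by rw [hz2]; decide)
  have e : triplesTurn (((0, 8) + ((ω.1).offset - (ω.1).nIn)) :: ((0, 8) + (ω.1).offset) ::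
      ([((3 : ℤ), (9 : ℤ)), (4, 8), (5, 7), (6, 6)] ++ [(8, 6), (9, 6)])) = -2 := by rw [hz2]; decide
  rw [e] at key
  push_cast at key
  rcases key with k | k
  · left; linarith
  · right; linarith

/-- Whole-walk Umlaufsatz, cell NW, pattern `(E, N, W)`. [cite: Hopf1935, Nr. 2 (Umlaufsatz, p. 53) and Nr. 4 eq. (22) (curves with corners, pp. 60–61)] -/
theorem winding_NW_ENW (hh : holeFaceW w ∉ D) (hr : RootedFace D (w.side .W) (farNW w)) (h : ω.IsB2a)
    (hz0 : ω.2.firstSideG = .E) (hz1 : ω.z1 hr h = .N) (hz2 : ω.1 = .W) :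
    ω.2.winding (fun _ => π / 2) = 2 * π ∨ ω.2.winding (fun _ => π / 2) = -(2 * π) := by
  have hπ := Real.pi_pos
  have key := winding_hopf_of_tables_cell hh hr h (farNW_base w) safeOffsetsNW five_le_dsq_innerPt_safeOffsetsNW
    [((1 : ℤ), (9 : ℤ)), (3, 9), (4, 8), (5, 7), (6, 6)] (by simp)
    (by rw [hz0, hz1, hz2]; decide) (by decide) (by rw [hz0, hz1, hz2]; decide) (by rw [hz0, hz1, hz2]; decide)
    (by rw [hz2]; decide)
  have e : triplesTurn (((0, 8) + ((ω.1).offset - (ω.1).nIn)) :: ((0, 8) + (ω.1).offset) ::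
      ([((1 : ℤ), (9 : ℤ)), (3, 9), (4, 8), (5, 7), (6, 6)] ++ [(8, 6), (9, 6)])) = 0 := by rw [hz2]; decide
  rw [e] at key
  push_cast at key
  rcases key with k | k
  · left; linarith
  · right; linarith

/-- Whole-walk Umlaufsatz, cell NW, pattern `(E, W, S)`. [cite: Hopf1935, Nr. 2 (Umlaufsatz, p. 53) and Nr. 4 eq. (22) (curves with corners, pp. 60–61)] -/
theorem winding_NW_EWS (hh : holeFaceW w ∉ D) (hr : RootedFace D (w.side .W) (farNW w)) (h : ω.IsB2a)
    (hz0 : ω.2.firstSideG = .E) (hz1 : ω.z1 hr h = .W) (hz2 : ω.1 = .S) :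
    ω.2.winding (fun _ => π / 2) = 5 * π / 2 ∨ ω.2.winding (fun _ => π / 2) = -(3 * π / 2) := by
  have hπ := Real.pi_pos
  have key := winding_hopf_of_tables_cell hh hr h (farNW_base w) safeOffsetsNW five_le_dsq_innerPt_safeOffsetsNW
    [((3 : ℤ), (9 : ℤ)), (4, 8), (5, 7), (6, 6)] (by simp)
    (by rw [hz0, hz1, hz2]; decide) (by decide) (by rw [hz0, hz1, hz2]; decide) (by rw [hz0, hz1, hz2]; decide)
    (by rw [hz2]; decide)
  have e : triplesTurn (((0, 8) + ((ω.1).offset - (ω.1).nIn)) :: ((0, 8) + (ω.1).offset) ::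
      ([((3 : ℤ), (9 : ℤ)), (4, 8), (5, 7), (6, 6)] ++ [(8, 6), (9, 6)])) = -2 := by rw [hz2]; decide
  rw [e] at key
  push_cast at key
  rcases key with k | k
  · left; linarith
  · right; linarith

/-- Whole-walk Umlaufsatz, cell NW, pattern `(S, N, E)`. [cite: Hopf1935, Nr. 2 (Umlaufsatz, p. 53) and Nr. 4 eq. (22) (curves with corners, pp. 60–61)] -/
theorem winding_NW_SNE (hh : holeFaceW w ∉ D) (hr : RootedFace D (w.side .W) (farNW w)) (h : ω.IsB2a)
    (hz0 : ω.2.firstSideG = .S) (hz1 : ω.z1 hr h = .N) (hz2 : ω.1 = .E) :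
    ω.2.winding (fun _ => π / 2) = π ∨ ω.2.winding (fun _ => π / 2) = -(3 * π) := by
  have hπ := Real.pi_pos
  have key := winding_hopf_of_tables_cell hh hr h (farNW_base w) safeOffsetsNW five_le_dsq_innerPt_safeOffsetsNW
    [((3 : ℤ), (9 : ℤ)), (4, 8), (5, 7), (6, 6)] (by simp)
    (by rw [hz0, hz1, hz2]; decide) (by decide) (by rw [hz0, hz1, hz2]; decide) (by rw [hz0, hz1, hz2]; decide)
    (by rw [hz2]; decide)
  have e : triplesTurn (((0, 8) + ((ω.1).offset - (ω.1).nIn)) :: ((0, 8) + (ω.1).offset) ::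
      ([((3 : ℤ), (9 : ℤ)), (4, 8), (5, 7), (6, 6)] ++ [(8, 6), (9, 6)])) = 4 := by rw [hz2]; decide
  rw [e] at key
  push_cast at key
  rcases key with k | k
  · left; linarith
  · right; linarith

/-- Whole-walk Umlaufsatz, cell NW, pattern `(S, W, N)`. [cite: Hopf1935, Nr. 2 (Umlaufsatz, p. 53) and Nr. 4 eq. (22) (curves with corners, pp. 60–61)] -/
theorem winding_NW_SWN (hh : holeFaceW w ∉ D) (hr : RootedFace D (w.side .W) (farNW w)) (h : ω.IsB2a)
    (hz0 : ω.2.firstSideG = .S) (hz1 : ω.z1 hr h = .W) (hz2 : ω.1 = .N) :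
    ω.2.winding (fun _ => π / 2) = 3 * π / 2 ∨ ω.2.winding (fun _ => π / 2) = -(5 * π / 2) := by
  have hπ := Real.pi_pos
  have key := winding_hopf_of_tables_cell hh hr h (farNW_base w) safeOffsetsNW five_le_dsq_innerPt_safeOffsetsNW
    [((3 : ℤ), (11 : ℤ)), (3, 9), (4, 8), (5, 7), (6, 6)] (by simp)
    (by rw [hz0, hz1, hz2]; decide) (by decide) (by rw [hz0, hz1, hz2]; decide) (by rw [hz0, hz1, hz2]; decide)
    (by rw [hz2]; decide)
  have e : triplesTurn (((0, 8) + ((ω.1).offset - (ω.1).nIn)) :: ((0, 8) + (ω.1).offset) ::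
      ([((3 : ℤ), (11 : ℤ)), (3, 9), (4, 8), (5, 7), (6, 6)] ++ [(8, 6), (9, 6)])) = 2 := by rw [hz2]; decide
  rw [e] at key
  push_cast at key
  rcases key with k | k
  · left; linarith
  · right; linarith

/-- Whole-walk Umlaufsatz, cell NW, pattern `(S, W, E)`. [cite: Hopf1935, Nr. 2 (Umlaufsatz, p. 53) and Nr. 4 eq. (22) (curves with corners, pp. 60–61)] -/
theorem winding_NW_SWE (hh : holeFaceW w ∉ D) (hr : RootedFace D (w.side .W) (farNW w)) (h : ω.IsB2a)
    (hz0 : ω.2.firstSideG = .S) (hz1 : ω.z1 hr h = .W) (hz2 : ω.1 = .E) :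
    ω.2.winding (fun _ => π / 2) = π ∨ ω.2.winding (fun _ => π / 2) = -(3 * π) := by
  have hπ := Real.pi_pos
  have key := winding_hopf_of_tables_cell hh hr h (farNW_base w) safeOffsetsNW five_le_dsq_innerPt_safeOffsetsNW
    [((3 : ℤ), (9 : ℤ)), (4, 8), (5, 7), (6, 6)] (by simp)
    (by rw [hz0, hz1, hz2]; decide) (by decide) (by rw [hz0, hz1, hz2]; decide) (by rw [hz0, hz1, hz2]; decide)
    (by rw [hz2]; decide)
  have e : triplesTurn (((0, 8) + ((ω.1).offset - (ω.1).nIn)) :: ((0, 8) + (ω.1).offset) ::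
      ([((3 : ℤ), (9 : ℤ)), (4, 8), (5, 7), (6, 6)] ++ [(8, 6), (9, 6)])) = 4 := by rw [hz2]; decide
  rw [e] at key
  push_cast at key
  rcases key with k | k
  · left; linarith
  · right; linarith

/-- Whole-walk Umlaufsatz, cell NW, pattern `(W, N, E)`. [cite: Hopf1935, Nr. 2 (Umlaufsatz, p. 53) and Nr. 4 eq. (22) (curves with corners, pp. 60–61)] -/
theorem winding_NW_WNE (hh : holeFaceW w ∉ D) (hr : RootedFace D (w.side .W) (farNW w)) (h : ω.IsB2a)
    (hz0 : ω.2.firstSideG = .W) (hz1 : ω.z1 hr h = .N) (hz2 : ω.1 = .E) :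
    ω.2.winding (fun _ => π / 2) = π ∨ ω.2.winding (fun _ => π / 2) = -(3 * π) := by
  have hπ := Real.pi_pos
  have key := winding_hopf_of_tables_cell hh hr h (farNW_base w) safeOffsetsNW five_le_dsq_innerPt_safeOffsetsNW
    [((3 : ℤ), (9 : ℤ)), (4, 8), (5, 7), (6, 6)] (by simp)
    (by rw [hz0, hz1, hz2]; decide) (by decide) (by rw [hz0, hz1, hz2]; decide) (by rw [hz0, hz1, hz2]; decide)
    (by rw [hz2]; decide)
  have e : triplesTurn (((0, 8) + ((ω.1).offset - (ω.1).nIn)) :: ((0, 8) + (ω.1).offset) ::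
      ([((3 : ℤ), (9 : ℤ)), (4, 8), (5, 7), (6, 6)] ++ [(8, 6), (9, 6)])) = 4 := by rw [hz2]; decide
  rw [e] at key
  push_cast at key
  rcases key with k | k
  · left; linarith
  · right; linarith

/-- Whole-walk Umlaufsatz, cell NW, pattern `(W, N, S)`. [cite: Hopf1935, Nr. 2 (Umlaufsatz, p. 53) and Nr. 4 eq. (22) (curves with corners, pp. 60–61)] -/
theorem winding_NW_WNS (hh : holeFaceW w ∉ D) (hr : RootedFace D (w.side .W) (farNW w)) (h : ω.IsB2a)
    (hz0 : ω.2.firstSideG = .W) (hz1 : ω.z1 hr h = .N) (hz2 : ω.1 = .S) :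
    ω.2.winding (fun _ => π / 2) = 5 * π / 2 ∨ ω.2.winding (fun _ => π / 2) = -(3 * π / 2) := by
  have hπ := Real.pi_pos
  have key := winding_hopf_of_tables_cell hh hr h (farNW_base w) safeOffsetsNW five_le_dsq_innerPt_safeOffsetsNW
    [((3 : ℤ), (9 : ℤ)), (4, 8), (5, 7), (6, 6)] (by simp)
    (by rw [hz0, hz1, hz2]; decide) (by decide) (by rw [hz0, hz1, hz2]; decide) (by rw [hz0, hz1, hz2]; decide)
    (by rw [hz2]; decide)
  have e : triplesTurn (((0, 8) + ((ω.1).offset - (ω.1).nIn)) :: ((0, 8) + (ω.1).offset) ::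
      ([((3 : ℤ), (9 : ℤ)), (4, 8), (5, 7), (6, 6)] ++ [(8, 6), (9, 6)])) = -2 := by rw [hz2]; decide
  rw [e] at key
  push_cast at key
  rcases key with k | k
  · left; linarith
  · right; linarith

/-- Whole-walk Umlaufsatz, cell NW, pattern `(W, E, S)`. [cite: Hopf1935, Nr. 2 (Umlaufsatz, p. 53) and Nr. 4 eq. (22) (curves with corners, pp. 60–61)] -/
theorem winding_NW_WES (hh : holeFaceW w ∉ D) (hr : RootedFace D (w.side .W) (farNW w)) (h : ω.IsB2a)
    (hz0 : ω.2.firstSideG = .W) (hz1 : ω.z1 hr h = .E) (hz2 : ω.1 = .S) :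
    ω.2.winding (fun _ => π / 2) = 5 * π / 2 ∨ ω.2.winding (fun _ => π / 2) = -(3 * π / 2) := by
  have hπ := Real.pi_pos
  have key := winding_hopf_of_tables_cell hh hr h (farNW_base w) safeOffsetsNW five_le_dsq_innerPt_safeOffsetsNW
    [((3 : ℤ), (9 : ℤ)), (4, 8), (5, 7), (6, 6)] (by simp)
    (by rw [hz0, hz1, hz2]; decide) (by decide) (by rw [hz0, hz1, hz2]; decide) (by rw [hz0, hz1, hz2]; decide)
    (by rw [hz2]; decide)
  have e : triplesTurn (((0, 8) + ((ω.1).offset - (ω.1).nIn)) :: ((0, 8) + (ω.1).offset) ::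
      ([((3 : ℤ), (9 : ℤ)), (4, 8), (5, 7), (6, 6)] ++ [(8, 6), (9, 6)])) = -2 := by rw [hz2]; decide
  rw [e] at key
  push_cast at key
  rcases key with k | k
  · left; linarith
  · right; linarith

/-- Whole-walk Umlaufsatz, cell NW, pattern `(W, S, N)`. [cite: Hopf1935, Nr. 2 (Umlaufsatz, p. 53) and Nr. 4 eq. (22) (curves with corners, pp. 60–61)] -/
theorem winding_NW_WSN (hh : holeFaceW w ∉ D) (hr : RootedFace D (w.side .W) (farNW w)) (h : ω.IsB2a)
    (hz0 : ω.2.firstSideG = .W) (hz1 : ω.z1 hr h = .S) (hz2 : ω.1 = .N) :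
    ω.2.winding (fun _ => π / 2) = 3 * π / 2 ∨ ω.2.winding (fun _ => π / 2) = -(5 * π / 2) := by
  have hπ := Real.pi_pos
  have key := winding_hopf_of_tables_cell hh hr h (farNW_base w) safeOffsetsNW five_le_dsq_innerPt_safeOffsetsNW
    [((3 : ℤ), (11 : ℤ)), (3, 9), (4, 8), (5, 7), (6, 6)] (by simp)
    (by rw [hz0, hz1, hz2]; decide) (by decide) (by rw [hz0, hz1, hz2]; decide) (by rw [hz0, hz1, hz2]; decide)
    (by rw [hz2]; decide)
  have e : triplesTurn (((0, 8) + ((ω.1).offset - (ω.1).nIn)) :: ((0, 8) + (ω.1).offset) ::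
      ([((3 : ℤ), (11 : ℤ)), (3, 9), (4, 8), (5, 7), (6, 6)] ++ [(8, 6), (9, 6)])) = 2 := by rw [hz2]; decide
  rw [e] at key
  push_cast at key
  rcases key with k | k
  · left; linarith
  · right; linarith

/-- Whole-walk Umlaufsatz, cell NW, pattern `(W, S, E)`. [cite: Hopf1935, Nr. 2 (Umlaufsatz, p. 53) and Nr. 4 eq. (22) (curves with corners, pp. 60–61)] -/
theorem winding_NW_WSE (hh : holeFaceW w ∉ D) (hr : RootedFace D (w.side .W) (farNW w)) (h : ω.IsB2a)
    (hz0 : ω.2.firstSideG = .W) (hz1 : ω.z1 hr h = .S) (hz2 : ω.1 = .E) :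
    ω.2.winding (fun _ => π / 2) = π ∨ ω.2.winding (fun _ => π / 2) = -(3 * π) := by
  have hπ := Real.pi_pos
  have key := winding_hopf_of_tables_cell hh hr h (farNW_base w) safeOffsetsNW five_le_dsq_innerPt_safeOffsetsNW
    [((3 : ℤ), (9 : ℤ)), (4, 8), (5, 7), (6, 6)] (by simp)
    (by rw [hz0, hz1, hz2]; decide) (by decide) (by rw [hz0, hz1, hz2]; decide) (by rw [hz0, hz1, hz2]; decide)
    (by rw [hz2]; decide)
  have e : triplesTurn (((0, 8) + ((ω.1).offset - (ω.1).nIn)) :: ((0, 8) + (ω.1).offset) ::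
      ([((3 : ℤ), (9 : ℤ)), (4, 8), (5, 7), (6, 6)] ++ [(8, 6), (9, 6)])) = 4 := by rw [hz2]; decide
  rw [e] at key
  push_cast at key
  rcases key with k | k
  · left; linarith
  · right; linarith

/-- ★ Cell NW: pattern `(N, E, S)` is impossible (wound or not). [cite: GlazmanManolescu2019, Lemma 2.1 (proof: [Gl])] [cite: DuminilCopinSmirnov2012, proof of Lemma 1 (the winding bookkeeping)] -/
theorem no_NW_NES (hh : holeFaceW w ∉ D) (hr : RootedFace D (w.side .W) (farNW w)) (h : ω.IsB2a)
    (hz0 : ω.2.firstSideG = .N) (hz1 : ω.z1 hr h = .E) (hz2 : ω.1 = .S) : False := by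
  have hπ := Real.pi_pos
  have hC := (WP_NW_pi_div_two_mem hh h).1 hz0
  have hP := winding_NW_NES hh hr h hz0 hz1 hz2
  rw [winding_eq_WP_add_cell hr h] at hP
  rw [hz0, hz1] at hP
  have haT : arcTurn ((fun _ : ℤ => π / 2) (farNW w).1) Side.N Side.E = π - π / 2 := rfl
  have heW : excursionWinding (π / 2) Side.N Side.E Side.S = -2 * π + π / 2 := rfl
  have hcs : chordSign Side.N Side.E Side.S = 1 := by decide
  rw [haT] at hP
  rcases ω.sign_law hr h (π / 2) with ⟨hWE, -⟩ | ⟨hWE, -⟩ <;> rw [hz0, hz1, hz2, heW] at hWE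
  · rcases hC with hC | hC <;> rcases hP with hP | hP <;> linarith
  · rw [hcs] at hWE
    push_cast at hWE
    rcases hC with hC | hC <;> rcases hP with hP | hP <;> linarith

/-- ★ Cell NW: pattern `(N, E, W)` is impossible (wound or not). [cite: GlazmanManolescu2019, Lemma 2.1 (proof: [Gl])] [cite: DuminilCopinSmirnov2012, proof of Lemma 1 (the winding bookkeeping)] -/
theorem no_NW_NEW (hh : holeFaceW w ∉ D) (hr : RootedFace D (w.side .W) (farNW w)) (h : ω.IsB2a)
    (hz0 : ω.2.firstSideG = .N) (hz1 : ω.z1 hr h = .E) (hz2 : ω.1 = .W) : False := by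
  have hπ := Real.pi_pos
  have hC := (WP_NW_pi_div_two_mem hh h).1 hz0
  have hP := winding_NW_NEW hh hr h hz0 hz1 hz2
  rw [winding_eq_WP_add_cell hr h] at hP
  rw [hz0, hz1] at hP
  have haT : arcTurn ((fun _ : ℤ => π / 2) (farNW w).1) Side.N Side.E = π - π / 2 := rfl
  have heW : excursionWinding (π / 2) Side.N Side.E Side.W = -2 * π := rfl
  have hcs : chordSign Side.N Side.E Side.W = 1 := by decide
  rw [haT] at hP
  rcases ω.sign_law hr h (π / 2) with ⟨hWE, -⟩ | ⟨hWE, -⟩ <;> rw [hz0, hz1, hz2, heW] at hWE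
  · rcases hC with hC | hC <;> rcases hP with hP | hP <;> linarith
  · rw [hcs] at hWE
    push_cast at hWE
    rcases hC with hC | hC <;> rcases hP with hP | hP <;> linarith

/-- ★ Cell NW: pattern `(N, S, E)` is impossible (wound or not). [cite: GlazmanManolescu2019, Lemma 2.1 (proof: [Gl])] [cite: DuminilCopinSmirnov2012, proof of Lemma 1 (the winding bookkeeping)] -/
theorem no_NW_NSE (hh : holeFaceW w ∉ D) (hr : RootedFace D (w.side .W) (farNW w)) (h : ω.IsB2a)
    (hz0 : ω.2.firstSideG = .N) (hz1 : ω.z1 hr h = .S) (hz2 : ω.1 = .E) : False := by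
  have hπ := Real.pi_pos
  have hC := (WP_NW_pi_div_two_mem hh h).1 hz0
  have hP := winding_NW_NSE hh hr h hz0 hz1 hz2
  rw [winding_eq_WP_add_cell hr h] at hP
  rw [hz0, hz1] at hP
  have haT : arcTurn ((fun _ : ℤ => π / 2) (farNW w).1) Side.N Side.S = 0 := rfl
  have heW : excursionWinding (π / 2) Side.N Side.S Side.E = 2 * π - π / 2 := rfl
  have hcs : chordSign Side.N Side.S Side.E = -1 := by decide
  rw [haT] at hP
  rcases ω.sign_law hr h (π / 2) with ⟨hWE, -⟩ | ⟨hWE, -⟩ <;> rw [hz0, hz1, hz2, heW] at hWE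
  · rcases hC with hC | hC <;> rcases hP with hP | hP <;> linarith
  · rw [hcs] at hWE
    push_cast at hWE
    rcases hC with hC | hC <;> rcases hP with hP | hP <;> linarith

/-- ★ Cell NW: pattern `(N, W, E)` is impossible (wound or not). [cite: GlazmanManolescu2019, Lemma 2.1 (proof: [Gl])] [cite: DuminilCopinSmirnov2012, proof of Lemma 1 (the winding bookkeeping)] -/
theorem no_NW_NWE (hh : holeFaceW w ∉ D) (hr : RootedFace D (w.side .W) (farNW w)) (h : ω.IsB2a)
    (hz0 : ω.2.firstSideG = .N) (hz1 : ω.z1 hr h = .W) (hz2 : ω.1 = .E) : False := by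
  have hπ := Real.pi_pos
  have hC := (WP_NW_pi_div_two_mem hh h).1 hz0
  have hP := winding_NW_NWE hh hr h hz0 hz1 hz2
  rw [winding_eq_WP_add_cell hr h] at hP
  rw [hz0, hz1] at hP
  have haT : arcTurn ((fun _ : ℤ => π / 2) (farNW w).1) Side.N Side.W = -(π / 2) := rfl
  have heW : excursionWinding (π / 2) Side.N Side.W Side.E = 2 * π := rfl
  have hcs : chordSign Side.N Side.W Side.E = -1 := by decide
  rw [haT] at hP
  rcases ω.sign_law hr h (π / 2) with ⟨hWE, -⟩ | ⟨hWE, -⟩ <;> rw [hz0, hz1, hz2, heW] at hWE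
  · rcases hC with hC | hC <;> rcases hP with hP | hP <;> linarith
  · rw [hcs] at hWE
    push_cast at hWE
    rcases hC with hC | hC <;> rcases hP with hP | hP <;> linarith

/-- ★ Cell NW, pattern `(N, W, S)`, wound: `WP(π/2) = 3 * π / 2`. [cite: GlazmanManolescu2019, Lemma 2.1 (proof: [Gl])] [cite: DuminilCopinSmirnov2012, proof of Lemma 1 (the winding bookkeeping)] -/
theorem WP_NW_NWS (hh : holeFaceW w ∉ D) (hr : RootedFace D (w.side .W) (farNW w)) (h : ω.IsB2a)
    (hz0 : ω.2.firstSideG = .N) (hz1 : ω.z1 hr h = .W) (hz2 : ω.1 = .S)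
    (hW : ω.WE (fun _ => π / 2) ≠ excursionWinding (π / 2) ω.2.firstSideG (ω.z1 hr h) ω.1) :
    ω.WP (fun _ => π / 2) = 3 * π / 2 := by
  have hπ := Real.pi_pos
  have hC := (WP_NW_pi_div_two_mem hh h).1 hz0
  have hP := winding_NW_NWS hh hr h hz0 hz1 hz2
  rw [winding_eq_WP_add_cell hr h] at hP
  have hWE := WE_sub_eq_of_wound_cell hr h (π / 2) hW
  rw [hz0, hz1] at hP
  rw [hz0, hz1, hz2] at hWE
  have haT : arcTurn ((fun _ : ℤ => π / 2) (farNW w).1) Side.N Side.W = -(π / 2) := rfl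
  have heW : excursionWinding (π / 2) Side.N Side.W Side.S = π + π / 2 := rfl
  have hcs : chordSign Side.N Side.W Side.S = -1 := by decide
  rw [haT] at hP
  rw [heW, hcs] at hWE
  push_cast at hWE
  rcases hC with hC | hC <;> rcases hP with hP | hP <;> first | exact hC | (exfalso; linarith)

/-- ★ Cell NW, pattern `(E, N, S)`, wound: `WP(π/2) = π`. [cite: GlazmanManolescu2019, Lemma 2.1 (proof: [Gl])] [cite: DuminilCopinSmirnov2012, proof of Lemma 1 (the winding bookkeeping)] -/
theorem WP_NW_ENS (hh : holeFaceW w ∉ D) (hr : RootedFace D (w.side .W) (farNW w)) (h : ω.IsB2a)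
    (hz0 : ω.2.firstSideG = .E) (hz1 : ω.z1 hr h = .N) (hz2 : ω.1 = .S)
    (hW : ω.WE (fun _ => π / 2) ≠ excursionWinding (π / 2) ω.2.firstSideG (ω.z1 hr h) ω.1) :
    ω.WP (fun _ => π / 2) = π := by
  have hπ := Real.pi_pos
  have hC := (WP_NW_pi_div_two_mem hh h).2.1 hz0
  have hP := winding_NW_ENS hh hr h hz0 hz1 hz2
  rw [winding_eq_WP_add_cell hr h] at hP
  have hWE := WE_sub_eq_of_wound_cell hr h (π / 2) hW
  rw [hz0, hz1] at hP
  rw [hz0, hz1, hz2] at hWE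
  have haT : arcTurn ((fun _ : ℤ => π / 2) (farNW w).1) Side.E Side.N = π / 2 - π := rfl
  have heW : excursionWinding (π / 2) Side.E Side.N Side.S = 2 * π := rfl
  have hcs : chordSign Side.E Side.N Side.S = -1 := by decide
  rw [haT] at hP
  rw [heW, hcs] at hWE
  push_cast at hWE
  rcases hC with hC | hC <;> rcases hP with hP | hP <;> first | exact hC | (exfalso; linarith)

/-- ★ Cell NW, pattern `(E, N, W)`, wound: `WP(π/2) = π`. [cite: GlazmanManolescu2019, Lemma 2.1 (proof: [Gl])] [cite: DuminilCopinSmirnov2012, proof of Lemma 1 (the winding bookkeeping)] -/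
theorem WP_NW_ENW (hh : holeFaceW w ∉ D) (hr : RootedFace D (w.side .W) (farNW w)) (h : ω.IsB2a)
    (hz0 : ω.2.firstSideG = .E) (hz1 : ω.z1 hr h = .N) (hz2 : ω.1 = .W)
    (hW : ω.WE (fun _ => π / 2) ≠ excursionWinding (π / 2) ω.2.firstSideG (ω.z1 hr h) ω.1) :
    ω.WP (fun _ => π / 2) = π := by
  have hπ := Real.pi_pos
  have hC := (WP_NW_pi_div_two_mem hh h).2.1 hz0
  have hP := winding_NW_ENW hh hr h hz0 hz1 hz2
  rw [winding_eq_WP_add_cell hr h] at hP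
  have hWE := WE_sub_eq_of_wound_cell hr h (π / 2) hW
  rw [hz0, hz1] at hP
  rw [hz0, hz1, hz2] at hWE
  have haT : arcTurn ((fun _ : ℤ => π / 2) (farNW w).1) Side.E Side.N = π / 2 - π := rfl
  have heW : excursionWinding (π / 2) Side.E Side.N Side.W = 2 * π - π / 2 := rfl
  have hcs : chordSign Side.E Side.N Side.W = -1 := by decide
  rw [haT] at hP
  rw [heW, hcs] at hWE
  push_cast at hWE
  rcases hC with hC | hC <;> rcases hP with hP | hP <;> first | exact hC | (exfalso; linarith)

/-- ★ Cell NW, pattern `(E, W, S)`, wound: `WP(π/2) = π`. [cite: GlazmanManolescu2019, Lemma 2.1 (proof: [Gl])] [cite: DuminilCopinSmirnov2012, proof of Lemma 1 (the winding bookkeeping)] -/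
theorem WP_NW_EWS (hh : holeFaceW w ∉ D) (hr : RootedFace D (w.side .W) (farNW w)) (h : ω.IsB2a)
    (hz0 : ω.2.firstSideG = .E) (hz1 : ω.z1 hr h = .W) (hz2 : ω.1 = .S)
    (hW : ω.WE (fun _ => π / 2) ≠ excursionWinding (π / 2) ω.2.firstSideG (ω.z1 hr h) ω.1) :
    ω.WP (fun _ => π / 2) = π := by
  have hπ := Real.pi_pos
  have hC := (WP_NW_pi_div_two_mem hh h).2.1 hz0
  have hP := winding_NW_EWS hh hr h hz0 hz1 hz2
  rw [winding_eq_WP_add_cell hr h] at hP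
  have hWE := WE_sub_eq_of_wound_cell hr h (π / 2) hW
  rw [hz0, hz1] at hP
  rw [hz0, hz1, hz2] at hWE
  have haT : arcTurn ((fun _ : ℤ => π / 2) (farNW w).1) Side.E Side.W = 0 := rfl
  have heW : excursionWinding (π / 2) Side.E Side.W Side.S = π + π / 2 := rfl
  have hcs : chordSign Side.E Side.W Side.S = -1 := by decide
  rw [haT] at hP
  rw [heW, hcs] at hWE
  push_cast at hWE
  rcases hC with hC | hC <;> rcases hP with hP | hP <;> first | exact hC | (exfalso; linarith)

/-- ★ Cell NW, pattern `(S, N, E)`, wound: `WP(π/2) = -(3 * π / 2)`. [cite: GlazmanManolescu2019, Lemma 2.1 (proof: [Gl])] [cite: DuminilCopinSmirnov2012, proof of Lemma 1 (the winding bookkeeping)] -/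
theorem WP_NW_SNE (hh : holeFaceW w ∉ D) (hr : RootedFace D (w.side .W) (farNW w)) (h : ω.IsB2a)
    (hz0 : ω.2.firstSideG = .S) (hz1 : ω.z1 hr h = .N) (hz2 : ω.1 = .E)
    (hW : ω.WE (fun _ => π / 2) ≠ excursionWinding (π / 2) ω.2.firstSideG (ω.z1 hr h) ω.1) :
    ω.WP (fun _ => π / 2) = -(3 * π / 2) := by
  have hπ := Real.pi_pos
  have hC := (WP_NW_pi_div_two_mem hh h).2.2.1 hz0
  have hP := winding_NW_SNE hh hr h hz0 hz1 hz2
  rw [winding_eq_WP_add_cell hr h] at hP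
  have hWE := WE_sub_eq_of_wound_cell hr h (π / 2) hW
  rw [hz0, hz1] at hP
  rw [hz0, hz1, hz2] at hWE
  have haT : arcTurn ((fun _ : ℤ => π / 2) (farNW w).1) Side.S Side.N = 0 := rfl
  have heW : excursionWinding (π / 2) Side.S Side.N Side.E = -π - π / 2 := rfl
  have hcs : chordSign Side.S Side.N Side.E = 1 := by decide
  rw [haT] at hP
  rw [heW, hcs] at hWE
  push_cast at hWE
  rcases hC with hC | hC <;> rcases hP with hP | hP <;> first | exact hC | (exfalso; linarith)

/-- ★ Cell NW, pattern `(S, W, N)`, wound: `WP(π/2) = -(3 * π / 2)`. [cite: GlazmanManolescu2019, Lemma 2.1 (proof: [Gl])] [cite: DuminilCopinSmirnov2012, proof of Lemma 1 (the winding bookkeeping)] -/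
theorem WP_NW_SWN (hh : holeFaceW w ∉ D) (hr : RootedFace D (w.side .W) (farNW w)) (h : ω.IsB2a)
    (hz0 : ω.2.firstSideG = .S) (hz1 : ω.z1 hr h = .W) (hz2 : ω.1 = .N)
    (hW : ω.WE (fun _ => π / 2) ≠ excursionWinding (π / 2) ω.2.firstSideG (ω.z1 hr h) ω.1) :
    ω.WP (fun _ => π / 2) = -(3 * π / 2) := by
  have hπ := Real.pi_pos
  have hC := (WP_NW_pi_div_two_mem hh h).2.2.1 hz0
  have hP := winding_NW_SWN hh hr h hz0 hz1 hz2
  rw [winding_eq_WP_add_cell hr h] at hP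
  have hWE := WE_sub_eq_of_wound_cell hr h (π / 2) hW
  rw [hz0, hz1] at hP
  rw [hz0, hz1, hz2] at hWE
  have haT : arcTurn ((fun _ : ℤ => π / 2) (farNW w).1) Side.S Side.W = π - π / 2 := rfl
  have heW : excursionWinding (π / 2) Side.S Side.W Side.N = -2 * π + π / 2 := rfl
  have hcs : chordSign Side.S Side.W Side.N = 1 := by decide
  rw [haT] at hP
  rw [heW, hcs] at hWE
  push_cast at hWE
  rcases hC with hC | hC <;> rcases hP with hP | hP <;> first | exact hC | (exfalso; linarith)

/-- ★ Cell NW, pattern `(S, W, E)`, wound: `WP(π/2) = -(3 * π / 2)`. [cite: GlazmanManolescu2019, Lemma 2.1 (proof: [Gl])] [cite: DuminilCopinSmirnov2012, proof of Lemma 1 (the winding bookkeeping)] -/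
theorem WP_NW_SWE (hh : holeFaceW w ∉ D) (hr : RootedFace D (w.side .W) (farNW w)) (h : ω.IsB2a)
    (hz0 : ω.2.firstSideG = .S) (hz1 : ω.z1 hr h = .W) (hz2 : ω.1 = .E)
    (hW : ω.WE (fun _ => π / 2) ≠ excursionWinding (π / 2) ω.2.firstSideG (ω.z1 hr h) ω.1) :
    ω.WP (fun _ => π / 2) = -(3 * π / 2) := by
  have hπ := Real.pi_pos
  have hC := (WP_NW_pi_div_two_mem hh h).2.2.1 hz0
  have hP := winding_NW_SWE hh hr h hz0 hz1 hz2
  rw [winding_eq_WP_add_cell hr h] at hP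
  have hWE := WE_sub_eq_of_wound_cell hr h (π / 2) hW
  rw [hz0, hz1] at hP
  rw [hz0, hz1, hz2] at hWE
  have haT : arcTurn ((fun _ : ℤ => π / 2) (farNW w).1) Side.S Side.W = π - π / 2 := rfl
  have heW : excursionWinding (π / 2) Side.S Side.W Side.E = -2 * π := rfl
  have hcs : chordSign Side.S Side.W Side.E = 1 := by decide
  rw [haT] at hP
  rw [heW, hcs] at hWE
  push_cast at hWE
  rcases hC with hC | hC <;> rcases hP with hP | hP <;> first | exact hC | (exfalso; linarith)

/-- ★ Cell NW, pattern `(W, N, E)`, wound: `WP(π/2) = -(2 * π)`. [cite: GlazmanManolescu2019, Lemma 2.1 (proof: [Gl])] [cite: DuminilCopinSmirnov2012, proof of Lemma 1 (the winding bookkeeping)] -/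
theorem WP_NW_WNE (hh : holeFaceW w ∉ D) (hr : RootedFace D (w.side .W) (farNW w)) (h : ω.IsB2a)
    (hz0 : ω.2.firstSideG = .W) (hz1 : ω.z1 hr h = .N) (hz2 : ω.1 = .E)
    (hW : ω.WE (fun _ => π / 2) ≠ excursionWinding (π / 2) ω.2.firstSideG (ω.z1 hr h) ω.1) :
    ω.WP (fun _ => π / 2) = -(2 * π) := by
  have hπ := Real.pi_pos
  have hC := (WP_NW_pi_div_two_mem hh h).2.2.2 hz0
  have hP := winding_NW_WNE hh hr h hz0 hz1 hz2
  rw [winding_eq_WP_add_cell hr h] at hP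
  have hWE := WE_sub_eq_of_wound_cell hr h (π / 2) hW
  rw [hz0, hz1] at hP
  rw [hz0, hz1, hz2] at hWE
  have haT : arcTurn ((fun _ : ℤ => π / 2) (farNW w).1) Side.W Side.N = π / 2 := rfl
  have heW : excursionWinding (π / 2) Side.W Side.N Side.E = -π - π / 2 := rfl
  have hcs : chordSign Side.W Side.N Side.E = 1 := by decide
  rw [haT] at hP
  rw [heW, hcs] at hWE
  push_cast at hWE
  rcases hC with hC | hC <;> rcases hP with hP | hP <;> first | exact hC | (exfalso; linarith)

/-- ★ Cell NW: pattern `(W, N, S)` is impossible (wound or not). [cite: GlazmanManolescu2019, Lemma 2.1 (proof: [Gl])] [cite: DuminilCopinSmirnov2012, proof of Lemma 1 (the winding bookkeeping)] -/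
theorem no_NW_WNS (hh : holeFaceW w ∉ D) (hr : RootedFace D (w.side .W) (farNW w)) (h : ω.IsB2a)
    (hz0 : ω.2.firstSideG = .W) (hz1 : ω.z1 hr h = .N) (hz2 : ω.1 = .S) : False := by
  have hπ := Real.pi_pos
  have hC := (WP_NW_pi_div_two_mem hh h).2.2.2 hz0
  have hP := winding_NW_WNS hh hr h hz0 hz1 hz2
  rw [winding_eq_WP_add_cell hr h] at hP
  rw [hz0, hz1] at hP
  have haT : arcTurn ((fun _ : ℤ => π / 2) (farNW w).1) Side.W Side.N = π / 2 := rfl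
  have heW : excursionWinding (π / 2) Side.W Side.N Side.S = -2 * π := rfl
  have hcs : chordSign Side.W Side.N Side.S = 1 := by decide
  rw [haT] at hP
  rcases ω.sign_law hr h (π / 2) with ⟨hWE, -⟩ | ⟨hWE, -⟩ <;> rw [hz0, hz1, hz2, heW] at hWE
  · rcases hC with hC | hC <;> rcases hP with hP | hP <;> linarith
  · rw [hcs] at hWE
    push_cast at hWE
    rcases hC with hC | hC <;> rcases hP with hP | hP <;> linarith

/-- ★ Cell NW: pattern `(W, E, S)` is impossible (wound or not). [cite: GlazmanManolescu2019, Lemma 2.1 (proof: [Gl])] [cite: DuminilCopinSmirnov2012, proof of Lemma 1 (the winding bookkeeping)] -/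
theorem no_NW_WES (hh : holeFaceW w ∉ D) (hr : RootedFace D (w.side .W) (farNW w)) (h : ω.IsB2a)
    (hz0 : ω.2.firstSideG = .W) (hz1 : ω.z1 hr h = .E) (hz2 : ω.1 = .S) : False := by
  have hπ := Real.pi_pos
  have hC := (WP_NW_pi_div_two_mem hh h).2.2.2 hz0
  have hP := winding_NW_WES hh hr h hz0 hz1 hz2
  rw [winding_eq_WP_add_cell hr h] at hP
  rw [hz0, hz1] at hP
  have haT : arcTurn ((fun _ : ℤ => π / 2) (farNW w).1) Side.W Side.E = 0 := rfl
  have heW : excursionWinding (π / 2) Side.W Side.E Side.S = -2 * π + π / 2 := rfl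
  have hcs : chordSign Side.W Side.E Side.S = 1 := by decide
  rw [haT] at hP
  rcases ω.sign_law hr h (π / 2) with ⟨hWE, -⟩ | ⟨hWE, -⟩ <;> rw [hz0, hz1, hz2, heW] at hWE
  · rcases hC with hC | hC <;> rcases hP with hP | hP <;> linarith
  · rw [hcs] at hWE
    push_cast at hWE
    rcases hC with hC | hC <;> rcases hP with hP | hP <;> linarith

/-- ★ Cell NW: pattern `(W, S, N)` is impossible (wound or not). [cite: GlazmanManolescu2019, Lemma 2.1 (proof: [Gl])] [cite: DuminilCopinSmirnov2012, proof of Lemma 1 (the winding bookkeeping)] -/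
theorem no_NW_WSN (hh : holeFaceW w ∉ D) (hr : RootedFace D (w.side .W) (farNW w)) (h : ω.IsB2a)
    (hz0 : ω.2.firstSideG = .W) (hz1 : ω.z1 hr h = .S) (hz2 : ω.1 = .N) : False := by
  have hπ := Real.pi_pos
  have hC := (WP_NW_pi_div_two_mem hh h).2.2.2 hz0
  have hP := winding_NW_WSN hh hr h hz0 hz1 hz2
  rw [winding_eq_WP_add_cell hr h] at hP
  rw [hz0, hz1] at hP
  have haT : arcTurn ((fun _ : ℤ => π / 2) (farNW w).1) Side.W Side.S = π / 2 - π := rfl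
  have heW : excursionWinding (π / 2) Side.W Side.S Side.N = 2 * π := rfl
  have hcs : chordSign Side.W Side.S Side.N = -1 := by decide
  rw [haT] at hP
  rcases ω.sign_law hr h (π / 2) with ⟨hWE, -⟩ | ⟨hWE, -⟩ <;> rw [hz0, hz1, hz2, heW] at hWE
  · rcases hC with hC | hC <;> rcases hP with hP | hP <;> linarith
  · rw [hcs] at hWE
    push_cast at hWE
    rcases hC with hC | hC <;> rcases hP with hP | hP <;> linarith

/-- ★ Cell NW: pattern `(W, S, E)` is impossible (wound or not). [cite: GlazmanManolescu2019, Lemma 2.1 (proof: [Gl])] [cite: DuminilCopinSmirnov2012, proof of Lemma 1 (the winding bookkeeping)] -/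
theorem no_NW_WSE (hh : holeFaceW w ∉ D) (hr : RootedFace D (w.side .W) (farNW w)) (h : ω.IsB2a)
    (hz0 : ω.2.firstSideG = .W) (hz1 : ω.z1 hr h = .S) (hz2 : ω.1 = .E) : False := by
  have hπ := Real.pi_pos
  have hC := (WP_NW_pi_div_two_mem hh h).2.2.2 hz0
  have hP := winding_NW_WSE hh hr h hz0 hz1 hz2
  rw [winding_eq_WP_add_cell hr h] at hP
  rw [hz0, hz1] at hP
  have haT : arcTurn ((fun _ : ℤ => π / 2) (farNW w).1) Side.W Side.S = π / 2 - π := rfl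
  have heW : excursionWinding (π / 2) Side.W Side.S Side.E = 2 * π - π / 2 := rfl
  have hcs : chordSign Side.W Side.S Side.E = -1 := by decide
  rw [haT] at hP
  rcases ω.sign_law hr h (π / 2) with ⟨hWE, -⟩ | ⟨hWE, -⟩ <;> rw [hz0, hz1, hz2, heW] at hWE
  · rcases hC with hC | hC <;> rcases hP with hP | hP <;> linarith
  · rw [hcs] at hWE
    push_cast at hWE
    rcases hC with hC | hC <;> rcases hP with hP | hP <;> linarith

/-- **The forced prefix turning at cell NW**, by first side (at `θ = π/2`). [cite: GlazmanManolescu2019, Lemma 2.1 (proof: [Gl])] -/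
def ringTurnNW : Side → ℝ
  | .N => 3 * π / 2
  | .E => π
  | .S => -(3 * π / 2)
  | .W => -(2 * π)

/-- The directly treated patterns at cell NW (one orientation per pinned class, both orientations of the impossible
classes). [folklore] -/
def ringPatternsNW : List (Side × Side × Side) :=
  [(.N, .E, .S), (.N, .E, .W), (.N, .S, .E), (.N, .W, .E), (.N, .W, .S), (.E, .N, .S), (.E, .N, .W), (.E, .W, .S), (.S, .N, .E), (.S, .W, .N), (.S, .W, .E), (.W, .N, .E), (.W, .N, .S), (.W, .E, .S), (.W, .S, .N), (.W, .S, .E)]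

/-- Every pattern of three distinct sides is treated directly or through its reversal. [folklore] -/
private theorem ringPatternsNW_cover : ∀ a b c : Side, a ≠ b → a ≠ c → b ≠ c →
    (a, b, c) ∈ ringPatternsNW ∨ (a, c, b) ∈ ringPatternsNW := by decide

/-- ★★ The directly treated patterns at cell NW: wound ⇒ `WP(π/2) = ringTurnNW z₀`. [cite: Hopf1935, Nr. 2 (Umlaufsatz, p. 53) and Nr. 4 eq. (22) (curves with corners, pp. 60–61)] [cite: GlazmanManolescu2019, Lemma 2.1 (proof: [Gl])] -/
theorem WP_NW_eq_of_mem (hh : holeFaceW w ∉ D) (hr : RootedFace D (w.side .W) (farNW w)) (h : ω.IsB2a)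
    (hmem : (ω.2.firstSideG, ω.z1 hr h, ω.1) ∈ ringPatternsNW)
    (hW : ω.WE (fun _ => π / 2) ≠ excursionWinding (π / 2) ω.2.firstSideG (ω.z1 hr h) ω.1) :
    ω.WP (fun _ => π / 2) = ringTurnNW ω.2.firstSideG := by
  simp only [ringPatternsNW, List.mem_cons, Prod.mk.injEq, List.mem_nil_iff, or_false] at hmem
  rcases hmem with ⟨h0, h1, h2⟩ | ⟨h0, h1, h2⟩ | ⟨h0, h1, h2⟩ | ⟨h0, h1, h2⟩ | ⟨h0, h1, h2⟩ | ⟨h0, h1, h2⟩ | ⟨h0, h1, h2⟩ | ⟨h0, h1, h2⟩ | ⟨h0, h1, h2⟩ | ⟨h0, h1, h2⟩ | ⟨h0, h1, h2⟩ | ⟨h0, h1, h2⟩ | ⟨h0, h1, h2⟩ | ⟨h0, h1, h2⟩ | ⟨h0, h1, h2⟩ | ⟨h0, h1, h2⟩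
  · exact (no_NW_NES hh hr h h0 h1 h2).elim
  · exact (no_NW_NEW hh hr h h0 h1 h2).elim
  · exact (no_NW_NSE hh hr h h0 h1 h2).elim
  · exact (no_NW_NWE hh hr h h0 h1 h2).elim
  · rw [WP_NW_NWS hh hr h h0 h1 h2 hW, h0]; rfl
  · rw [WP_NW_ENS hh hr h h0 h1 h2 hW, h0]; rfl
  · rw [WP_NW_ENW hh hr h h0 h1 h2 hW, h0]; rfl
  · rw [WP_NW_EWS hh hr h h0 h1 h2 hW, h0]; rfl
  · rw [WP_NW_SNE hh hr h h0 h1 h2 hW, h0]; rfl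
  · rw [WP_NW_SWN hh hr h h0 h1 h2 hW, h0]; rfl
  · rw [WP_NW_SWE hh hr h h0 h1 h2 hW, h0]; rfl
  · rw [WP_NW_WNE hh hr h h0 h1 h2 hW, h0]; rfl
  · exact (no_NW_WNS hh hr h h0 h1 h2).elim
  · exact (no_NW_WES hh hr h h0 h1 h2).elim
  · exact (no_NW_WSN hh hr h h0 h1 h2).elim
  · exact (no_NW_WSE hh hr h h0 h1 h2).elim

/-- ★★★ **THE TURNING RIGIDITY AT CELL NW (θ = π/2)**: for every WOUND class-`B2a` walk of the hole root `w.side W` at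
the cell `NW` of the hole (north of the far cell), the right-angle turning of the prefix is `ringTurnNW z₀` — fixed by the first side alone.
[cite: Hopf1935, Nr. 2 (Umlaufsatz, p. 53) and Nr. 4 eq. (22) (curves with corners, pp. 60–61)] [cite: GlazmanManolescu2019, Lemma 2.1 (proof: [Gl])] [cite: DuminilCopinSmirnov2012, proof of Lemma 1 (the winding bookkeeping)] -/
theorem WP_NW_pi_div_two_eq_of_wound (hh : holeFaceW w ∉ D) (hr : RootedFace D (w.side .W) (farNW w))
    (h : ω.IsB2a) (hW : ω.WE (fun _ => π / 2) ≠ excursionWinding (π / 2) ω.2.firstSideG (ω.z1 hr h) ω.1) :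
    ω.WP (fun _ => π / 2) = ringTurnNW ω.2.firstSideG := by
  obtain ⟨hz01, hz02, hz12⟩ := ω.firstSide_exit_return_distinct hr h
  rcases ringPatternsNW_cover _ _ _ hz01 hz02 hz12 with hd | hd
  · exact WP_NW_eq_of_mem hh hr h hd hW
  · have h'' := ω.rev_isB2a hr h
    have e1 : (ω.rev hr).z1 hr h'' = ω.1 := by unfold ΩG.z1; exact ω.rev_exitSide hr h
    have e2 : (ω.rev hr).1 = ω.z1 hr h := ω.rev_fst hr h
    have e0 : (ω.rev hr).2.firstSideG = ω.2.firstSideG := ω.rev_firstSide hr h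
    have hWr : (ω.rev hr).WE (fun _ => π / 2) ≠
        excursionWinding (π / 2) (ω.rev hr).2.firstSideG ((ω.rev hr).z1 hr h'') (ω.rev hr).1 := by
      rw [ω.rev_WE (fun _ => π / 2) hr h, e0, e1, e2, excursionWinding_swap]
      intro e; apply hW; linarith
    have key := WP_NW_eq_of_mem (ω := ω.rev hr) hh hr h'' (by rw [e0, e1, e2]; exact hd) hWr
    rwa [ω.rev_WP (fun _ => π / 2) hr h, e0] at key

/-- ★★ **ENTRY–EXIT EXCLUSION AT CELL NW** (wound or not): a walk that entered from `N` never uses the side `E`; a walk that entered from `W` never uses the side `S`. [cite: Hopf1935, Nr. 2 (Umlaufsatz, p. 53) and Nr. 4 eq. (22) (curves with corners, pp. 60–61)] [cite: GlazmanManolescu2019, Lemma 2.1 (proof: [Gl])] -/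
theorem NW_entry_exit_exclusion (hh : holeFaceW w ∉ D) (hr : RootedFace D (w.side .W) (farNW w)) (h : ω.IsB2a) :
    (ω.2.firstSideG = .N → ω.z1 hr h ≠ .E ∧ ω.1 ≠ .E) ∧
      (ω.2.firstSideG = .W → ω.z1 hr h ≠ .S ∧ ω.1 ≠ .S) := by
  obtain ⟨hz01, hz02, hz12⟩ := ω.firstSide_exit_return_distinct hr h
  constructor
  · intro hz0
    constructor
    · intro hz1
      rcases hω : ω.1 with _ | _ | _ | _
      · exact no_NW_NEW hh hr h hz0 hz1 hω
      · rw [hz1, hω] at hz12; exact hz12 rfl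
      · exact no_NW_NES hh hr h hz0 hz1 hω
      · rw [hz0, hω] at hz02; exact hz02 rfl
    · intro hz2
      rcases hω : ω.z1 hr h with _ | _ | _ | _
      · exact no_NW_NWE hh hr h hz0 hω hz2
      · rw [hz2, hω] at hz12; exact hz12 rfl
      · exact no_NW_NSE hh hr h hz0 hω hz2
      · rw [hz0, hω] at hz01; exact hz01 rfl
  · intro hz0
    constructor
    · intro hz1
      rcases hω : ω.1 with _ | _ | _ | _
      · rw [hz0, hω] at hz02; exact hz02 rfl
      · exact no_NW_WSE hh hr h hz0 hz1 hω
      · rw [hz1, hω] at hz12; exact hz12 rfl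
      · exact no_NW_WSN hh hr h hz0 hz1 hω
    · intro hz2
      rcases hω : ω.z1 hr h with _ | _ | _ | _
      · rw [hz0, hω] at hz01; exact hz01 rfl
      · exact no_NW_WES hh hr h hz0 hω hz2
      · rw [hz2, hω] at hz12; exact hz12 rfl
      · exact no_NW_WNS hh hr h hz0 hω hz2

/-- ★★★ **THE TURNING RIGIDITY AT CELL NW, every angle**: for every WOUND class-`B2a` walk at the cell `NW` of the hole (north of the far cell)
(hole `holeFaceW w ∉ D`): `N` ⇒ `θ + π`, `E` ⇒ `π`, `S` ⇒ `θ - 2 * π`, `W` ⇒ `-(2 * π)`. [cite: Hopf1935, Nr. 2 (Umlaufsatz, p. 53) and Nr. 4 eq. (22) (curves with corners, pp. 60–61)] [cite: GlazmanManolescu2019, Lemma 2.1 (proof: [Gl])] [cite: DuminilCopinSmirnov2012, proof of Lemma 1 (the winding bookkeeping)] -/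
theorem WP_NW_eq_of_wound (hh : holeFaceW w ∉ D) (hr : RootedFace D (w.side .W) (farNW w)) (h : ω.IsB2a)
    (θ : ℝ) (hW : ω.WE (fun _ => θ) ≠ excursionWinding θ ω.2.firstSideG (ω.z1 hr h) ω.1) :
    (ω.2.firstSideG = .N → ω.WP (fun _ => θ) = θ + π) ∧
      (ω.2.firstSideG = .E → ω.WP (fun _ => θ) = π) ∧
      (ω.2.firstSideG = .S → ω.WP (fun _ => θ) = θ - 2 * π) ∧
      (ω.2.firstSideG = .W → ω.WP (fun _ => θ) = -(2 * π)) := by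
  have hW' : ω.WE (fun _ => π / 2) ≠ excursionWinding (π / 2) ω.2.firstSideG (ω.z1 hr h) ω.1 := by
    intro e; apply hW
    have := WE_sub_excursionWinding_const_cell (ω := ω) hr h θ
    linarith
  have key := WP_NW_pi_div_two_eq_of_wound hh hr h hW'
  have htr := WP_cell_of_pinned (ω := ω) h θ key
  refine ⟨fun hz => ?_, fun hz => ?_, fun hz => ?_, fun hz => ?_⟩ <;> rw [htr, hz] <;>
    simp only [ringTurnNW, Side.slantInd] <;> ring

end CellNW

end ΩG

/-! ## § Ring cell LS: the lateral cell SOUTH of the hole (`latS`, dead side `N`) — instances, pinning, assembly -/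

namespace ΩG

variable {D : Set Face} {w : Face} {ω : ΩG D (w.side .W) (latS w)}

section CellLS

/-- ★★ **The prefix turns by one of two values** at the lateral cell SOUTH of the hole (`latS`, dead side `N`): `E`: `{3 * π, -π}`; `S`: `{5 * π / 2, -(3 * π / 2)}`; `W`: `{2 * π, -(2 * π)}`. [cite: Hopf1935, Nr. 2 (Umlaufsatz, p. 53) and Nr. 4 eq. (22) (curves with corners, pp. 60–61)] [cite: GlazmanManolescu2019, Lemma 2.1 (proof: [Gl])] -/
theorem WP_LS_pi_div_two_mem (hh : holeFaceW w ∉ D) (h : ω.IsB2a) :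
    (ω.2.firstSideG = .E → ω.WP (fun _ => π / 2) = 3 * π ∨ ω.WP (fun _ => π / 2) = -π) ∧
      (ω.2.firstSideG = .S → ω.WP (fun _ => π / 2) = 5 * π / 2 ∨ ω.WP (fun _ => π / 2) = -(3 * π / 2)) ∧
      (ω.2.firstSideG = .W → ω.WP (fun _ => π / 2) = 2 * π ∨ ω.WP (fun _ => π / 2) = -(2 * π)) := by
  have hπ := Real.pi_pos
  refine ⟨fun hz => ?_, fun hz => ?_, fun hz => ?_⟩
  · have key := WP_hopf_of_tables_cell (ω := ω) hh (latS_side_ne_root w) h (latS_base w) safeOffsetsLS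
      five_le_dsq_innerPt_safeOffsetsLS [((7 : ℤ), (3 : ℤ)), (6, 4), (6, 6)] (by simp)
      (by rw [hz]; decide) (by decide) (by rw [hz]; decide) (by rw [hz]; decide) (by rw [hz]; decide)
    rw [hz] at key
    have e : triplesTurn (((4, 0) + (Side.E.offset - Side.E.nIn)) :: ((4, 0) + Side.E.offset) ::
        ([((7 : ℤ), (3 : ℤ)), (6, 4), (6, 6)] ++ [(8, 6), (9, 6)])) = -4 := by decide
    rw [e] at key
    push_cast at key
    rcases key with k | k
    · left; linarith
    · right; linarith
  · have key := WP_hopf_of_tables_cell (ω := ω) hh (latS_side_ne_root w) h (latS_base w) safeOffsetsLS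
      five_le_dsq_innerPt_safeOffsetsLS [((6 : ℤ), (2 : ℤ)), (6, 4), (6, 6)] (by simp)
      (by rw [hz]; decide) (by decide) (by rw [hz]; decide) (by rw [hz]; decide) (by rw [hz]; decide)
    rw [hz] at key
    have e : triplesTurn (((4, 0) + (Side.S.offset - Side.S.nIn)) :: ((4, 0) + Side.S.offset) ::
        ([((6 : ℤ), (2 : ℤ)), (6, 4), (6, 6)] ++ [(8, 6), (9, 6)])) = -2 := by decide
    rw [e] at key
    push_cast at key
    rcases key with k | k
    · left; linarith
    · right; linarith
  · have key := WP_hopf_of_tables_cell (ω := ω) hh (latS_side_ne_root w) h (latS_base w) safeOffsetsLS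
      five_le_dsq_innerPt_safeOffsetsLS [((5 : ℤ), (3 : ℤ)), (6, 4), (6, 6)] (by simp)
      (by rw [hz]; decide) (by decide) (by rw [hz]; decide) (by rw [hz]; decide) (by rw [hz]; decide)
    rw [hz] at key
    have e : triplesTurn (((4, 0) + (Side.W.offset - Side.W.nIn)) :: ((4, 0) + Side.W.offset) ::
        ([((5 : ℤ), (3 : ℤ)), (6, 4), (6, 6)] ++ [(8, 6), (9, 6)])) = 0 := by decide
    rw [e] at key
    push_cast at key
    rcases key with k | k
    · left; linarith
    · right; linarith

/-- Whole-walk Umlaufsatz, cell LS, pattern `(E, S, W)`. [cite: Hopf1935, Nr. 2 (Umlaufsatz, p. 53) and Nr. 4 eq. (22) (curves with corners, pp. 60–61)] -/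
theorem winding_LS_ESW (hh : holeFaceW w ∉ D) (hr : RootedFace D (w.side .W) (latS w)) (h : ω.IsB2a)
    (hz0 : ω.2.firstSideG = .E) (hz1 : ω.z1 hr h = .S) (hz2 : ω.1 = .W) :
    ω.2.winding (fun _ => π / 2) = 2 * π ∨ ω.2.winding (fun _ => π / 2) = -(2 * π) := by
  have hπ := Real.pi_pos
  have key := winding_hopf_of_tables_cell hh hr h (latS_base w) safeOffsetsLS five_le_dsq_innerPt_safeOffsetsLS
    [((5 : ℤ), (3 : ℤ)), (6, 4), (6, 6)] (by simp)
    (by rw [hz0, hz1, hz2]; decide) (by decide) (by rw [hz0, hz1, hz2]; decide) (by rw [hz0, hz1, hz2]; decide)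
    (by rw [hz2]; decide)
  have e : triplesTurn (((4, 0) + ((ω.1).offset - (ω.1).nIn)) :: ((4, 0) + (ω.1).offset) ::
      ([((5 : ℤ), (3 : ℤ)), (6, 4), (6, 6)] ++ [(8, 6), (9, 6)])) = 0 := by rw [hz2]; decide
  rw [e] at key
  push_cast at key
  rcases key with k | k
  · left; linarith
  · right; linarith

/-- Whole-walk Umlaufsatz, cell LS, pattern `(S, E, W)`. [cite: Hopf1935, Nr. 2 (Umlaufsatz, p. 53) and Nr. 4 eq. (22) (curves with corners, pp. 60–61)] -/
theorem winding_LS_SEW (hh : holeFaceW w ∉ D) (hr : RootedFace D (w.side .W) (latS w)) (h : ω.IsB2a)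
    (hz0 : ω.2.firstSideG = .S) (hz1 : ω.z1 hr h = .E) (hz2 : ω.1 = .W) :
    ω.2.winding (fun _ => π / 2) = 2 * π ∨ ω.2.winding (fun _ => π / 2) = -(2 * π) := by
  have hπ := Real.pi_pos
  have key := winding_hopf_of_tables_cell hh hr h (latS_base w) safeOffsetsLS five_le_dsq_innerPt_safeOffsetsLS
    [((5 : ℤ), (3 : ℤ)), (6, 4), (6, 6)] (by simp)
    (by rw [hz0, hz1, hz2]; decide) (by decide) (by rw [hz0, hz1, hz2]; decide) (by rw [hz0, hz1, hz2]; decide)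
    (by rw [hz2]; decide)
  have e : triplesTurn (((4, 0) + ((ω.1).offset - (ω.1).nIn)) :: ((4, 0) + (ω.1).offset) ::
      ([((5 : ℤ), (3 : ℤ)), (6, 4), (6, 6)] ++ [(8, 6), (9, 6)])) = 0 := by rw [hz2]; decide
  rw [e] at key
  push_cast at key
  rcases key with k | k
  · left; linarith
  · right; linarith

/-- Whole-walk Umlaufsatz, cell LS, pattern `(S, W, E)`. [cite: Hopf1935, Nr. 2 (Umlaufsatz, p. 53) and Nr. 4 eq. (22) (curves with corners, pp. 60–61)] -/
theorem winding_LS_SWE (hh : holeFaceW w ∉ D) (hr : RootedFace D (w.side .W) (latS w)) (h : ω.IsB2a)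
    (hz0 : ω.2.firstSideG = .S) (hz1 : ω.z1 hr h = .W) (hz2 : ω.1 = .E) :
    ω.2.winding (fun _ => π / 2) = 3 * π ∨ ω.2.winding (fun _ => π / 2) = -π := by
  have hπ := Real.pi_pos
  have key := winding_hopf_of_tables_cell hh hr h (latS_base w) safeOffsetsLS five_le_dsq_innerPt_safeOffsetsLS
    [((7 : ℤ), (3 : ℤ)), (6, 4), (6, 6)] (by simp)
    (by rw [hz0, hz1, hz2]; decide) (by decide) (by rw [hz0, hz1, hz2]; decide) (by rw [hz0, hz1, hz2]; decide)
    (by rw [hz2]; decide)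
  have e : triplesTurn (((4, 0) + ((ω.1).offset - (ω.1).nIn)) :: ((4, 0) + (ω.1).offset) ::
      ([((7 : ℤ), (3 : ℤ)), (6, 4), (6, 6)] ++ [(8, 6), (9, 6)])) = -4 := by rw [hz2]; decide
  rw [e] at key
  push_cast at key
  rcases key with k | k
  · left; linarith
  · right; linarith

/-- Whole-walk Umlaufsatz, cell LS, pattern `(W, S, E)`. [cite: Hopf1935, Nr. 2 (Umlaufsatz, p. 53) and Nr. 4 eq. (22) (curves with corners, pp. 60–61)] -/
theorem winding_LS_WSE (hh : holeFaceW w ∉ D) (hr : RootedFace D (w.side .W) (latS w)) (h : ω.IsB2a)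
    (hz0 : ω.2.firstSideG = .W) (hz1 : ω.z1 hr h = .S) (hz2 : ω.1 = .E) :
    ω.2.winding (fun _ => π / 2) = 3 * π ∨ ω.2.winding (fun _ => π / 2) = -π := by
  have hπ := Real.pi_pos
  have key := winding_hopf_of_tables_cell hh hr h (latS_base w) safeOffsetsLS five_le_dsq_innerPt_safeOffsetsLS
    [((7 : ℤ), (3 : ℤ)), (6, 4), (6, 6)] (by simp)
    (by rw [hz0, hz1, hz2]; decide) (by decide) (by rw [hz0, hz1, hz2]; decide) (by rw [hz0, hz1, hz2]; decide)
    (by rw [hz2]; decide)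
  have e : triplesTurn (((4, 0) + ((ω.1).offset - (ω.1).nIn)) :: ((4, 0) + (ω.1).offset) ::
      ([((7 : ℤ), (3 : ℤ)), (6, 4), (6, 6)] ++ [(8, 6), (9, 6)])) = -4 := by rw [hz2]; decide
  rw [e] at key
  push_cast at key
  rcases key with k | k
  · left; linarith
  · right; linarith

/-- ★ Cell LS, pattern `(E, S, W)`, wound: `WP(π/2) = -π`. [cite: GlazmanManolescu2019, Lemma 2.1 (proof: [Gl])] [cite: DuminilCopinSmirnov2012, proof of Lemma 1 (the winding bookkeeping)] -/
theorem WP_LS_ESW (hh : holeFaceW w ∉ D) (hr : RootedFace D (w.side .W) (latS w)) (h : ω.IsB2a)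
    (hz0 : ω.2.firstSideG = .E) (hz1 : ω.z1 hr h = .S) (hz2 : ω.1 = .W)
    (hW : ω.WE (fun _ => π / 2) ≠ excursionWinding (π / 2) ω.2.firstSideG (ω.z1 hr h) ω.1) :
    ω.WP (fun _ => π / 2) = -π := by
  have hπ := Real.pi_pos
  have hC := (WP_LS_pi_div_two_mem hh h).1 hz0
  have hP := winding_LS_ESW hh hr h hz0 hz1 hz2
  rw [winding_eq_WP_add_cell hr h] at hP
  have hWE := WE_sub_eq_of_wound_cell hr h (π / 2) hW
  rw [hz0, hz1] at hP
  rw [hz0, hz1, hz2] at hWE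
  have haT : arcTurn ((fun _ : ℤ => π / 2) (latS w).1) Side.E Side.S = π / 2 := rfl
  have heW : excursionWinding (π / 2) Side.E Side.S Side.W = -π - π / 2 := rfl
  have hcs : chordSign Side.E Side.S Side.W = 1 := by decide
  rw [haT] at hP
  rw [heW, hcs] at hWE
  push_cast at hWE
  rcases hC with hC | hC <;> rcases hP with hP | hP <;> first | exact hC | (exfalso; linarith)

/-- ★ Cell LS: pattern `(S, E, W)` is impossible (wound or not). [cite: GlazmanManolescu2019, Lemma 2.1 (proof: [Gl])] [cite: DuminilCopinSmirnov2012, proof of Lemma 1 (the winding bookkeeping)] -/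
theorem no_LS_SEW (hh : holeFaceW w ∉ D) (hr : RootedFace D (w.side .W) (latS w)) (h : ω.IsB2a)
    (hz0 : ω.2.firstSideG = .S) (hz1 : ω.z1 hr h = .E) (hz2 : ω.1 = .W) : False := by
  have hπ := Real.pi_pos
  have hC := (WP_LS_pi_div_two_mem hh h).2.1 hz0
  have hP := winding_LS_SEW hh hr h hz0 hz1 hz2
  rw [winding_eq_WP_add_cell hr h] at hP
  rw [hz0, hz1] at hP
  have haT : arcTurn ((fun _ : ℤ => π / 2) (latS w).1) Side.S Side.E = -(π / 2) := rfl
  have heW : excursionWinding (π / 2) Side.S Side.E Side.W = 2 * π := rfl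
  have hcs : chordSign Side.S Side.E Side.W = -1 := by decide
  rw [haT] at hP
  rcases ω.sign_law hr h (π / 2) with ⟨hWE, -⟩ | ⟨hWE, -⟩ <;> rw [hz0, hz1, hz2, heW] at hWE
  · rcases hC with hC | hC <;> rcases hP with hP | hP <;> linarith
  · rw [hcs] at hWE
    push_cast at hWE
    rcases hC with hC | hC <;> rcases hP with hP | hP <;> linarith

/-- ★ Cell LS: pattern `(S, W, E)` is impossible (wound or not). [cite: GlazmanManolescu2019, Lemma 2.1 (proof: [Gl])] [cite: DuminilCopinSmirnov2012, proof of Lemma 1 (the winding bookkeeping)] -/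
theorem no_LS_SWE (hh : holeFaceW w ∉ D) (hr : RootedFace D (w.side .W) (latS w)) (h : ω.IsB2a)
    (hz0 : ω.2.firstSideG = .S) (hz1 : ω.z1 hr h = .W) (hz2 : ω.1 = .E) : False := by
  have hπ := Real.pi_pos
  have hC := (WP_LS_pi_div_two_mem hh h).2.1 hz0
  have hP := winding_LS_SWE hh hr h hz0 hz1 hz2
  rw [winding_eq_WP_add_cell hr h] at hP
  rw [hz0, hz1] at hP
  have haT : arcTurn ((fun _ : ℤ => π / 2) (latS w).1) Side.S Side.W = π - π / 2 := rfl
  have heW : excursionWinding (π / 2) Side.S Side.W Side.E = -2 * π := rfl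
  have hcs : chordSign Side.S Side.W Side.E = 1 := by decide
  rw [haT] at hP
  rcases ω.sign_law hr h (π / 2) with ⟨hWE, -⟩ | ⟨hWE, -⟩ <;> rw [hz0, hz1, hz2, heW] at hWE
  · rcases hC with hC | hC <;> rcases hP with hP | hP <;> linarith
  · rw [hcs] at hWE
    push_cast at hWE
    rcases hC with hC | hC <;> rcases hP with hP | hP <;> linarith

/-- ★ Cell LS, pattern `(W, S, E)`, wound: `WP(π/2) = 2 * π`. [cite: GlazmanManolescu2019, Lemma 2.1 (proof: [Gl])] [cite: DuminilCopinSmirnov2012, proof of Lemma 1 (the winding bookkeeping)] -/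
theorem WP_LS_WSE (hh : holeFaceW w ∉ D) (hr : RootedFace D (w.side .W) (latS w)) (h : ω.IsB2a)
    (hz0 : ω.2.firstSideG = .W) (hz1 : ω.z1 hr h = .S) (hz2 : ω.1 = .E)
    (hW : ω.WE (fun _ => π / 2) ≠ excursionWinding (π / 2) ω.2.firstSideG (ω.z1 hr h) ω.1) :
    ω.WP (fun _ => π / 2) = 2 * π := by
  have hπ := Real.pi_pos
  have hC := (WP_LS_pi_div_two_mem hh h).2.2 hz0
  have hP := winding_LS_WSE hh hr h hz0 hz1 hz2
  rw [winding_eq_WP_add_cell hr h] at hP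
  have hWE := WE_sub_eq_of_wound_cell hr h (π / 2) hW
  rw [hz0, hz1] at hP
  rw [hz0, hz1, hz2] at hWE
  have haT : arcTurn ((fun _ : ℤ => π / 2) (latS w).1) Side.W Side.S = π / 2 - π := rfl
  have heW : excursionWinding (π / 2) Side.W Side.S Side.E = 2 * π - π / 2 := rfl
  have hcs : chordSign Side.W Side.S Side.E = -1 := by decide
  rw [haT] at hP
  rw [heW, hcs] at hWE
  push_cast at hWE
  rcases hC with hC | hC <;> rcases hP with hP | hP <;> first | exact hC | (exfalso; linarith)

/-- **The forced prefix turning at cell LS**, by first side (at `θ = π/2`; junk `0` on the sides `N`, `S`, which do not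
occur). [cite: GlazmanManolescu2019, Lemma 2.1 (proof: [Gl])] -/
def ringTurnLS : Side → ℝ
  | .N => 0
  | .E => -π
  | .S => 0
  | .W => 2 * π

/-- The directly treated patterns at cell LS. [folklore] -/
def ringPatternsLS : List (Side × Side × Side) :=
  [(.E, .S, .W), (.S, .E, .W), (.S, .W, .E), (.W, .S, .E)]

/-- Every pattern of three distinct sides avoiding the dead side `N` is treated directly or through its reversal. [folklore] -/
private theorem ringPatternsLS_cover : ∀ a b c : Side, a ≠ b → a ≠ c → b ≠ c → a ≠ .N → b ≠ .N → c ≠ .N →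
    (a, b, c) ∈ ringPatternsLS ∨ (a, c, b) ∈ ringPatternsLS := by decide

/-- The `N` side of `latS` is the `S` side of the hole. [cite: GlazmanManolescu2019, §1 (the lattice of rhombi and its mid-edges)] -/
theorem latS_side_N_faces (w : Face) : ((latS w).side .N).faces = (latS w, holeFaceW w) := by
  obtain ⟨k, j⟩ := w
  simp only [latS, holeFaceW, Face.side, MidEdge.faces]
  refine Prod.ext (Prod.ext rfl ?_) (Prod.ext rfl ?_)
  · show j - 1 + 1 - 1 = j - 1
    omega
  · show j - 1 + 1 = j
    omega

/-- ★ **The dead side**: no class-`B2a` walk at `latS` first enters it from `N` (the face across `N` is the hole), and none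
exits or returns through `N`. [cite: Glazman2015WeightedSAW, Lemma 3.1 (proof, pp. 6–7: the classes of walks through a rhombus)] -/
theorem LS_sides_ne_N (hh : holeFaceW w ∉ D) (hr : RootedFace D (w.side .W) (latS w)) (h : ω.IsB2a) :
    ω.2.firstSideG ≠ .N ∧ ω.z1 hr h ≠ .N ∧ ω.1 ≠ .N := by
  have hdoors := ω.exit_return_doors hr h
  refine ⟨fun hz => ?_, fun e => ?_, fun e => ?_⟩
  · obtain ⟨hs, ht⟩ := preC_sOut_last (ω := ω) hh (latS_side_ne_root w) h
    obtain ⟨hD, hne, -⟩ := preC_fc (ω := ω) hh h (i := ω.2.firstHitG - 1)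
      (by have := fhC_pos (latS_side_ne_root w) ω; omega)
    rw [hz] at ht
    have hcases := (Face.exists_side_eq_iff _ _).1 ⟨_, ht⟩
    rw [latS_side_N_faces] at hcases
    rcases hcases with e | e
    · exact hne e
    · have e' : (ω.preC h).fc (ω.2.firstHitG - 1) = holeFaceW w := e
      rw [e'] at hD
      exact hh hD
  · rw [e, latS_side_N_faces] at hdoors; exact hh hdoors.1.2
  · rw [e, latS_side_N_faces] at hdoors; exact hh hdoors.2.2

/-- ★★ The directly treated patterns at cell LS: wound ⇒ `WP(π/2) = ringTurnLS z₀`. [cite: Hopf1935, Nr. 2 (Umlaufsatz, p. 53) and Nr. 4 eq. (22) (curves with corners, pp. 60–61)] [cite: GlazmanManolescu2019, Lemma 2.1 (proof: [Gl])] -/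
theorem WP_LS_eq_of_mem (hh : holeFaceW w ∉ D) (hr : RootedFace D (w.side .W) (latS w)) (h : ω.IsB2a)
    (hmem : (ω.2.firstSideG, ω.z1 hr h, ω.1) ∈ ringPatternsLS)
    (hW : ω.WE (fun _ => π / 2) ≠ excursionWinding (π / 2) ω.2.firstSideG (ω.z1 hr h) ω.1) :
    ω.WP (fun _ => π / 2) = ringTurnLS ω.2.firstSideG := by
  simp only [ringPatternsLS, List.mem_cons, Prod.mk.injEq, List.mem_nil_iff, or_false] at hmem
  rcases hmem with ⟨h0, h1, h2⟩ | ⟨h0, h1, h2⟩ | ⟨h0, h1, h2⟩ | ⟨h0, h1, h2⟩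
  · rw [WP_LS_ESW hh hr h h0 h1 h2 hW, h0]; rfl
  · exact (no_LS_SEW hh hr h h0 h1 h2).elim
  · exact (no_LS_SWE hh hr h h0 h1 h2).elim
  · rw [WP_LS_WSE hh hr h h0 h1 h2 hW, h0]; rfl

/-- ★★★ **THE TURNING RIGIDITY AT THE SOUTH LATERAL CELL (θ = π/2)**: for every WOUND class-`B2a` walk of the hole
root `w.side W` at `latS w`, `WP(π/2) = ringTurnLS z₀` (`E ↦ −π`, `W ↦ 2π`). [cite: Hopf1935, Nr. 2 (Umlaufsatz, p. 53) and Nr. 4 eq. (22) (curves with corners, pp. 60–61)] [cite: GlazmanManolescu2019, Lemma 2.1 (proof: [Gl])] [cite: DuminilCopinSmirnov2012, proof of Lemma 1 (the winding bookkeeping)] -/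
theorem WP_LS_pi_div_two_eq_of_wound (hh : holeFaceW w ∉ D) (hr : RootedFace D (w.side .W) (latS w))
    (h : ω.IsB2a) (hW : ω.WE (fun _ => π / 2) ≠ excursionWinding (π / 2) ω.2.firstSideG (ω.z1 hr h) ω.1) :
    ω.WP (fun _ => π / 2) = ringTurnLS ω.2.firstSideG := by
  obtain ⟨hz01, hz02, hz12⟩ := ω.firstSide_exit_return_distinct hr h
  obtain ⟨hN0, hN1, hN2⟩ := LS_sides_ne_N hh hr h
  rcases ringPatternsLS_cover _ _ _ hz01 hz02 hz12 hN0 hN1 hN2 with hd | hd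
  · exact WP_LS_eq_of_mem hh hr h hd hW
  · have h'' := ω.rev_isB2a hr h
    have e1 : (ω.rev hr).z1 hr h'' = ω.1 := by unfold ΩG.z1; exact ω.rev_exitSide hr h
    have e2 : (ω.rev hr).1 = ω.z1 hr h := ω.rev_fst hr h
    have e0 : (ω.rev hr).2.firstSideG = ω.2.firstSideG := ω.rev_firstSide hr h
    have hWr : (ω.rev hr).WE (fun _ => π / 2) ≠
        excursionWinding (π / 2) (ω.rev hr).2.firstSideG ((ω.rev hr).z1 hr h'') (ω.rev hr).1 := by
      rw [ω.rev_WE (fun _ => π / 2) hr h, e0, e1, e2, excursionWinding_swap]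
      intro e; apply hW; linarith
    have key := WP_LS_eq_of_mem (ω := ω.rev hr) hh hr h'' (by rw [e0, e1, e2]; exact hd) hWr
    rwa [ω.rev_WP (fun _ => π / 2) hr h, e0] at key

/-- ★★ **AT THE SOUTH LATERAL CELL EVERY class-`B2a` WALK ENTERS FROM `E` OR FROM `W`** (wound or not; the companion
file's (R1) needed woundness): an `S`-entry would need an excursion joining the `E` and `W` sides of `latS`, which the
two Umlaufsätze exclude. [cite: Hopf1935, Nr. 2 (Umlaufsatz, p. 53) and Nr. 4 eq. (22) (curves with corners, pp. 60–61)] [cite: GlazmanManolescu2019, Lemma 2.1 (proof: [Gl])] -/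
theorem LS_firstSide_eq_E_or_W (hh : holeFaceW w ∉ D) (hr : RootedFace D (w.side .W) (latS w)) (h : ω.IsB2a) :
    ω.2.firstSideG = .E ∨ ω.2.firstSideG = .W := by
  obtain ⟨hz01, hz02, hz12⟩ := ω.firstSide_exit_return_distinct hr h
  obtain ⟨hN0, hN1, hN2⟩ := LS_sides_ne_N hh hr h
  rcases hz0 : ω.2.firstSideG with _ | _ | _ | _
  · exact Or.inr rfl
  · exact Or.inl rfl
  · exfalso
    rw [hz0] at hz01 hz02
    rcases hω1 : ω.z1 hr h with _ | _ | _ | _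
    · rcases hω2 : ω.1 with _ | _ | _ | _
      · rw [hω1, hω2] at hz12; exact hz12 rfl
      · exact no_LS_SWE hh hr h hz0 hω1 hω2
      · exact hz02 hω2.symm
      · exact hN2 hω2
    · rcases hω2 : ω.1 with _ | _ | _ | _
      · exact no_LS_SEW hh hr h hz0 hω1 hω2
      · rw [hω1, hω2] at hz12; exact hz12 rfl
      · exact hz02 hω2.symm
      · exact hN2 hω2
    · exact hz01 hω1.symm
    · exact hN1 hω1
  · exact absurd hz0 hN0

/-- ★★★ **THE TURNING RIGIDITY AT THE SOUTH LATERAL CELL, every angle**: wound ⇒ `E ↦ −π`, `W ↦ 2π` (the row-mirror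
images of the lateral file's `π`, `−2π` at `latN`). [cite: Hopf1935, Nr. 2 (Umlaufsatz, p. 53) and Nr. 4 eq. (22) (curves with corners, pp. 60–61)] [cite: GlazmanManolescu2019, Lemma 2.1 (proof: [Gl])] [cite: DuminilCopinSmirnov2012, proof of Lemma 1 (the winding bookkeeping)] -/
theorem WP_LS_eq_of_wound (hh : holeFaceW w ∉ D) (hr : RootedFace D (w.side .W) (latS w)) (h : ω.IsB2a)
    (θ : ℝ) (hW : ω.WE (fun _ => θ) ≠ excursionWinding θ ω.2.firstSideG (ω.z1 hr h) ω.1) :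
    (ω.2.firstSideG = .E → ω.WP (fun _ => θ) = -π) ∧ (ω.2.firstSideG = .W → ω.WP (fun _ => θ) = 2 * π) := by
  have hW' : ω.WE (fun _ => π / 2) ≠ excursionWinding (π / 2) ω.2.firstSideG (ω.z1 hr h) ω.1 := by
    intro e; apply hW
    have := WE_sub_excursionWinding_const_cell (ω := ω) hr h θ
    linarith
  have key := WP_LS_pi_div_two_eq_of_wound hh hr h hW'
  have htr := WP_cell_of_pinned (ω := ω) h θ key
  refine ⟨fun hz => ?_, fun hz => ?_⟩ <;> rw [htr, hz] <;> simp only [ringTurnLS, Side.slantInd] <;> ring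

end CellLS

end ΩG

end Literature.Probability.RandomPlanarGeometry.SAW.YangBaxter
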